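import Literature.MathematicalPhysics.QuantumFieldTheory.Balaban1983to89.T4PathVarianceRate
import Literature.MathematicalPhysics.QuantumFieldTheory.Balaban1983to89.T4ShellSuppressionRoute

/-!
# RUNG (B)+1, NODE U5 (NE7), PROVER SEAT P2 (weight route), GEN 11: WHAT THE SINGLE-RUN LARGE-FIELD WEIGHTS BUY IN THE
# SECANT CURRENCY — the exact split of the produced rate `gbRate`, the final-scale floor (necessity), and the window
# cost of the square root (ADDITIVE LEAF on `T4PathVarianceRate` v1.1 (t4-ne7-p3 gen 5, p189032) + this lane's
# `T4ShellSuppressionRoute` v1.3 (p185518), both re-used BY NAME; no existing module is modified; no importer;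
# cell `pub-balaban`, scoping sub-cell `t4`, unit `b2b-balaban-t4-ne7-p2-g11`, journal row T4-U5.E-NE7-PROVE-P2*);
# v1.2 (GEN 15, unit `b2b-balaban-t4-ne7-p2-g15`): + §4 THE SAME IN THE MOMENT CURRENCY of `T4PathVarianceRate` v1.3
# (t4-ne7-p3 gen 7, p190970: shapes NE7-M `EffTiltMoment` at `mRate`, NE7-SGM `EffTiltSandwichGM` at `gmRate`);
# v1.3 (GEN 16, unit `b2b-balaban-t4-ne7-p2-g16`): + §4.5 THE ENTROPY HYPOTHESIS OF §4.2 IS SELF-FUNDING — GM ⇔ M at clause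
# level from WEIGHT BOUNDS alone (no bound on the produced entropy is assumed; under the shape NE7-SGM itself, after the
# normalisation `w ↦ min(w,1)`, with no hypothesis beyond the shape's `β_K ≥ 0`);
# v1.4 (GEN 17, unit `b2b-balaban-t4-ne7-p2-g17`): + §5 THE SAME IN THE FIELD-LEVEL CURRENCY NE7-H of `T4PathVarianceRate` v1.5
# (t4-ne7-p3 gen 8, p191671: shape `EffTermHybrid`, rate `fieldHybridRate r W K = r_K − log(1 − W_K)`): the exact split is LINEAR in
# the weight slot `W_K`, the lineage's floors transport to `W_K` by name, and POINTWISE IN THE FIELD the slot is a feasibility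
# condition first (`W_K < 1` fieldwise: support-disjoint families admit no hybrid sandwich);
# v1.5 (GEN 18, unit `b2b-balaban-t4-ne7-p2-g18`): + §4.6 THE M-CLAUSE REACHED FROM NE7-V IS THE V-CLAUSE (t4-lean's upstream ask,
# hosted verbatim) + §6 COLLAR DISCARD, the positive counterpart of (5.3): with SMOOTHED final-level thresholds the pattern-labelled
# hybrid sandwich IS feasible at every field, with a field-dependent good class (field-independent after labelling by the discard
# datum), at a price LINEAR in the discarded collar mass — the final-level shell then costs `Σ_K √(λ_K/w_K) < ∞`, ramp data alone

HONEST FRAMING.  Rung (B)+1 of the cell's ladder = the `ε → 0` limit of gauge-invariant unit-scale averaged loop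
observables on ONE FIXED four-torus, a scoping target carried with (B) = [Balaban1989LargeFieldII] Thm 1 and the
β-function hypothesis `BetaPertH` as EXPLICIT hypotheses wherever they enter (they enter NO declaration of this file).
It is NOT the infinite-volume limit, NOT a mass gap, NOT the Clay problem, and nothing here is summit progress.  Every
declaration is [folklore]: real arithmetic over the tree's own definitions `T4PathVarianceRate.gbRate` / `.gbEntropy`
(the rate PRODUCED by the good/bad tilt sandwich NE7-SGB / NE7-SGB₀ of the secant route — hypothesis shapes, NOT PRINTED),
`T4RemnantBooking.ageCut` (the log window) and `Step.Discrete031` (the endpoint-normalised two-sided running (0.31) of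
[Balaban1987RG1] p. 259, a hypothesis shape here).  No constant of [B4]–[B16] is asserted; the ABSOLUTE RULE of the cell
(no internally minted statement enters as a cited fact) is respected trivially: nothing is cited as a fact.

THE QUESTION THIS LEAF SETTLES (kernel, by name).  `T4PathVarianceRate` closes the apex from NE7-SGB / NE7-SGB₀ under ONE
clause, `Summable (gbRate r R w w' k)` with `gbRate = √(r_K² + 4R_K²·max(w_K,w'_K)·e^{k_K})`
(`hasContinuumLimit_of_effTiltSandwichGB`, `…GB₀`), and `T4ApexCanonical` v1.1 §7 carries that clause verbatim, noting
«no sufficient condition for it is chosen here».  This lane's assignment is the WEIGHT side of NE7 (what the single-run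
(B)-type bad-set weights can and cannot fund).  In the secant currency the answer is exact and short:

* §1 THE SPLIT (`summable_gbRate_iff`).  With the WEIGHT HALF `weightRate R w w' k K := 2R_K·√(max(w_K,w'_K))·e^{k_K/2}`
  one has `max(r_K, weightRate_K) ≤ gbRate_K ≤ r_K + weightRate_K` (`r_le_gbRate`, `weightRate_le_gbRate`,
  `gbRate_le_add`), hence for nonnegative inputs
  `Summable gbRate ↔ Summable r ∧ Summable weightRate` — the two-run small-field input `r` (the node's wall, GAPS
  G-ne7p3-7) and the single-run weight input are funded SEPARATELY, and the weights enter UNDER A SQUARE ROOT multiplied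
  by the range.
* §2 NECESSITY — THE FINAL-SCALE FLOOR IN THE SECANT CURRENCY (`not_summable_gbRate_of_floor`,
  `not_summable_gbRate_of_finalScale_floor`).  If the range stays away from zero (`R_K ≥ R₀ > 0` eventually — the
  regime in which a bad slot is used at all: with `|f_K|, |κ_K| ≤ R_K` one may always take `Gd = univ`, `r_K := 2R_K`)
  and the weight slot has a positive floor `max(w_K,w'_K) ≥ c > 0` eventually (`k_K ≥ 0`), then `gbRate_K ≥ 2R₀√c > 0`
  eventually and the produced rate is NOT summable, WHATEVER the two-run input `r`.  Along
  endpoint-normalised runs (`Step.Discrete031 b β′ K g (gs K)` for every cutoff `K`: both runs end at the SAME renormalised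
  coupling, `T4ShellSuppressionRoute.sq_endpoint` / `p0Profile_endpoint`) a floor of the form
  `c·exp(−p₀(gs K K)) = c·exp(−p₀(g))` is such a constant: this is `T4ShellSuppressionRoute.not_summable_of_finalScale_floor`
  (this lane, v1.3) TRANSPORTED to the secant currency, and the kernel form, for the shapes `EffTiltSandwichGB/GB₀`, of
  audit C-t4r3-1 (A1) recorded in `T4VarianceMatching` for the density currency `EffDensityRate`: the bad slot `Gdᶜ_K`
  cannot book the large-field event of the LAST scales of the runs (unit-scale plaquette fields above the final
  threshold `p₀(g)` have a `K`-independent one-run size); the good set must CONTAIN the configurations with such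
  recent-in-RG-time large fields, and on them the POINTWISE sandwich `|f_K − κ_K| ≤ r_K` of the two runs' relative action
  must hold — i.e. the secant route, like the hybrid route (`T4HybridMatching.hybridNE7_closure` on its log window
  `jlogOf C K ≤ j ≤ K`), consumes a TERM-WISE comparison of the two runs' young large-field action terms; the weight
  slot buys only the OLD (banked) remnant.  [analysis] reading of the dictionary; the kernel content is the arithmetic.
  ADJECTIVE DICTIONARY (v1.1): in THIS file (as in `T4ShellSuppressionRoute` / `T4HybridMatching`) AGE is counted from
  the unit-lattice END of a run — «recent-in-RG-time» / «young» = born in the LAST RG steps `K − j < ageCut`, «old» /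
  «banked» = born earlier (ultraviolet end); audit C-t4r3-1 (A1) in `T4VarianceMatching` words the SAME constraint with
  the opposite adjectives (its «OLD large-field regions» are the unit-scale ones, its «RECENT-scale» event is the newly
  added ultraviolet scale of the longer run `K ↦ K + 1`) — same content.
* §3 WHAT THE WEIGHTS DO BUY, AND THE WINDOW COST OF THE SQUARE ROOT.  THE BANKED MODEL: weights at the log window
  `bankedWeight V ρ C′ K := V·ρ^{ageCut C′ K}` (`ageCut C′ K = ⌈C′·log(K+1)⌉`, `0 < ρ < 1`: a geometric gain per banked
  epoch, the shape of the cell's age-rate producers `T4RemnantBooking.RemnantAgeBound` / `T4BankedInduction` —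
  hypothesis shapes, NOT PRINTED), a range growing at most like a power of `K + 1`,
  `bankedRange R₀ Λ C K := R₀·Λ^{ageCut C K}` (`Λ ≥ 1`; `Λ = 1` or `C = 0` = bounded range), an entropy input
  `0 ≤ k_K ≤ k₀`.  Then, by `T4BookingNecessity.summable_pow_ageCut_mul_iff` at `√ρ` (`log √ρ = ½ log ρ`;
  `summable_pow_ageCut_mul_sqrt_iff`):
      LINEAR weight clause   `Σ_K V·ρ^{ageCut C′ K} < ∞   ↔  1 < C′·(−log ρ)`              (`summable_bankedWeight_iff`),
      SECANT weight clause   `Σ_K weightRate_K < ∞        ↔  2 + 2C·log Λ < C′·(−log ρ)`   (`summable_weightRate_banked_iff`;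
                              necessity for every `k ≥ 0`: `window_of_summable_weightRate_banked`; sufficiency for
                              MAJORANTS `R_K ≤ R₀Λ^{ageCut C K}`, `max(w_K,w'_K) ≤ V·ρ^{ageCut C′ K}`, `k_K ≤ k₀` — the form
                              a producer uses: `summable_weightRate_of_banked_le`, `summable_gbRate_of_banked_le`),
  so with a summable two-run input `r` the produced rate of NE7-SGB (`summable_gbRate_banked_iff`) and of NE7-SGB₀ with
  its PRODUCED entropy `k = gbEntropy` (bounded in the model, `gbEntropy_banked_bounded`;
  `summable_gbRate_gbEntropy_banked_iff`) is summable iff `2 + 2C·log Λ < C′(−log ρ)`: THE SECANT CURRENCY NEEDS (AT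
  LEAST) TWICE THE LOG WINDOW of the linear currencies (`T4EffectiveLawLimit.densityChain_of_effTiltRateGB`:
  `4e^{2R}σ_K + 2(w_K + w'_K)`; `T4VarianceMatching` §5 `EffDensityRate`: `s_K + w_K + w'_K`) — the price of the range
  entering polynomially instead of as `e^{2R}`; for `1 < C′(−log ρ) ≤ 2` (bounded range) the linear clause holds while
  the secant clause FAILS for every `k ≥ 0` (`linear_window_not_secant_window`), and `2 < C′(−log ρ)` funds NE7-SGB₀'s
  clause for bounded range (`summable_gbRate_gbEntropy_of_doubled_window`).  Since the term-wise comparison must cover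
  every age below the window (§2), doubling `C′` doubles the range of large-field ages on which the two runs' action
  terms have to be compared pointwise.  A constraint on, not an objection to, `T4PathVarianceRate` (its hypotheses are
  shapes; every theorem there stands).
* §4 (v1.2) THE SAME IN THE MOMENT CURRENCY.  `T4PathVarianceRate` v1.3 §8 re-types the large-field input by SECOND
  MOMENTS: NE7-M `EffTiltMoment F M M'` under `Summable (mRate M M')`, `mRate = √(max(M,M')·e^{√M+√M'})`, and NE7-SGM
  `EffTiltSandwichGM F r m m' w w'` (TAIL second moments `m_K = ∫_{Gdᶜ}(f_K−κ_K)²`, `m'_K` instead of the sup-range)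
  under `Summable (gmRate r m m' w w')`, `gmRate = √(r² + max(m,m')·e^{gmEntropy})`, `gmEntropy = 2r + 2w' + √(w·m)`,
  noting that the sup-range `R_K` of §2's floor no longer occurs in the weakest typed form (its author's journal
  line on landing v1.3 — a statement about TYPED SHAPES, not about print).  §4 answers in kind, as a
  RIDER (nothing there is objected to): (4.1) with the MOMENT HALF `momentRate m m' k := √(max(m,m'))·e^{k/2}` one has
  `mRate M M' = momentRate M M' (√M+√M')`, `gmRate = √(r² + momentRate²)`, `weightRate R w w' k = momentRate (4R²w) (4R²w') k`
  (§1–§3 = the crude-tail special case) and the EXACT SPLIT `Summable gmRate ↔ Summable r ∧ Summable momentRate`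
  (`summable_gmRate_iff`); (4.2) the moment clauses are SQUARE-ROOT clauses — `Summable (mRate M M') ↔ Summable √M ∧
  Summable √M'` unconditionally (`summable_mRate_iff`), `Summable momentRate ↔ Summable √m ∧ Summable √m'` for bounded
  entropy, and since `√` splits sums the clause of NE7-M reached through `effTiltMoment_of_effTiltSandwichGM` (`M = r²+m`)
  and the clause of NE7-SGM are the SAME three conjuncts `Summable r ∧ Summable √m ∧ Summable √m'`
  (`summable_gmRate_iff_summable_mRate`); (4.3) NECESSITY SURVIVES: §2's floor is an EVENT floor — Chebyshev from below
  (`μ(B)·d² ≤ ∫_S (f−κ)² dμ` for `d ≤ |f−κ|` on `B ⊆ S`) turns a final-scale large-field event of one-run mass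
  `≥ c·e^{−p₀(gs K K)} = c·e^{−p₀(g)}` (endpoint-normalised runs) on which the two runs' relative action stays `≥ d` from its
  level into a floor `c·e^{−p₀(g)}·d²` of EVERY moment majorant, so `Σ mRate`, `Σ gmRate` diverge for all remaining inputs
  (`not_summable_mRate_of_finalScale_event_floor`, `not_summable_gmRate_of_finalScale_event_floor`): the moment currency
  removes the sup-range as the SIZE assigned to the off-good-set discrepancy, not the EVENT, and `Σ mRate < ∞` is the
  obligation that the conditional root-mean-square discrepancy ON the final-scale large-field event be summable — the
  term-wise comparison of §2, in `L²` instead of `sup`; (4.4) in the banked model the crude tail `4·bankedRange²·bankedWeight`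
  gives `Summable √(…) ↔ 2 + 2C·log Λ < C′·(−log ρ)` again (`summable_sqrt_bankedTailMoment_iff`, `summable_gmRate_banked_iff`,
  `summable_mRate_banked_iff`, `linear_window_not_moment_window`), and what the moment form BUYS is quantified: a
  conditional-RMS majorant `m_K ≤ w_K·s_K²`, `s_K = s₀Λ_s^{ageCut C_s K}`, funds the clause under
  `2 + 2C_s·log Λ_s < C′·(−log ρ)` (`summable_gmRate_of_condRMS_banked_le`) — the range exponent traded for the
  conditional-RMS exponent, the factor two of the square root kept.
  (4.5, v1.3) THE ENTROPY HYPOTHESIS OF (4.2) IS SELF-FUNDING: `summable_gmRate_iff_summable_mRate` asks a bound on the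
  PRODUCED entropy `gmEntropy = 2r + 2w' + √(w·m)`; that bound is produced by the M-clause itself once the weight MAJORANTS
  are bounded (`0 ≤ w ≤ W`, `0 ≤ w' ≤ W'`; for NE7-SGM `w' ≤ ½` is a clause and `w ≤ 1` after the harmless normalisation
  `w ↦ min(w,1)`, effective laws being probability measures): `Summable r`, `Summable √m` make `r`, `√m` bounded, whence
  `gmEntropy ≤ 2·sup r + 2W' + √(W·(sup √m)²)` (`gmEntropy_bounded_of_summable`), so `Summable (gmRate r m m' w w') ↔
  Summable (mRate (r²+m) (r²+m'))` with NO entropy hypothesis (`summable_gmRate_iff_summable_mRate_of_weights_le`; GM ⇒ M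
  needs signs only, `summable_mRate_sq_add_of_summable_gmRate`; normalising lowers the rate, `gmRate_min_one_le`); under
  the shape itself `effTiltSandwichGM_min_one` re-witnesses NE7-SGM with `min(w,1)` and `exists_effTiltSandwichGM_summable_iff`
  gives (∃ inputs, `Summable gmRate` ∧ NE7-SGM) ↔ (∃ inputs, `Summable (mRate (r²+m) (r²+m'))` ∧ NE7-SGM) for `β_K ≥ 0`, no
  other hypothesis — at clause level the GM currency carries exactly the summability content of the M currency of the
  NE7-M it produces: what NE7-SGM adds over NE7-M is the SHAPE (the good/bad split used in (4.3)–(4.4)), not the clause.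
  (4.6, v1.5) THE M-CLAUSE REACHED FROM NE7-V: `T4PathVarianceRate` v1.4 §8.6 produces NE7-M from NE7-V with moments
  `(v², 2v²(1+v²))`; its clause `Summable (mRate (v²) (2v²(1+v²)))` holds iff `Summable v` (`summable_mRate_sq_iff`, no sign
  hypothesis; helpers `summable_sqrt_sq_iff`, `sqrt_two_mul_sq_le`, one-way `summable_mRate_sq_of_summable`) — t4-lean's
  kernel-checked text (gen 22), hosted here verbatim at its request; the consumer binds it by name in `T4ApexCanonical2`.
  (5, v1.4) THE FIELD-LEVEL CURRENCY NE7-H (`T4PathVarianceRate` v1.5 §9: AT EVERY unit-lattice field a hybrid sandwich of the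
  two runs' term densities with ONE field-independent bad-class weight `0 ≤ W_K < 1`; rate `r_K − log(1 − W_K)`): (5.1) the
  exact split is LINEAR, `Summable (fieldHybridRate r W) ↔ Summable r ∧ Summable W` (`summable_fieldHybridRate_iff`) — for banked
  weights the window `1 < C′·(−log ρ)`, HALF the doubled window of (3) / (4.4) (`fieldHybrid_linear_window`); (5.2)
  `W_K ≤ fieldHybridRate r W K`, so the positive, final-scale and window-level floors transport to the slot by name
  (`not_summable_fieldHybridRate_of_floor` / `_of_finalScale_floor` / `_of_windowLevel_floor`); (5.3) POINTWISE IN THE FIELD the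
  slot is a FEASIBILITY condition before any summability: under a hybrid sandwich with `W < 1` some good term is charged by BOTH
  runs (`hybrid_exists_good_pos`), a bad class carrying the fraction `1 − η` of one run's mass at ONE field forces `1 − η ≤ W`
  (`hybrid_one_sub_le_weight`), and support-disjoint families admit NO sandwich with `W < 1` (`not_hybridSandwich_of_disjoint_support`;
  toy `not_hybridSandwich_thresholdMismatch`: sharp characteristic functions at two thresholds, on the shell between them) —
  dictionary [analysis, NOT PRINTED]: the FINAL-level indicator shell (NE7c at level `K`) is not a weight at field level but a
  feasibility obstruction, removed only by design ((η) smoothed / averaged thresholds, or (ii′) identical final restrictions on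
  matched histories), while the younger levels' shells enter `W_K` as CONDITIONAL shell mass given the field, bookable only by a
  conditional level-rate ((M1) given `u`), never by suppression size; (5.4) under the shape the clause IS the split clause
  (`summable_fieldHybridRate_iff_of_effTermHybrid`, `exists_effTermHybrid_summable_iff` — the clause `T4ApexCanonical` v1.4 §10.2
  types) and every instance exhibits at every field a good term charged by both runs (`exists_common_good_support_of_effTermHybrid`).
  (6, v1.5) COLLAR DISCARD — THE POSITIVE COUNTERPART OF (5.3).  With SMOOTHED factors `φ_A, φ_B : S → [0,1]` on a finite slot set
  `S` the patterns `P ⊆ S` carry weights `patWeight S φ P = ∏_{P}(1 − φ)·∏_{S∖P} φ`, a partition of unity (`sum_powerset_patWeight`,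
  no hypothesis); a run-A collar discard `(Dt, Df)` defines a FIELD-DEPENDENT good class `collarGood S Dt Df` whose complement
  weighs at most the discarded collar mass `Σ_{Dt}(1 − φ) + Σ_{Df} φ` (`sum_collarGood_patWeight`, `sum_bad_patWeight_le`,
  `1 − ∏(1 − x) ≤ Σ x`); matched polarities off the discard (`e^{±s□}`) and discarded factors `≤ δ□` in both runs give
  `HybridSandwich S.powerset (collarGood S Dt Df) … c (r₀ + Σ s□) (Σ_{Dt∪Df} δ□)` (`hybridSandwich_of_collarDiscard`) — no floor,
  no anti-concentration, no suppression; labelling the terms by the discard datum makes the good class field-INDEPENDENT with the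
  same constants (`hybridSandwich_label`); the ramp dictionary `|φ_B − φ_A| ≤ η < t₀` gives the prices `(η/(t₀ − η), t₀ + η)`
  (`collar_dictionary`), the cut `t₀ = √η` makes both `≤ 2√η` (`collar_sqrt_budget`), and at the FINAL level (slot count
  independent of `K`) `Σ_K √η_K < ∞` books the smoothed shell into `vol·δ_K` and `W_K` at once, `W_K < 1` eventually
  (`summable_collar_budget`, `collar_finalLevel_clause`) — the design condition (η) must meet; sharp factors recover (5.3).

WHAT THIS FILE DOES NOT DO.  It proves no instance of NE7-SGB/SGB₀/SGM/M/V — nor (v1.4) NE7-H, nor (v1.5) the collar-discard hypotheses for Bałaban's smoothed restrictions — for Bałaban's data (NOT PRINTED — the node's wall,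
GAPS G-ne7p3-7, is unchanged); it asserts no lower bound on any actual large-field probability (the floor and the
banked model are HYPOTHESIS SHAPES on the majorants `w`, `w'` a producer would write down); it does not touch infinite
volume, uniqueness, rotation invariance or a mass gap; `BetaPertH`, (B), (B^μ) appear in no declaration; no existing
module is modified.

References (context only; nothing is cited as a fact): [Balaban1987RG1] = [B12] T. Bałaban, CMP 109 (1987) 249–301,
(0.31) p. 259 (the two-sided running, typed as `Step.Discrete031`); [Balaban1988Convergent] = [B14] CMP 119 (1988)
243–285, (1.1) p. 246 (the profile `p₀(g)`, typed as `p0Profile`); [Balaban1988LargeFieldI] = [B15] CMP 122 (1989)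
175–202 and [Balaban1989LargeFieldII] = [B16] CMP 122 (1989) 355–392 (the (B)-type large-field weights, in kind).
In-tree, by name: `T4PathVarianceRate` (t4-ne7-p3) `gbRate`, `gbEntropy`, `hasContinuumLimit_of_effTiltSandwichGB/GB₀`,
(v1.3 §8) `mRate`, `gmRate`, `gmEntropy`, `EffTiltMoment`, `EffTiltSandwichGM`, `effTiltMoment_of_effTiltSandwichGM`,
`effTiltSandwichGM_of_effTiltSandwichGB₀`, `hasContinuumLimit_of_effTiltMoment/…SandwichGM`, (v1.3 §4.5) `UnitFactorisation.isProbabilityMeasure_effLaw`;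
`T4ShellSuppressionRoute` (this lane) `not_summable_of_floor`, `p0Profile_endpoint`; `T4BookingNecessity`
`summable_pow_ageCut_iff`, `summable_pow_ageCut_mul_iff`; `T4RemnantBooking.ageCut`; `T4ApexCanonical` v1.1 §7 (the
unsplit clause; v1.2 §8 binds `weightRate` / `summable_gbRate_iff`); Mathlib `Real.log_sqrt`, `Real.sqrt_mul'`,
`Filter.Tendsto.bddAbove_range`, `Summable.of_nonneg_of_le`, `MeasureTheory.setIntegral_mono_on/_mono_set/_const`,
(v1.3) `MeasureTheory.setIntegral_nonneg`, `measureReal_nonneg`, `measureReal_le_one`; (v1.4 §5) in-tree `T4PathVarianceRate` (v1.5 §9)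
`EffTermHybrid`, `fieldHybridRate`, `summable_fieldHybridRate`; `T4HybridMatching` `HybridSandwich` (its fields, `.sum_pos`, `.lower`),
`le_neg_log_one_sub`, `neg_log_one_sub_nonneg`, `summable_neg_log_one_sub`; `T4ShellSuppressionRoute.not_summable_of_finalScale_floor`;
`T4BookingNecessity.not_summable_exp_neg_p0Profile_select`; `T4GoodClassBudget.jlogOf`; `T4ApexCanonical` v1.4 §10.2 (the split clause
of `CanonicalTermHybridUnder`); Mathlib `Summable.of_nonneg_of_le`, `Finset.sum_sdiff`, `Finset.sum_le_sum_of_subset_of_nonneg`,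
`Finset.sum_nonpos`, `le_of_mul_le_mul_right`, `div_le_iff₀`, `le_div_iff₀`; (v1.5 §4.6) Mathlib `summable_abs_iff`, `Real.sqrt_sq_eq_abs`,
`Real.sqrt_le_left`; (v1.5 §6) in-tree `T4HybridMatching.prod_sandwich`; Mathlib `Finset.prod_add`, `Finset.sum_sdiff_eq_sub`,
`Finset.prod_le_one`, `Finset.sum_ite_mem`, `Finset.sum_filter`, `Finset.filter_not`, `Finset.sdiff_eq_filter`, `Finset.sum_product`,
`Finset.sum_eq_single`, `Finset.sum_union`, `Real.add_one_le_exp`, `Real.mul_self_sqrt`, `Summable.tendsto_atTop_zero`.  Cell records: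
`t4/T4-EST-NE7-P2.md` (this lane), `t4/T4-EST-NE7-P3.md` (§37: the field-level audit), `t4/T4-EST-U5bE2.md` ((η)-design), T4-DAG §8 Q18,
GAPS G-ne7p3-7 / C-ne7p3-10 / G-ne7p2-6, audit C-t4r3-1 (A1); (v1.5) t4-lean gen 22 `gen22/clause/MRateSqClause.lean` (journal l.59216),
`T4AgeZeroLayer` / `T4PatternLayer` (pv07: the (η) member's Lipschitz-smoothed pattern layers — context for §6, not imported).

WHAT IS KERNEL-CHECKED (0 sorry, axioms `propext`/`Classical.choice`/`Quot.sound`; every declaration [folklore]).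
§1 `weightRate`, `weightRate_nonneg`, `gbRate_nonneg`, `gbRate_eq_sqrt`, `r_le_gbRate`, `weightRate_le_gbRate`,
`max_le_gbRate`, `gbRate_le_add`, `summable_gbRate_iff`, `summable_gbRate_gbEntropy_iff`.  §2 `weightRate_ge_of_floor`,
`not_summable_weightRate_of_floor`, `not_summable_gbRate_of_floor`, `gbEntropy_nonneg`,
`not_summable_gbRate_of_finalScale_floor`, `not_summable_gbRate_gbEntropy_of_finalScale_floor`.  §3 `sqrt_pow_eq`,
`sqrt_pos_of_pos`, `sqrt_lt_one_of_lt_one`, `weightRate_le_of_banked`, `bankedRange`, `bankedWeight`, `bankedRange_nonneg`,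
`bankedWeight_nonneg`, `bankedWeight_le`, `summable_bankedWeight_iff`, `weightRate_banked_eq`,
`summable_pow_ageCut_mul_sqrt_iff`, `window_of_summable_weightRate_banked`, `summable_weightRate_of_banked_le`,
`summable_gbRate_of_banked_le`, `gbEntropy_le_of_bounds`, `summable_weightRate_banked_iff`, `summable_gbRate_banked_iff`,
`gbEntropy_banked_bounded`, `productWindow_of_doubledWindow`,
`summable_gbRate_gbEntropy_banked_iff`, `linear_window_not_secant_window`, `summable_gbRate_gbEntropy_of_doubled_window`.
§4 (v1.2) `momentRate`, `momentRate_nonneg`, `mRate_eq_momentRate`, `gmRate_eq_sqrt`, `weightRate_eq_momentRate`,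
`r_le_gmRate`, `momentRate_le_gmRate`, `gmRate_le_add`, `summable_gmRate_iff`; `sqrt_max`, `sqrt_le_momentRate_left`,
`sqrt_le_momentRate_right`, `momentRate_le_of_le`, `summable_momentRate_iff`, `summable_mRate_iff`, `summable_sqrt_add_iff`, `summable_sqrt_sq_add_iff`, `summable_mRate_sq_add_iff`, `gmEntropy_nonneg`,
`gmEntropy_le_of_bounds`, `gmEntropy_bounds`, `summable_gmRate_iff_of_bounded`, `summable_gmRate_iff_summable_mRate`;
`not_summable_sqrt_of_floor`, `not_summable_mRate_of_floor`, `not_summable_mRate_of_floor'`,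
`not_summable_gmRate_of_tail_floor`, `not_summable_gmRate_of_tail_floor'`, `measureReal_mul_sq_le_setIntegral`,
`measureReal_mul_sq_le_integral`, `integrable_sq_sub_of_abs_le`, `not_summable_mRate_of_event_floor`,
`not_summable_mRate_of_finalScale_event_floor`, `not_summable_gmRate_of_finalScale_event_floor`; `bankedTailMoment`,
`bankedTailMoment_nonneg`, `sqrt_bankedTailMoment_eq`, `summable_sqrt_bankedTailMoment_iff`, `linear_window_not_moment_window`,
`bankedWeight_mul_bankedTailMoment_bounded`, `summable_gmRate_banked_iff`, `summable_mRate_banked_iff`, `sqrt_le_of_condRMS`,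
`summable_sqrt_of_condRMS_banked_le`, `summable_gmRate_of_condRMS_banked_le`.
§4.5 (v1.3) `gmEntropy_bounded_of_summable`, `summable_mRate_sq_add_of_summable_gmRate`,
`summable_gmRate_iff_summable_mRate_of_weights_le`, `gmEntropy_min_one_le`, `gmRate_min_one_le`;
`effTiltSandwichGM_signBounds`, `summable_gmRate_iff_summable_mRate_of_effTiltSandwichGM`,
`summable_mRate_sq_add_of_effTiltSandwichGM`, `effTiltSandwichGM_min_one`,
`summable_gmRate_min_one_iff_of_effTiltSandwichGM`, `exists_effTiltSandwichGM_summable_iff`.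
§5 (v1.4) `neg_log_one_sub_le_fieldHybridRate`, `weight_le_fieldHybridRate`, `summable_neg_log_one_sub_iff`,
`summable_fieldHybridRate_iff`, `summable_fieldHybridRate_banked_iff`, `fieldHybrid_linear_window`,
`not_summable_fieldHybridRate_of_not_summable`, `not_summable_fieldHybridRate_of_floor`,
`not_summable_fieldHybridRate_of_finalScale_floor`, `not_summable_fieldHybridRate_of_windowLevel_floor`,
`hybrid_sum_good_ge_left`, `hybrid_sum_good_ge_right`, `hybrid_sum_good_pos_left`, `hybrid_sum_good_pos_right`,
`hybrid_exists_good_pos`, `hybrid_badFraction_le`, `hybrid_one_sub_le_weight`, `hybrid_one_le_weight_of_good_null`,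
`not_hybridSandwich_of_disjoint_support`, `thresholdDensity`, `thresholdMismatch_disjoint`,
`not_hybridSandwich_thresholdMismatch`, `effTermHybrid_signBounds`, `summable_fieldHybridRate_iff_of_effTermHybrid`,
`exists_effTermHybrid_summable_iff`, `exists_common_good_support_of_effTermHybrid`.
§4.6 (v1.5) `summable_sqrt_sq_iff`, `sqrt_two_mul_sq_le`, `summable_mRate_sq_iff`, `summable_mRate_sq_of_summable`.  §6
(v1.5) `patWeight`, `sum_powerset_patWeight`, `patWeight_nonneg`, `one_sub_prod_le_sum`, `collarGood`, `keptFac`,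
`collarGood_subset`, `mem_collarGood`, `sum_collarGood_patWeight`, `one_sub_keptFac_eq`, `sum_bad_patWeight_le`,
`prod_ratio_sandwich`, `hybridSandwich_of_collarDiscard`, `collarGood_empty`, `collar_weight_le_card_mul`,
`hybridSandwich_label`, `collar_dictionary`, `collar_sqrt_budget`, `summable_collar_budget`, `collar_finalLevel_clause`.
DECLARATION CENSUS: v1 / v1.1 = 39 declarations (3 `def` + 36 `theorem`; the lineage record `t4/T4-EST-NE7-P2.md` (13c)
and journal l.54823 wrote «4 def + 35 theorem» — erratum, corrected here); v1.2 = 84 declarations (5 `def` + 79 `theorem`);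
v1.3 = 95 declarations (5 `def` + 90 `theorem`); v1.4 = 121 declarations (6 `def` + 115 `theorem`); v1.5 = 145 declarations
(9 `def` + 136 `theorem`).

VERSIONS.  v1 (p189398, 2026-08-19): §1–§3.  v1.1 (DOCFIX D-ne7p2-13a, self-found): + the header's ADJECTIVE DICTIONARY and
the matching parenthesis in the docstring of `not_summable_gbRate_of_finalScale_floor` (this file's «recent-in-RG-time»
= audit C-t4r3-1 (A1)'s «OLD», same constraint); every declaration, statement and proof byte-identical to v1.
v1.2 (gen 15): + §4 (the moment currency of `T4PathVarianceRate` v1.3 §8: 2 `def` + 43 `theorem`, all [folklore]) and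
the header paragraphs marked (v1.2); imports unchanged; every declaration, statement and proof of v1.1 byte-identical
(FROZEN-WITH-CONSUMER: `T4ApexCanonical` v1.2 imports this file and binds `weightRate`, `summable_gbRate_iff`,
`summable_gbRate_gbEntropy_iff` only).
v1.3 (gen 16): + §4.5 (11 `theorem`, all [folklore]: the entropy hypothesis of §4.2 is self-funding; shape-level forms) and the header
sentences marked (v1.3); imports unchanged; every declaration, statement and proof of v1.2 byte-identical
(FROZEN-WITH-CONSUMER: `T4ApexCanonical` v1.2 binds `weightRate`, `summable_gbRate_iff`, `summable_gbRate_gbEntropy_iff`; its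
v1.3 (p191499, t4-lean gen 20, §9) binds §4's `momentRate`, `summable_mRate_iff`, `summable_gmRate_iff`,
`sqrt_le_momentRate_left/right`, `summable_mRate_sq_add_iff`, `gmEntropy_nonneg` by name — all of them v1.2 declarations,
untouched here; nothing of `T4ApexCanonical` is restated: its §9.1 sign lemma lives downstream and cannot be imported here).
v1.4 (gen 17): + §5 (1 `def` + 25 `theorem`, all [folklore]: the field-level currency NE7-H — linear split, floors transported to the
slot, pointwise feasibility, shape-level clause) and the header sentences marked (v1.4); imports unchanged (NE7-H is reachable through
`T4PathVarianceRate` v1.5, p191671, whose v1.4 declarations are byte-identical); every declaration, statement and proof of v1.3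
byte-identical (FROZEN-WITH-CONSUMER: `T4ApexCanonical` v1.4 (p192241, t4-lean gen 21, §10.1) additionally binds §4.5's
`effTiltSandwichGM_min_one`, `summable_gmRate_min_one_iff_of_effTiltSandwichGM`, `summable_mRate_sq_add_of_effTiltSandwichGM` and §4's
`summable_gmRate_iff_summable_mRate` by name — untouched here; nothing of `T4ApexCanonical` or of `T4PathVarianceRate` is restated;
`T4HybridMatching.HybridSandwich` is used, not modified: the §5.3 lemmas live in this namespace).
v1.5 (gen 18): + §4.6 (4 `theorem`, t4-lean gen 22's kernel-checked text hosted verbatim: the M-clause reached from NE7-V) + §6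
(3 `def` + 17 `theorem`, all [folklore]: collar discard — pattern partition of unity, field-dependent good class, linear price of the
bad patterns, the hybrid sandwich, labelling, ramp dictionary, final-level clause) and the header sentences marked (v1.5); four DOCSTRING
clauses banked from the XREAD of v1.2 → v1.4 (adv6 gen 66: INFO I1 title line, I2 `[RegularGaugeGroup G]` named in the three shape-level
§4.5 docstrings, I3 the §5 consumer-note quotation in full) and the owner's precision sentence on (5.3) (t4-ne7-p3 gen 9) folded —
docstrings only; imports unchanged; every declaration, statement and proof of v1.4 byte-identical (FROZEN-WITH-CONSUMER:
`T4ApexCanonical` v1.4 binds v1.2–v1.3 names only; `T4ApexCanonical2` (t4-lean) will bind §4.6 by name).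
-/

noncomputable section

open Filter Topology

namespace Literature.MathematicalPhysics.QuantumFieldTheory.Balaban1983to89.T4PathVarianceWeightSplit

open T4PathVarianceRate (gbRate gbEntropy)
open T4RemnantBooking (ageCut)
open T4BookingNecessity (summable_pow_ageCut_iff summable_pow_ageCut_mul_iff)
open T4ShellSuppressionRoute (not_summable_of_floor p0Profile_endpoint)

variable {r R w w' k : ℕ → ℝ} {K : ℕ}

/-! ## §1 The two halves of the produced rate and the exact summability split -/

/-- The WEIGHT HALF of the produced rate `gbRate`: `2·R_K·√(max(w_K, w'_K))·e^{k_K/2}` — range times the SQUARE ROOT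
of the larger endpoint bad-set weight times `e^{k_K/2}`. [folklore] -/
def weightRate (R w w' k : ℕ → ℝ) (K : ℕ) : ℝ :=
  2 * R K * Real.sqrt (max (w K) (w' K)) * Real.exp (k K / 2)

/-- [folklore] -/
theorem weightRate_nonneg (hR : 0 ≤ R K) : 0 ≤ weightRate R w w' k K := by
  unfold weightRate
  have := Real.sqrt_nonneg (max (w K) (w' K))
  positivity

/-- [folklore] -/
theorem gbRate_nonneg (r R w w' k : ℕ → ℝ) (K : ℕ) : 0 ≤ gbRate r R w w' k K := by
  unfold gbRate
  exact Real.sqrt_nonneg _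

/-- `gbRate_K = √(r_K² + weightRate_K²)` as soon as the weight slot is nonnegative (automatic for any instance of
NE7-SGB: `w_K ≥ effLaw_K(Gdᶜ) ≥ 0`). [folklore] -/
theorem gbRate_eq_sqrt (hm : 0 ≤ max (w K) (w' K)) :
    gbRate r R w w' k K = Real.sqrt (r K ^ 2 + weightRate R w w' k K ^ 2) := by
  unfold gbRate weightRate
  congr 1
  have h1 : Real.sqrt (max (w K) (w' K)) ^ 2 = max (w K) (w' K) := Real.sq_sqrt hm
  have h2 : Real.exp (k K / 2) ^ 2 = Real.exp (k K) := by
    rw [sq, ← Real.exp_add]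
    congr 1
    ring
  calc r K ^ 2 + 4 * R K ^ 2 * (max (w K) (w' K) * Real.exp (k K))
      = r K ^ 2 + 4 * R K ^ 2 * (Real.sqrt (max (w K) (w' K)) ^ 2 * Real.exp (k K / 2) ^ 2) := by rw [h1, h2]
    _ = r K ^ 2 + (2 * R K * Real.sqrt (max (w K) (w' K)) * Real.exp (k K / 2)) ^ 2 := by ring

/-- The two-run half is dominated: `r_K ≤ gbRate_K`. [folklore] -/
theorem r_le_gbRate (hr : 0 ≤ r K) (hm : 0 ≤ max (w K) (w' K)) : r K ≤ gbRate r R w w' k K := by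
  rw [gbRate_eq_sqrt hm]
  calc r K = Real.sqrt (r K ^ 2) := (Real.sqrt_sq hr).symm
    _ ≤ Real.sqrt (r K ^ 2 + weightRate R w w' k K ^ 2) :=
        Real.sqrt_le_sqrt (le_add_of_nonneg_right (sq_nonneg _))

/-- The weight half is dominated: `weightRate_K ≤ gbRate_K`. [folklore] -/
theorem weightRate_le_gbRate (hR : 0 ≤ R K) (hm : 0 ≤ max (w K) (w' K)) :
    weightRate R w w' k K ≤ gbRate r R w w' k K := by
  rw [gbRate_eq_sqrt hm]
  calc weightRate R w w' k K = Real.sqrt (weightRate R w w' k K ^ 2) := (Real.sqrt_sq (weightRate_nonneg hR)).symm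
    _ ≤ Real.sqrt (r K ^ 2 + weightRate R w w' k K ^ 2) :=
        Real.sqrt_le_sqrt (le_add_of_nonneg_left (sq_nonneg _))

/-- … so `max(r_K, weightRate_K) ≤ gbRate_K`. [folklore] -/
theorem max_le_gbRate (hr : 0 ≤ r K) (hR : 0 ≤ R K) (hm : 0 ≤ max (w K) (w' K)) :
    max (r K) (weightRate R w w' k K) ≤ gbRate r R w w' k K :=
  max_le (r_le_gbRate hr hm) (weightRate_le_gbRate hR hm)

/-- Subadditivity of the square root: `gbRate_K ≤ r_K + weightRate_K`. [folklore] -/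
theorem gbRate_le_add (hr : 0 ≤ r K) (hR : 0 ≤ R K) (hm : 0 ≤ max (w K) (w' K)) :
    gbRate r R w w' k K ≤ r K + weightRate R w w' k K := by
  have hW := weightRate_nonneg (w := w) (w' := w') (k := k) hR
  rw [gbRate_eq_sqrt hm, Real.sqrt_le_left (add_nonneg hr hW)]
  nlinarith [mul_nonneg hr hW]

/-- **THE EXACT SPLIT OF THE SECANT CLAUSE.**  For nonnegative inputs the produced rate of NE7-SGB is summable IF AND
ONLY IF the two-run small-field input `r` AND the weight half `weightRate R w w' k` are summable — the clause
`Summable (gbRate r R w w' k)` of `T4PathVarianceRate.hasContinuumLimit_of_effTiltSandwichGB` (carried unsplit by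
`T4ApexCanonical` v1.1 §7) funds the wall and the weights SEPARATELY. [folklore] -/
theorem summable_gbRate_iff (hr : ∀ K, 0 ≤ r K) (hR : ∀ K, 0 ≤ R K) (hm : ∀ K, 0 ≤ max (w K) (w' K)) :
    Summable (gbRate r R w w' k) ↔ Summable r ∧ Summable (weightRate R w w' k) := by
  refine ⟨fun h => ⟨?_, ?_⟩, fun h => ?_⟩
  · exact Summable.of_nonneg_of_le hr (fun K => r_le_gbRate (hr K) (hm K)) h
  · exact Summable.of_nonneg_of_le (fun K => weightRate_nonneg (hR K))
      (fun K => weightRate_le_gbRate (hR K) (hm K)) h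
  · exact Summable.of_nonneg_of_le (fun K => gbRate_nonneg r R w w' k K)
      (fun K => gbRate_le_add (hr K) (hR K) (hm K)) (h.1.add h.2)

/-- The same split for the entropy-free shape NE7-SGB₀ (`k = gbEntropy r R w w'`, the clause of
`T4PathVarianceRate.hasContinuumLimit_of_effTiltSandwichGB₀`). [folklore] -/
theorem summable_gbRate_gbEntropy_iff (hr : ∀ K, 0 ≤ r K) (hR : ∀ K, 0 ≤ R K) (hm : ∀ K, 0 ≤ max (w K) (w' K)) :
    Summable (gbRate r R w w' (gbEntropy r R w w')) ↔
      Summable r ∧ Summable (weightRate R w w' (gbEntropy r R w w')) :=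
  summable_gbRate_iff hr hR hm

/-! ## §2 Necessity: a positive floor in the weight slot kills the clause — the final-scale floor in the secant currency -/

/-- A floor in the weight slot is a floor of the weight half: `R_K ≥ R₀ ≥ 0`, `max(w_K,w'_K) ≥ c`, `k_K ≥ 0` give
`weightRate_K ≥ 2R₀√c`. [folklore] -/
theorem weightRate_ge_of_floor {R₀ c : ℝ} (hR₀ : 0 ≤ R₀) (hR : R₀ ≤ R K) (hwc : c ≤ max (w K) (w' K))
    (hk : 0 ≤ k K) : 2 * R₀ * Real.sqrt c ≤ weightRate R w w' k K := by
  unfold weightRate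
  have hRK : 0 ≤ R K := hR₀.trans hR
  have h1 : Real.sqrt c ≤ Real.sqrt (max (w K) (w' K)) := Real.sqrt_le_sqrt hwc
  have h2 : 1 ≤ Real.exp (k K / 2) := Real.one_le_exp (by linarith)
  have hs : 0 ≤ Real.sqrt (max (w K) (w' K)) := Real.sqrt_nonneg _
  calc 2 * R₀ * Real.sqrt c ≤ 2 * R K * Real.sqrt c :=
        mul_le_mul_of_nonneg_right (by linarith) (Real.sqrt_nonneg _)
    _ ≤ 2 * R K * Real.sqrt (max (w K) (w' K)) := mul_le_mul_of_nonneg_left h1 (by linarith)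
    _ = 2 * R K * Real.sqrt (max (w K) (w' K)) * 1 := (mul_one _).symm
    _ ≤ 2 * R K * Real.sqrt (max (w K) (w' K)) * Real.exp (k K / 2) :=
        mul_le_mul_of_nonneg_left h2 (mul_nonneg (by linarith) hs)

/-- **A WEIGHT FLOOR KILLS THE WEIGHT HALF.**  `R_K ≥ R₀ > 0`, `max(w_K,w'_K) ≥ c > 0`, `k_K ≥ 0` eventually ⇒
`weightRate R w w' k` is not summable. [folklore] -/
theorem not_summable_weightRate_of_floor {R₀ c : ℝ} (hR₀ : 0 < R₀) (hc : 0 < c) (hR : ∀ᶠ K in atTop, R₀ ≤ R K)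
    (hwc : ∀ᶠ K in atTop, c ≤ max (w K) (w' K)) (hk : ∀ᶠ K in atTop, 0 ≤ k K) :
    ¬ Summable (weightRate R w w' k) :=
  not_summable_of_floor (by positivity : 0 < 2 * R₀ * Real.sqrt c)
    ((hR.and (hwc.and hk)).mono fun K h => weightRate_ge_of_floor hR₀.le h.1 h.2.1 h.2.2)

/-- **A WEIGHT FLOOR KILLS THE SECANT CLAUSE, WHATEVER THE TWO-RUN INPUT.**  If the range stays away from zero
(`R_K ≥ R₀ > 0` eventually), the weight slot has a positive floor (`max(w_K,w'_K) ≥ c > 0` eventually) and `k_K ≥ 0`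
eventually, then `gbRate r R w w' k` is NOT summable — for every `r`.  So the clause of
`T4PathVarianceRate.hasContinuumLimit_of_effTiltSandwichGB` is unfundable by any producer whose bad slot books an
event of `K`-independent one-run size. [folklore] -/
theorem not_summable_gbRate_of_floor {R₀ c : ℝ} (hR₀ : 0 < R₀) (hc : 0 < c) (hR : ∀ᶠ K in atTop, R₀ ≤ R K)
    (hwc : ∀ᶠ K in atTop, c ≤ max (w K) (w' K)) (hk : ∀ᶠ K in atTop, 0 ≤ k K) :
    ¬ Summable (gbRate r R w w' k) :=
  not_summable_of_floor (by positivity : 0 < 2 * R₀ * Real.sqrt c)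
    ((hR.and (hwc.and hk)).mono fun K h =>
      (weightRate_ge_of_floor hR₀.le h.1 h.2.1 h.2.2).trans
        (weightRate_le_gbRate (hR₀.le.trans h.1) (hc.le.trans h.2.1)))

/-- The entropy input PRODUCED by NE7-SGB₀ is nonnegative for nonnegative inputs (so the clause `k_K ≥ 0` of the floor
theorems is automatic for `k = gbEntropy r R w w'`). [folklore] -/
theorem gbEntropy_nonneg (hr : 0 ≤ r K) (hR : 0 ≤ R K) (hw : 0 ≤ w K) (hw' : 0 ≤ w' K) :
    0 ≤ gbEntropy r R w w' K := by
  unfold gbEntropy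
  positivity

/-- **THE FINAL-SCALE FLOOR IN THE SECANT CURRENCY** (`T4ShellSuppressionRoute.not_summable_of_finalScale_floor`
transported; audit C-t4r3-1 (A1) in kernel form for NE7-SGB).  Along any family of endpoint-normalised runs
(`Step.Discrete031 b β′ K g (gs K)` for every cutoff `K`, so `p₀(gs K K) = p₀(g)` by `p0Profile_endpoint`), if the
weight slot is bounded BELOW by a positive multiple of the final-level one-run size `exp(−p₀(gs K K))` for every `K`,
the range satisfies `R_K ≥ R₀ > 0` and `k_K ≥ 0`, then the produced rate is not summable, for every two-run input `r`.
Dictionary [analysis]: a bad slot `Gdᶜ_K` that books the unit-scale (last-step) large-field event carries such a floor;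
hence the good set must contain the configurations with recent-in-RG-time large fields (born in the LAST RG steps, at
bounded age from the unit-lattice end — the «OLD large-field regions» of audit C-t4r3-1 (A1)'s wording, see the header's
adjective dictionary) and the pointwise sandwich `|f_K − κ_K| ≤ r_K` must hold ON them. [folklore] -/
theorem not_summable_gbRate_of_finalScale_floor {b β' g : ℝ} (A₀ : ℝ) (p₀ : ℕ) {gs : ℕ → ℕ → ℝ}
    (h031 : ∀ K, Step.Discrete031 b β' K g (gs K)) {R₀ c : ℝ} (hR₀ : 0 < R₀) (hc : 0 < c) (hR : ∀ K, R₀ ≤ R K)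
    (hfloor : ∀ K, c * Real.exp (-(p0Profile A₀ p₀ (gs K K))) ≤ max (w K) (w' K)) (hk : ∀ K, 0 ≤ k K) :
    ¬ Summable (gbRate r R w w' k) :=
  not_summable_gbRate_of_floor hR₀ (mul_pos hc (Real.exp_pos (-(p0Profile A₀ p₀ g)))) (Eventually.of_forall hR)
    (Eventually.of_forall fun K => by
      have h := hfloor K
      rwa [p0Profile_endpoint A₀ p₀ (h031 K)] at h)
    (Eventually.of_forall hk)

/-- The same for the entropy-free shape NE7-SGB₀ (`k = gbEntropy r R w w' ≥ 0` automatically for nonnegative inputs):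
the clause of `T4PathVarianceRate.hasContinuumLimit_of_effTiltSandwichGB₀` is unfundable under a final-scale floor.
[folklore] -/
theorem not_summable_gbRate_gbEntropy_of_finalScale_floor {b β' g : ℝ} (A₀ : ℝ) (p₀ : ℕ) {gs : ℕ → ℕ → ℝ}
    (h031 : ∀ K, Step.Discrete031 b β' K g (gs K)) {R₀ c : ℝ} (hR₀ : 0 < R₀) (hc : 0 < c) (hR : ∀ K, R₀ ≤ R K)
    (hr : ∀ K, 0 ≤ r K) (hw : ∀ K, 0 ≤ w K) (hw' : ∀ K, 0 ≤ w' K)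
    (hfloor : ∀ K, c * Real.exp (-(p0Profile A₀ p₀ (gs K K))) ≤ max (w K) (w' K)) :
    ¬ Summable (gbRate r R w w' (gbEntropy r R w w')) :=
  not_summable_gbRate_of_finalScale_floor A₀ p₀ h031 hR₀ hc hR hfloor fun K =>
    gbEntropy_nonneg (hr K) ((hR₀.le).trans (hR K)) (hw K) (hw' K)

/-! ## §3 What the weights buy: banked weights at the log window, and the window cost of the square root -/

/-- `√(ρⁿ) = (√ρ)ⁿ` for `ρ ≥ 0`. [folklore] -/
theorem sqrt_pow_eq {ρ : ℝ} (hρ : 0 ≤ ρ) (n : ℕ) : Real.sqrt (ρ ^ n) = Real.sqrt ρ ^ n := by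
  have e : ρ ^ n = (Real.sqrt ρ ^ n) ^ 2 := by
    rw [← pow_mul, mul_comm, pow_mul, Real.sq_sqrt hρ]
  rw [e, Real.sqrt_sq (pow_nonneg (Real.sqrt_nonneg _) n)]

/-- [folklore] -/
theorem sqrt_pos_of_pos {ρ : ℝ} (h0 : 0 < ρ) : 0 < Real.sqrt ρ := Real.sqrt_pos.2 h0

/-- [folklore] -/
theorem sqrt_lt_one_of_lt_one {ρ : ℝ} (h0 : 0 ≤ ρ) (h1 : ρ < 1) : Real.sqrt ρ < 1 := by
  simpa using Real.sqrt_lt_sqrt h0 h1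

/-- BANKED WEIGHTS ⇒ a banked weight half with HALF the exponent: `max(w_K,w'_K) ≤ V·ρ^{N_K}` gives
`weightRate_K ≤ 2R_K·√V·(√ρ)^{N_K}·e^{k_K/2}`. [folklore] -/
theorem weightRate_le_of_banked {V ρ : ℝ} (hV : 0 ≤ V) (hρ : 0 ≤ ρ) {N : ℕ → ℕ} (hR : 0 ≤ R K)
    (hb : max (w K) (w' K) ≤ V * ρ ^ N K) :
    weightRate R w w' k K ≤ 2 * R K * (Real.sqrt V * Real.sqrt ρ ^ N K) * Real.exp (k K / 2) := by
  unfold weightRate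
  have h1 : Real.sqrt (max (w K) (w' K)) ≤ Real.sqrt V * Real.sqrt ρ ^ N K := by
    calc Real.sqrt (max (w K) (w' K)) ≤ Real.sqrt (V * ρ ^ N K) := Real.sqrt_le_sqrt hb
      _ = Real.sqrt V * Real.sqrt ρ ^ N K := by rw [Real.sqrt_mul hV, sqrt_pow_eq hρ]
  exact mul_le_mul_of_nonneg_right (mul_le_mul_of_nonneg_left h1 (by linarith)) (Real.exp_pos _).le

/-- THE BANKED MODEL, range: `R_K = R₀·Λ^{ageCut C K}` (`ageCut C K = ⌈C·log(K+1)⌉`; `Λ ≥ 1`: growth at most like a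
power of `K + 1`; `Λ = 1` or `C = 0` = bounded range). [folklore] -/
def bankedRange (R₀ Λ C : ℝ) : ℕ → ℝ := fun K => R₀ * Λ ^ ageCut C K

/-- THE BANKED MODEL, weights: `w_K = w'_K = V·ρ^{ageCut C′ K}` — a geometric gain `ρ < 1` per banked epoch over the
log window of constant `C′`, the shape of the cell's age-rate producers (`T4RemnantBooking.RemnantAgeBound`,
`T4BankedInduction`; hypothesis shapes, NOT PRINTED). [folklore] -/
def bankedWeight (V ρ C' : ℝ) : ℕ → ℝ := fun K => V * ρ ^ ageCut C' K

/-- [folklore] -/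
theorem bankedRange_nonneg {R₀ Λ C : ℝ} (hR₀ : 0 ≤ R₀) (hΛ : 0 ≤ Λ) (K : ℕ) : 0 ≤ bankedRange R₀ Λ C K := by
  unfold bankedRange; positivity

/-- [folklore] -/
theorem bankedWeight_nonneg {V ρ C' : ℝ} (hV : 0 ≤ V) (hρ : 0 ≤ ρ) (K : ℕ) : 0 ≤ bankedWeight V ρ C' K := by
  unfold bankedWeight; positivity

/-- [folklore] -/
theorem bankedWeight_le {V ρ C' : ℝ} (hV : 0 ≤ V) (h0 : 0 ≤ ρ) (h1 : ρ ≤ 1) (K : ℕ) : bankedWeight V ρ C' K ≤ V := by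
  unfold bankedWeight
  exact mul_le_of_le_one_right hV (pow_le_one₀ h0 h1)

/-- The LINEAR weight clause at the log window: for `V > 0`, `0 < ρ < 1`, `C′ ≥ 0`,
`Σ_K V·ρ^{ageCut C′ K} < ∞ ↔ 1 < C′·(−log ρ)` (`T4BookingNecessity.summable_pow_ageCut_iff` with a constant).  This is
the clause the endpoint routes ask of banked weights (`T4EffectiveLawLimit.densityChain_of_effTiltRateGB`:
`… + 2(w_K + w'_K)`; `T4VarianceMatching` §5: `s_K + w_K + w'_K`). [folklore] -/
theorem summable_bankedWeight_iff {V ρ C' : ℝ} (hV : 0 < V) (h0 : 0 < ρ) (h1 : ρ < 1) (hC' : 0 ≤ C') :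
    Summable (bankedWeight V ρ C') ↔ 1 < C' * (-Real.log ρ) := by
  unfold bankedWeight
  rw [summable_mul_left_iff hV.ne']
  exact summable_pow_ageCut_iff h0 h1 hC'

/-- The weight half of the banked model, in closed form: `2R₀·√V·e^{k_K/2}·(Λ^{ageCut C K}·(√ρ)^{ageCut C′ K})`.
[folklore] -/
theorem weightRate_banked_eq {R₀ V ρ Λ C C' : ℝ} (hV : 0 ≤ V) (hρ : 0 ≤ ρ) (K : ℕ) :
    weightRate (bankedRange R₀ Λ C) (bankedWeight V ρ C') (bankedWeight V ρ C') k K =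
      2 * R₀ * Real.sqrt V * Real.exp (k K / 2) * (Λ ^ ageCut C K * Real.sqrt ρ ^ ageCut C' K) := by
  unfold weightRate bankedRange bankedWeight
  rw [max_self, Real.sqrt_mul hV, sqrt_pow_eq hρ]
  ring

/-- The top-of-window count against the HALVED age gain is summable iff `2 + 2C·log Λ < C′·(−log ρ)`
(`T4BookingNecessity.summable_pow_ageCut_mul_iff` at `√ρ`, `log √ρ = ½·log ρ`). [folklore] -/
theorem summable_pow_ageCut_mul_sqrt_iff {ρ Λ C C' : ℝ} (h0 : 0 < ρ) (h1 : ρ < 1) (hΛ : 1 ≤ Λ) (hC : 0 ≤ C)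
    (hC' : 0 ≤ C') :
    Summable (fun K : ℕ => Λ ^ ageCut C K * Real.sqrt ρ ^ ageCut C' K) ↔ 2 + 2 * C * Real.log Λ < C' * (-Real.log ρ) := by
  rw [summable_pow_ageCut_mul_iff hΛ hC (sqrt_pos_of_pos h0) (sqrt_lt_one_of_lt_one h0.le h1) hC', Real.log_sqrt h0.le]
  constructor <;> intro h <;> linarith

/-- NECESSITY in the banked model: if the weight half is summable for some entropy input `k ≥ 0`, then
`2 + 2C·log Λ < C′·(−log ρ)`. [folklore] -/
theorem window_of_summable_weightRate_banked {R₀ V ρ Λ C C' : ℝ} (hR₀ : 0 < R₀) (hV : 0 < V) (h0 : 0 < ρ)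
    (h1 : ρ < 1) (hΛ : 1 ≤ Λ) (hC : 0 ≤ C) (hC' : 0 ≤ C') (hk : ∀ K, 0 ≤ k K)
    (hs : Summable (weightRate (bankedRange R₀ Λ C) (bankedWeight V ρ C') (bankedWeight V ρ C') k)) :
    2 + 2 * C * Real.log Λ < C' * (-Real.log ρ) := by
  have hΛ0 : 0 < Λ := one_pos.trans_le hΛ
  have hA : 0 < 2 * R₀ * Real.sqrt V := by
    have := sqrt_pos_of_pos hV
    positivity
  have hm0 : ∀ K, 0 ≤ Λ ^ ageCut C K * Real.sqrt ρ ^ ageCut C' K := fun K =>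
    mul_nonneg (pow_nonneg hΛ0.le _) (pow_nonneg (Real.sqrt_nonneg _) _)
  have hlo : ∀ K, 2 * R₀ * Real.sqrt V * (Λ ^ ageCut C K * Real.sqrt ρ ^ ageCut C' K) ≤
      weightRate (bankedRange R₀ Λ C) (bankedWeight V ρ C') (bankedWeight V ρ C') k K := fun K => by
    rw [weightRate_banked_eq hV.le h0.le K]
    have h2 : 1 ≤ Real.exp (k K / 2) := Real.one_le_exp (by linarith [hk K])
    calc 2 * R₀ * Real.sqrt V * (Λ ^ ageCut C K * Real.sqrt ρ ^ ageCut C' K)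
        = 2 * R₀ * Real.sqrt V * 1 * (Λ ^ ageCut C K * Real.sqrt ρ ^ ageCut C' K) := by ring
      _ ≤ 2 * R₀ * Real.sqrt V * Real.exp (k K / 2) * (Λ ^ ageCut C K * Real.sqrt ρ ^ ageCut C' K) :=
          mul_le_mul_of_nonneg_right (mul_le_mul_of_nonneg_left h2 hA.le) (hm0 K)
  have h' : Summable (fun K => 2 * R₀ * Real.sqrt V * (Λ ^ ageCut C K * Real.sqrt ρ ^ ageCut C' K)) :=
    Summable.of_nonneg_of_le (fun K => mul_nonneg hA.le (hm0 K)) hlo hs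
  exact (summable_pow_ageCut_mul_sqrt_iff h0 h1 hΛ hC hC').1 ((summable_mul_left_iff hA.ne').1 h')

/-- SUFFICIENCY, in the form a producer uses (majorants, not the model): range `0 ≤ R_K ≤ R₀·Λ^{ageCut C K}`, weights
`max(w_K,w'_K) ≤ V·ρ^{ageCut C′ K}`, entropy input `k_K ≤ k₀`, and the DOUBLED window `2 + 2C·log Λ < C′·(−log ρ)`
⇒ the weight half is summable. [folklore] -/
theorem summable_weightRate_of_banked_le {R₀ V ρ Λ C C' k₀ : ℝ} (hR₀ : 0 ≤ R₀) (hV : 0 ≤ V) (h0 : 0 < ρ)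
    (h1 : ρ < 1) (hΛ : 1 ≤ Λ) (hC : 0 ≤ C) (hC' : 0 ≤ C') (hR : ∀ K, 0 ≤ R K ∧ R K ≤ R₀ * Λ ^ ageCut C K)
    (hb : ∀ K, max (w K) (w' K) ≤ V * ρ ^ ageCut C' K) (hk : ∀ K, k K ≤ k₀)
    (hwin : 2 + 2 * C * Real.log Λ < C' * (-Real.log ρ)) : Summable (weightRate R w w' k) := by
  have hΛ0 : 0 < Λ := one_pos.trans_le hΛ
  have hm0 : ∀ K, 0 ≤ Λ ^ ageCut C K * Real.sqrt ρ ^ ageCut C' K := fun K =>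
    mul_nonneg (pow_nonneg hΛ0.le _) (pow_nonneg (Real.sqrt_nonneg _) _)
  have hB : 0 ≤ 2 * R₀ * Real.sqrt V * Real.exp (k₀ / 2) := by
    have := Real.sqrt_nonneg V
    positivity
  have hhi : ∀ K, weightRate R w w' k K ≤
      2 * R₀ * Real.sqrt V * Real.exp (k₀ / 2) * (Λ ^ ageCut C K * Real.sqrt ρ ^ ageCut C' K) := fun K => by
    have h2 : Real.exp (k K / 2) ≤ Real.exp (k₀ / 2) := Real.exp_le_exp.2 (by linarith [hk K])
    have hsV : 0 ≤ Real.sqrt V * Real.sqrt ρ ^ ageCut C' K :=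
      mul_nonneg (Real.sqrt_nonneg _) (pow_nonneg (Real.sqrt_nonneg _) _)
    calc weightRate R w w' k K ≤ 2 * R K * (Real.sqrt V * Real.sqrt ρ ^ ageCut C' K) * Real.exp (k K / 2) :=
          weightRate_le_of_banked hV h0.le (hR K).1 (hb K)
      _ ≤ 2 * (R₀ * Λ ^ ageCut C K) * (Real.sqrt V * Real.sqrt ρ ^ ageCut C' K) * Real.exp (k₀ / 2) := by
          have a1 : 2 * R K * (Real.sqrt V * Real.sqrt ρ ^ ageCut C' K) ≤
              2 * (R₀ * Λ ^ ageCut C K) * (Real.sqrt V * Real.sqrt ρ ^ ageCut C' K) :=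
            mul_le_mul_of_nonneg_right (by linarith [(hR K).2]) hsV
          have a0 : 0 ≤ 2 * (R₀ * Λ ^ ageCut C K) * (Real.sqrt V * Real.sqrt ρ ^ ageCut C' K) :=
            mul_nonneg (by positivity) hsV
          calc 2 * R K * (Real.sqrt V * Real.sqrt ρ ^ ageCut C' K) * Real.exp (k K / 2)
              ≤ 2 * (R₀ * Λ ^ ageCut C K) * (Real.sqrt V * Real.sqrt ρ ^ ageCut C' K) * Real.exp (k K / 2) :=
                mul_le_mul_of_nonneg_right a1 (Real.exp_pos _).le
            _ ≤ 2 * (R₀ * Λ ^ ageCut C K) * (Real.sqrt V * Real.sqrt ρ ^ ageCut C' K) * Real.exp (k₀ / 2) :=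
                mul_le_mul_of_nonneg_left h2 a0
      _ = 2 * R₀ * Real.sqrt V * Real.exp (k₀ / 2) * (Λ ^ ageCut C K * Real.sqrt ρ ^ ageCut C' K) := by ring
  exact Summable.of_nonneg_of_le (fun K => weightRate_nonneg (hR K).1) hhi
    (((summable_pow_ageCut_mul_sqrt_iff h0 h1 hΛ hC hC').2 hwin).mul_left _)

/-- SUFFICIENCY FOR THE WHOLE CLAUSE, producer form: a summable nonnegative two-run input `r`, range and weights
under the banked majorants, an entropy input bounded above, and the DOUBLED window ⇒ `Summable (gbRate r R w w' k)` —
the clause of `T4PathVarianceRate.hasContinuumLimit_of_effTiltSandwichGB` (`summable_gbRate_iff` +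
`summable_weightRate_of_banked_le`).  For NE7-SGB₀ take `k = gbEntropy r R w w'` and bound it by `gbEntropy_le_of_bounds`.
[folklore] -/
theorem summable_gbRate_of_banked_le {R₀ V ρ Λ C C' k₀ : ℝ} (hR₀ : 0 ≤ R₀) (hV : 0 ≤ V) (h0 : 0 < ρ) (h1 : ρ < 1)
    (hΛ : 1 ≤ Λ) (hC : 0 ≤ C) (hC' : 0 ≤ C') (hr0 : ∀ K, 0 ≤ r K) (hr : Summable r)
    (hR : ∀ K, 0 ≤ R K ∧ R K ≤ R₀ * Λ ^ ageCut C K) (hm : ∀ K, 0 ≤ max (w K) (w' K))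
    (hb : ∀ K, max (w K) (w' K) ≤ V * ρ ^ ageCut C' K) (hk : ∀ K, k K ≤ k₀)
    (hwin : 2 + 2 * C * Real.log Λ < C' * (-Real.log ρ)) : Summable (gbRate r R w w' k) :=
  (summable_gbRate_iff hr0 (fun K => (hR K).1) hm).2
    ⟨hr, summable_weightRate_of_banked_le hR₀ hV h0 h1 hΛ hC hC' hR hb hk hwin⟩

/-- A bound for the PRODUCED entropy input of NE7-SGB₀ from bounds on its ingredients:
`r_K ≤ r̄`, `R_K·w_K ≤ P`, `w_K ≤ W`, `w'_K ≤ W'` (with `0 ≤ r_K`, `0 ≤ w_K`) ⇒ `gbEntropy_K ≤ 2r̄ + 2P + r̄W + 2W'`.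
[folklore] -/
theorem gbEntropy_le_of_bounds {rbar P W W' : ℝ} (hr0 : 0 ≤ r K) (hr : r K ≤ rbar) (hw0 : 0 ≤ w K)
    (hRw : R K * w K ≤ P) (hw : w K ≤ W) (hw' : w' K ≤ W') :
    gbEntropy r R w w' K ≤ 2 * rbar + 2 * P + rbar * W + 2 * W' := by
  have hrbar : 0 ≤ rbar := hr0.trans hr
  have e1 : r K * w K ≤ rbar * W :=
    (mul_le_mul_of_nonneg_right hr hw0).trans (mul_le_mul_of_nonneg_left hw hrbar)
  show 2 * r K + (2 * R K + r K) * w K + 2 * w' K ≤ _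
  nlinarith

/-- **THE WINDOW COST OF THE SQUARE ROOT.**  In the banked model (range `R₀·Λ^{ageCut C K}`, `R₀ > 0`, `Λ ≥ 1`,
`C ≥ 0`; weights `V·ρ^{ageCut C′ K}`, `V > 0`, `0 < ρ < 1`, `C′ ≥ 0`; entropy input `0 ≤ k_K ≤ k₀`) the SECANT weight
clause holds IF AND ONLY IF `2 + 2C·log Λ < C′·(−log ρ)`.  Compare the LINEAR clause `1 < C′·(−log ρ)`
(`summable_bankedWeight_iff`): the secant currency needs (at least) TWICE the log window. [folklore] -/
theorem summable_weightRate_banked_iff {R₀ V ρ Λ C C' k₀ : ℝ} (hR₀ : 0 < R₀) (hV : 0 < V) (h0 : 0 < ρ)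
    (h1 : ρ < 1) (hΛ : 1 ≤ Λ) (hC : 0 ≤ C) (hC' : 0 ≤ C') (hk : ∀ K, 0 ≤ k K ∧ k K ≤ k₀) :
    Summable (weightRate (bankedRange R₀ Λ C) (bankedWeight V ρ C') (bankedWeight V ρ C') k) ↔
      2 + 2 * C * Real.log Λ < C' * (-Real.log ρ) := by
  refine ⟨window_of_summable_weightRate_banked hR₀ hV h0 h1 hΛ hC hC' (fun K => (hk K).1), fun hwin => ?_⟩
  have hΛ0 : 0 < Λ := one_pos.trans_le hΛ
  refine summable_weightRate_of_banked_le (k₀ := k₀) hR₀.le hV.le h0 h1 hΛ hC hC' (fun K => ⟨?_, le_rfl⟩)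
    (fun K => ?_) (fun K => (hk K).2) hwin
  · show 0 ≤ R₀ * Λ ^ ageCut C K
    positivity
  · show max (V * ρ ^ ageCut C' K) (V * ρ ^ ageCut C' K) ≤ V * ρ ^ ageCut C' K
    rw [max_self]

/-- **THE SECANT CLAUSE IN THE BANKED MODEL.**  With a summable nonnegative two-run input `r` and `0 ≤ k_K ≤ k₀`, the
produced rate `gbRate` of NE7-SGB in the banked model is summable IF AND ONLY IF `2 + 2C·log Λ < C′·(−log ρ)`
(`summable_gbRate_iff` + `summable_weightRate_banked_iff`). [folklore] -/
theorem summable_gbRate_banked_iff {R₀ V ρ Λ C C' k₀ : ℝ} (hR₀ : 0 < R₀) (hV : 0 < V) (h0 : 0 < ρ) (h1 : ρ < 1)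
    (hΛ : 1 ≤ Λ) (hC : 0 ≤ C) (hC' : 0 ≤ C') (hk : ∀ K, 0 ≤ k K ∧ k K ≤ k₀) (hr0 : ∀ K, 0 ≤ r K)
    (hr : Summable r) :
    Summable (gbRate r (bankedRange R₀ Λ C) (bankedWeight V ρ C') (bankedWeight V ρ C') k) ↔
      2 + 2 * C * Real.log Λ < C' * (-Real.log ρ) := by
  have hΛ0 : 0 < Λ := one_pos.trans_le hΛ
  have hm : ∀ K, 0 ≤ max (bankedWeight V ρ C' K) (bankedWeight V ρ C' K) := fun K =>
    le_max_of_le_left (bankedWeight_nonneg hV.le h0.le K)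
  rw [summable_gbRate_iff hr0 (fun K => bankedRange_nonneg hR₀.le hΛ0.le K) hm,
    summable_weightRate_banked_iff hR₀ hV h0 h1 hΛ hC hC' hk]
  exact ⟨fun h => h.2, fun h => ⟨hr, h⟩⟩

/-- In the banked model the entropy input PRODUCED by NE7-SGB₀, `gbEntropy = 2r + (2R + r)w + 2w'`, is nonnegative and
BOUNDED as soon as the two-run input is bounded (`0 ≤ r_K ≤ r̄`) and the range-times-weight product is summable
(`1 < C′·(−log ρ) − C·log Λ`, implied by the doubled window). [folklore] -/
theorem gbEntropy_banked_bounded {R₀ V ρ Λ C C' rbar : ℝ} (hR₀ : 0 ≤ R₀) (hV : 0 ≤ V) (h0 : 0 < ρ) (h1 : ρ < 1)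
    (hΛ : 1 ≤ Λ) (hC : 0 ≤ C) (hC' : 0 ≤ C') (hr : ∀ K, 0 ≤ r K ∧ r K ≤ rbar)
    (hq : 1 < C' * (-Real.log ρ) - C * Real.log Λ) :
    ∃ k₀, ∀ K, 0 ≤ gbEntropy r (bankedRange R₀ Λ C) (bankedWeight V ρ C') (bankedWeight V ρ C') K ∧
      gbEntropy r (bankedRange R₀ Λ C) (bankedWeight V ρ C') (bankedWeight V ρ C') K ≤ k₀ := by
  have hΛ0 : 0 < Λ := one_pos.trans_le hΛ
  have hs : Summable (fun K : ℕ => Λ ^ ageCut C K * ρ ^ ageCut C' K) :=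
    (summable_pow_ageCut_mul_iff hΛ hC h0 h1 hC').2 hq
  obtain ⟨B, hB⟩ := hs.tendsto_atTop_zero.bddAbove_range
  have hB' : ∀ K, Λ ^ ageCut C K * ρ ^ ageCut C' K ≤ B := fun K => hB ⟨K, rfl⟩
  have hρA : ∀ K, ρ ^ ageCut C' K ≤ 1 := fun K => pow_le_one₀ h0.le h1.le
  have hrbar : 0 ≤ rbar := (hr 0).1.trans (hr 0).2
  refine ⟨2 * rbar + (2 * (R₀ * V * B) + rbar * V) + 2 * V, fun K => ⟨?_, ?_⟩⟩
  · exact gbEntropy_nonneg (hr K).1 (bankedRange_nonneg hR₀ hΛ0.le K) (bankedWeight_nonneg hV h0.le K)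
      (bankedWeight_nonneg hV h0.le K)
  · show 2 * r K + (2 * (R₀ * Λ ^ ageCut C K) + r K) * (V * ρ ^ ageCut C' K) + 2 * (V * ρ ^ ageCut C' K) ≤ _
    have e1 : 2 * r K ≤ 2 * rbar := by linarith [(hr K).2]
    have e3 : 2 * (R₀ * Λ ^ ageCut C K) * (V * ρ ^ ageCut C' K) ≤ 2 * (R₀ * V * B) := by
      calc 2 * (R₀ * Λ ^ ageCut C K) * (V * ρ ^ ageCut C' K) = 2 * (R₀ * V) * (Λ ^ ageCut C K * ρ ^ ageCut C' K) := by
            ring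
        _ ≤ 2 * (R₀ * V) * B := mul_le_mul_of_nonneg_left (hB' K) (by positivity)
        _ = 2 * (R₀ * V * B) := by ring
    have e4 : r K * (V * ρ ^ ageCut C' K) ≤ rbar * V := by
      calc r K * (V * ρ ^ ageCut C' K) ≤ rbar * (V * ρ ^ ageCut C' K) :=
            mul_le_mul_of_nonneg_right (hr K).2 (by positivity)
        _ ≤ rbar * V := mul_le_mul_of_nonneg_left (mul_le_of_le_one_right hV (hρA K)) hrbar
    have e5 : 2 * (V * ρ ^ ageCut C' K) ≤ 2 * V :=
      mul_le_mul_of_nonneg_left (mul_le_of_le_one_right hV (hρA K)) (by norm_num)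
    have ed : (2 * (R₀ * Λ ^ ageCut C K) + r K) * (V * ρ ^ ageCut C' K) =
        2 * (R₀ * Λ ^ ageCut C K) * (V * ρ ^ ageCut C' K) + r K * (V * ρ ^ ageCut C' K) := by ring
    rw [ed]
    linarith

/-- The doubled window implies the product threshold of `gbEntropy_banked_bounded`. [folklore] -/
theorem productWindow_of_doubledWindow {ρ Λ C C' : ℝ} (hΛ : 1 ≤ Λ) (hC : 0 ≤ C)
    (hwin : 2 + 2 * C * Real.log Λ < C' * (-Real.log ρ)) : 1 < C' * (-Real.log ρ) - C * Real.log Λ := by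
  have : 0 ≤ C * Real.log Λ := mul_nonneg hC (Real.log_nonneg hΛ)
  linarith

/-- **THE SECANT CLAUSE OF NE7-SGB₀ IN THE BANKED MODEL** (four inputs, entropy PRODUCED as `gbEntropy`): with a
bounded summable nonnegative two-run input `r`, the produced rate `gbRate r R w w' (gbEntropy r R w w')` of the
banked model is summable IF AND ONLY IF `2 + 2C·log Λ < C′·(−log ρ)` — the clause of
`T4PathVarianceRate.hasContinuumLimit_of_effTiltSandwichGB₀` in this model is exactly the doubled window. [folklore] -/
theorem summable_gbRate_gbEntropy_banked_iff {R₀ V ρ Λ C C' rbar : ℝ} (hR₀ : 0 < R₀) (hV : 0 < V) (h0 : 0 < ρ)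
    (h1 : ρ < 1) (hΛ : 1 ≤ Λ) (hC : 0 ≤ C) (hC' : 0 ≤ C') (hr : ∀ K, 0 ≤ r K ∧ r K ≤ rbar) (hrs : Summable r) :
    Summable (gbRate r (bankedRange R₀ Λ C) (bankedWeight V ρ C') (bankedWeight V ρ C')
        (gbEntropy r (bankedRange R₀ Λ C) (bankedWeight V ρ C') (bankedWeight V ρ C'))) ↔
      2 + 2 * C * Real.log Λ < C' * (-Real.log ρ) := by
  have hΛ0 : 0 < Λ := one_pos.trans_le hΛ
  have hm : ∀ K, 0 ≤ max (bankedWeight V ρ C' K) (bankedWeight V ρ C' K) := fun K =>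
    le_max_of_le_left (bankedWeight_nonneg hV.le h0.le K)
  have hk0 : ∀ K, 0 ≤ gbEntropy r (bankedRange R₀ Λ C) (bankedWeight V ρ C') (bankedWeight V ρ C') K := fun K =>
    gbEntropy_nonneg (hr K).1 (bankedRange_nonneg hR₀.le hΛ0.le K) (bankedWeight_nonneg hV.le h0.le K)
      (bankedWeight_nonneg hV.le h0.le K)
  rw [summable_gbRate_iff (fun K => (hr K).1) (fun K => bankedRange_nonneg hR₀.le hΛ0.le K) hm]
  refine ⟨fun h => window_of_summable_weightRate_banked hR₀ hV h0 h1 hΛ hC hC' hk0 h.2, fun hwin => ⟨hrs, ?_⟩⟩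
  obtain ⟨k₀, hk⟩ := gbEntropy_banked_bounded hR₀.le hV.le h0 h1 hΛ hC hC' hr
    (productWindow_of_doubledWindow hΛ hC hwin)
  exact (summable_weightRate_banked_iff hR₀ hV h0 h1 hΛ hC hC' hk).2 hwin

/-- **STRICT SEPARATION (bounded range).**  If `1 < C′·(−log ρ) ≤ 2` then the banked weights `V·ρ^{ageCut C′ K}`
satisfy the LINEAR weight clause but the SECANT weight clause FAILS even for bounded range (`Λ = 1`, `C = 0`) and every
entropy input `k ≥ 0`: the window constant that funds the endpoint / density currencies does not fund the secant
currency. [folklore] -/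
theorem linear_window_not_secant_window {R₀ V ρ C' : ℝ} (hR₀ : 0 < R₀) (hV : 0 < V) (h0 : 0 < ρ) (h1 : ρ < 1)
    (hC' : 0 ≤ C') (hlo : 1 < C' * (-Real.log ρ)) (hhi : C' * (-Real.log ρ) ≤ 2) (hk : ∀ K, 0 ≤ k K) :
    Summable (bankedWeight V ρ C') ∧
      ¬ Summable (weightRate (bankedRange R₀ 1 0) (bankedWeight V ρ C') (bankedWeight V ρ C') k) := by
  refine ⟨(summable_bankedWeight_iff hV h0 h1 hC').2 hlo, fun hs => ?_⟩
  have h := window_of_summable_weightRate_banked hR₀ hV h0 h1 le_rfl le_rfl hC' hk hs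
  rw [Real.log_one] at h
  linarith

/-- **THE DOUBLED WINDOW FUNDS IT.**  Conversely, if `2 < C′·(−log ρ)` then, for bounded range and a bounded summable
nonnegative two-run input `r`, the banked model funds the produced rate of NE7-SGB₀ (for an instance whose range,
weights and entropy input are only MAJORISED by the model use `summable_gbRate_of_banked_le` with
`gbEntropy_le_of_bounds`; `T4PathVarianceRate.hasContinuumLimit_of_effTiltSandwichGB₀` then applies by name). [folklore] -/
theorem summable_gbRate_gbEntropy_of_doubled_window {R₀ V ρ C' rbar : ℝ} (hR₀ : 0 < R₀) (hV : 0 < V) (h0 : 0 < ρ)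
    (h1 : ρ < 1) (hC' : 0 ≤ C') (hr : ∀ K, 0 ≤ r K ∧ r K ≤ rbar) (hrs : Summable r)
    (hwin : 2 < C' * (-Real.log ρ)) :
    Summable (gbRate r (bankedRange R₀ 1 0) (bankedWeight V ρ C') (bankedWeight V ρ C')
        (gbEntropy r (bankedRange R₀ 1 0) (bankedWeight V ρ C') (bankedWeight V ρ C'))) := by
  refine (summable_gbRate_gbEntropy_banked_iff hR₀ hV h0 h1 le_rfl le_rfl hC' hr hrs).2 ?_
  rw [Real.log_one]
  linarith

/-! ## §4 The moment currency (v1.2): the same split, the same floor, the same window for `T4PathVarianceRate` v1.3 §8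

`T4PathVarianceRate` v1.3 (t4-ne7-p3 gen 7, p190970) re-types the large-field input in SECOND-MOMENT form: the pure
moment shape NE7-M `EffTiltMoment F M M'` closes the apex under `Summable (mRate M M')`,
`mRate M M' K = √(max(M_K, M'_K)·e^{√M_K + √M'_K})`, and the good/bad moment shape NE7-SGM `EffTiltSandwichGM F r m m' w w'`
(TAIL second moments `m_K = ∫_{Gdᶜ}(f_K − κ_K)² d(effLaw K)`, `m'_K` in place of the sup-range) under
`Summable (gmRate r m m' w w')`, `gmRate = √(r² + max(m,m')·e^{gmEntropy})`, `gmEntropy = 2r + 2w' + √(w·m)`; the typed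
ladder is NE7-SGB₀ ⇒ NE7-SGM (`m := 4R²w`) ⇒ NE7-M (`M := r² + m`).  This section repeats §1–§3 in that currency.  Every
declaration is [folklore] real arithmetic over those three definitions plus ONE measure-level Chebyshev floor; nothing is
asserted about Bałaban's data; the shapes stay NOT PRINTED (as recorded upstream in `T4PathVarianceRate`).

* §4.1 THE MOMENT HALF `momentRate m m' k K := √(max(m_K, m'_K))·e^{k_K/2}`: `mRate M M' = momentRate M M' (√M + √M')`,
  `gmRate_K = √(r_K² + momentRate_K²)` at `k = gmEntropy`, and with the crude tail `m = 4R²w` the moment half IS the weight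
  half of §1 (`weightRate_eq_momentRate`).  EXACT SPLIT `Summable gmRate ↔ Summable r ∧ Summable momentRate`
  (`summable_gmRate_iff`, the twin of `summable_gbRate_iff`).
* §4.2 THE MOMENT CLAUSES ARE SQUARE-ROOT CLAUSES: `Summable (mRate M M') ↔ Summable √M ∧ Summable √M'` with NO side
  condition (`summable_mRate_iff`); `Summable momentRate ↔ Summable √m ∧ Summable √m'` for a bounded entropy input
  (`summable_momentRate_iff`); `√` splits sums (`summable_sqrt_add_iff`), so the clause of NE7-M reached through
  `effTiltMoment_of_effTiltSandwichGM` (`M = r² + m`) and the clause of NE7-SGM are the SAME three conjuncts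
  `Summable r ∧ Summable √m ∧ Summable √m'` (`summable_mRate_sq_add_iff`, `summable_gmRate_iff_of_bounded`,
  `summable_gmRate_iff_summable_mRate`): the ladder step GM ⇒ M loses nothing at the level of clauses.
* §4.3 NECESSITY — THE FINAL-SCALE FLOOR IS AN EVENT FLOOR AND SURVIVES THE CHANGE OF CURRENCY.  A floor in either moment
  slot kills the clause (`not_summable_mRate_of_floor`, `not_summable_gmRate_of_tail_floor`); Chebyshev from below,
  `μ(B)·d² ≤ ∫_S (f − κ)² dμ` whenever `d ≤ |f − κ|` on `B ⊆ S` (`measureReal_mul_sq_le_setIntegral`); hence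
  (`not_summable_mRate_of_finalScale_event_floor`, `not_summable_gmRate_of_finalScale_event_floor`) along endpoint-normalised
  runs (`Step.Discrete031`, `p0Profile_endpoint`) an EVENT `B_K` of one-run mass `≥ c·e^{−p₀(gs K K)} = c·e^{−p₀(g)}` on which
  the relative action of the two runs stays `≥ d` away from its level makes every moment majorant `≥ c·e^{−p₀(g)}·d²`, and
  no `M'` (resp. no `r, m', w, w'`) restores summability.  Reading [analysis]: what v1.3 §8 removes is the sup-range `R_K`
  as the SIZE assigned to the discrepancy off the good set; what no currency removes is the EVENT — the unit-scale
  large-field event of the LAST RG steps has `K`-independent one-run mass along endpoint-normalised runs (the (B)-type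
  suppression `e^{−p₀(g)}` is a fixed number there), so `Σ_K mRate_K < ∞` is the obligation that the CONDITIONAL
  root-mean-square discrepancy of the two runs' relative actions ON that event be summable in `K` — a TERM-WISE two-run
  comparison on young large fields (audit C-t4r3-1 (A1); §2's adjective dictionary), now in `L²` instead of `sup`.
* §4.4 THE BANKED MODEL IN THE MOMENT CURRENCY.  With the crude tail `bankedTailMoment := 4·bankedRange²·bankedWeight`
  (what the sup-range grants, `effTiltSandwichGM_of_effTiltSandwichGB₀`) the square-root clause is AGAIN
  `2 + 2C·log Λ < C′·(−log ρ)` (`summable_sqrt_bankedTailMoment_iff`, `summable_gmRate_banked_iff`,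
  `summable_mRate_banked_iff`; strict separation from the linear window `linear_window_not_moment_window`): §3 persists
  verbatim.  What the moment form BUYS, made quantitative: a CONDITIONAL-RMS majorant `m_K ≤ w_K·s_K²`
  (`sqrt_le_of_condRMS`) with `s_K = s₀·Λ_s^{ageCut C_s K}` funds `Summable √m` under `2 + 2C_s·log Λ_s < C′·(−log ρ)`
  (`summable_sqrt_of_condRMS_banked_le`, `summable_gmRate_of_condRMS_banked_le`) — the RANGE exponent `C·log Λ` is traded
  for the conditional-RMS exponent `C_s·log Λ_s`; the factor two against the linear currencies (`1 < C′·(−log ρ)`,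
  `summable_bankedWeight_iff`) is the square root and stays.
* §4.5 (v1.3) THE ENTROPY HYPOTHESIS OF §4.2 IS SELF-FUNDING: the bound on the produced entropy is PRODUCED by the
  M-clause plus bounds on the weight majorants (`gmEntropy_bounded_of_summable`), so GM ⇔ M at clause level holds with no
  entropy hypothesis (`summable_gmRate_iff_summable_mRate_of_weights_le`; one way from signs only,
  `summable_mRate_sq_add_of_summable_gmRate`); under the shape, after `w ↦ min(w,1)` (`effTiltSandwichGM_min_one`,
  probability normalisation), with no hypothesis at all: `exists_effTiltSandwichGM_summable_iff`. -/

section Moment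

open MeasureTheory
open T4PathVarianceRate (mRate gmRate gmEntropy)

variable {m m' M M' : ℕ → ℝ}

/-! ### §4.1 The moment half and the exact split of `gmRate` -/

/-- The MOMENT HALF: `√(max(m_K, m'_K))·e^{k_K/2}` — the square root of the larger endpoint (tail) second moment times
`e^{k_K/2}`.  With the crude tail `m = 4R²w`, `m' = 4R²w'` it IS the weight half of §1 (`weightRate_eq_momentRate`).
[folklore] -/
def momentRate (m m' k : ℕ → ℝ) (K : ℕ) : ℝ :=
  Real.sqrt (max (m K) (m' K)) * Real.exp (k K / 2)

/-- [folklore] -/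
theorem momentRate_nonneg (m m' k : ℕ → ℝ) (K : ℕ) : 0 ≤ momentRate m m' k K :=
  mul_nonneg (Real.sqrt_nonneg _) (Real.exp_pos _).le

/-- **`mRate` IS A MOMENT HALF**: `mRate M M' = momentRate M M' (√M + √M')` — the pure-moment rate of NE7-M is the moment
half whose entropy input is the PRODUCED symmetric entropy payment `√M_K + √M'_K` (no sign hypotheses). [folklore] -/
theorem mRate_eq_momentRate (M M' : ℕ → ℝ) :
    mRate M M' = momentRate M M' (fun K => Real.sqrt (M K) + Real.sqrt (M' K)) := by
  funext K
  unfold mRate momentRate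
  have hs : ∀ s : ℝ, Real.sqrt (Real.exp s) = Real.exp (s / 2) := fun s => by
    have h : Real.exp s = Real.exp (s / 2) ^ 2 := by
      rw [sq, ← Real.exp_add]
      congr 1
      ring
    rw [h, Real.sqrt_sq (Real.exp_pos _).le]
  rw [Real.sqrt_mul' _ (Real.exp_pos _).le, hs]

/-- `gmRate_K = √(r_K² + momentRate_K²)` at the produced entropy `k = gmEntropy r m w w'`, as soon as
`max(m_K, m'_K) ≥ 0` (automatic for any instance of NE7-SGM: `m_K ≥ ∫_{Gdᶜ}(f−κ)² ≥ 0`). [folklore] -/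
theorem gmRate_eq_sqrt (hm : 0 ≤ max (m K) (m' K)) :
    gmRate r m m' w w' K = Real.sqrt (r K ^ 2 + momentRate m m' (gmEntropy r m w w') K ^ 2) := by
  unfold gmRate momentRate
  congr 1
  have h1 : Real.sqrt (max (m K) (m' K)) ^ 2 = max (m K) (m' K) := Real.sq_sqrt hm
  have h2 : Real.exp (gmEntropy r m w w' K / 2) ^ 2 = Real.exp (gmEntropy r m w w' K) := by
    rw [sq, ← Real.exp_add]
    congr 1
    ring
  rw [mul_pow, h1, h2]

/-- **CONSISTENCY WITH §1**: with the crude tail moments `m = 4R²w`, `m' = 4R²w'` granted by a sup-range `R_K ≥ 0`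
(`T4PathVarianceRate.effTiltSandwichGM_of_effTiltSandwichGB₀`) the moment half IS the weight half:
`weightRate R w w' k K = momentRate (4R²w) (4R²w') k K`.  So §1–§3 are the special case of this section. [folklore] -/
theorem weightRate_eq_momentRate (hR : 0 ≤ R K) :
    weightRate R w w' k K = momentRate (fun K => 4 * R K ^ 2 * w K) (fun K => 4 * R K ^ 2 * w' K) k K := by
  show 2 * R K * Real.sqrt (max (w K) (w' K)) * Real.exp (k K / 2) =
    Real.sqrt (max (4 * R K ^ 2 * w K) (4 * R K ^ 2 * w' K)) * Real.exp (k K / 2)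
  have hmax : max (4 * R K ^ 2 * w K) (4 * R K ^ 2 * w' K) = 4 * R K ^ 2 * max (w K) (w' K) :=
    (mul_max_of_nonneg (w K) (w' K) (by positivity : 0 ≤ 4 * R K ^ 2)).symm
  have hsq : Real.sqrt (4 * R K ^ 2) = 2 * R K := by
    rw [show 4 * R K ^ 2 = (2 * R K) ^ 2 by ring]
    exact Real.sqrt_sq (by linarith)
  rw [hmax, Real.sqrt_mul (by positivity : (0 : ℝ) ≤ 4 * R K ^ 2), hsq]

/-- The two-run half is dominated: `r_K ≤ gmRate_K`. [folklore] -/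
theorem r_le_gmRate (hr : 0 ≤ r K) (hm : 0 ≤ max (m K) (m' K)) : r K ≤ gmRate r m m' w w' K := by
  rw [gmRate_eq_sqrt hm]
  calc r K = Real.sqrt (r K ^ 2) := (Real.sqrt_sq hr).symm
    _ ≤ Real.sqrt (r K ^ 2 + momentRate m m' (gmEntropy r m w w') K ^ 2) :=
        Real.sqrt_le_sqrt (le_add_of_nonneg_right (sq_nonneg _))

/-- The moment half is dominated: `momentRate_K ≤ gmRate_K`. [folklore] -/
theorem momentRate_le_gmRate (hm : 0 ≤ max (m K) (m' K)) :
    momentRate m m' (gmEntropy r m w w') K ≤ gmRate r m m' w w' K := by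
  rw [gmRate_eq_sqrt hm]
  calc momentRate m m' (gmEntropy r m w w') K = Real.sqrt (momentRate m m' (gmEntropy r m w w') K ^ 2) :=
        (Real.sqrt_sq (momentRate_nonneg _ _ _ _)).symm
    _ ≤ Real.sqrt (r K ^ 2 + momentRate m m' (gmEntropy r m w w') K ^ 2) :=
        Real.sqrt_le_sqrt (le_add_of_nonneg_left (sq_nonneg _))

/-- Subadditivity of the square root: `gmRate_K ≤ r_K + momentRate_K`. [folklore] -/
theorem gmRate_le_add (hr : 0 ≤ r K) (hm : 0 ≤ max (m K) (m' K)) :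
    gmRate r m m' w w' K ≤ r K + momentRate m m' (gmEntropy r m w w') K := by
  have hW := momentRate_nonneg m m' (gmEntropy r m w w') K
  rw [gmRate_eq_sqrt hm, Real.sqrt_le_left (add_nonneg hr hW)]
  nlinarith [mul_nonneg hr hW]

/-- **THE EXACT SPLIT OF THE MOMENT-SANDWICH CLAUSE.**  For `r_K ≥ 0` and `max(m_K, m'_K) ≥ 0` the produced rate of
NE7-SGM is summable IF AND ONLY IF the two-run small-field input `r` AND the moment half
`momentRate m m' (gmEntropy r m w w')` are summable — the clause `Summable (gmRate r m m' w w')` of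
`T4PathVarianceRate.hasContinuumLimit_of_effTiltSandwichGM` funds the wall and the tail moments SEPARATELY (the twin of
`summable_gbRate_iff`). [folklore] -/
theorem summable_gmRate_iff (hr : ∀ K, 0 ≤ r K) (hm : ∀ K, 0 ≤ max (m K) (m' K)) :
    Summable (gmRate r m m' w w') ↔ Summable r ∧ Summable (momentRate m m' (gmEntropy r m w w')) := by
  refine ⟨fun h => ⟨?_, ?_⟩, fun h => ?_⟩
  · exact Summable.of_nonneg_of_le hr (fun K => r_le_gmRate (hr K) (hm K)) h
  · exact Summable.of_nonneg_of_le (fun K => momentRate_nonneg _ _ _ K) (fun K => momentRate_le_gmRate (hm K)) h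
  · exact Summable.of_nonneg_of_le (fun K => Real.sqrt_nonneg _) (fun K => gmRate_le_add (hr K) (hm K)) (h.1.add h.2)

/-! ### §4.2 The moment clauses are square-root clauses -/

/-- `√` is monotone: `√(max a b) = max(√a, √b)`. [folklore] -/
theorem sqrt_max (a b : ℝ) : Real.sqrt (max a b) = max (Real.sqrt a) (Real.sqrt b) := by
  rcases le_total a b with h | h
  · rw [max_eq_right h, max_eq_right (Real.sqrt_le_sqrt h)]
  · rw [max_eq_left h, max_eq_left (Real.sqrt_le_sqrt h)]

/-- `k_K ≥ 0` ⇒ `√m_K ≤ momentRate_K`. [folklore] -/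
theorem sqrt_le_momentRate_left (hk : 0 ≤ k K) : Real.sqrt (m K) ≤ momentRate m m' k K := by
  unfold momentRate
  have h1 : Real.sqrt (m K) ≤ Real.sqrt (max (m K) (m' K)) := Real.sqrt_le_sqrt (le_max_left _ _)
  have h2 : 1 ≤ Real.exp (k K / 2) := Real.one_le_exp (by linarith)
  calc Real.sqrt (m K) = Real.sqrt (m K) * 1 := (mul_one _).symm
    _ ≤ Real.sqrt (max (m K) (m' K)) * Real.exp (k K / 2) := mul_le_mul h1 h2 zero_le_one (Real.sqrt_nonneg _)

/-- `k_K ≥ 0` ⇒ `√m'_K ≤ momentRate_K`. [folklore] -/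
theorem sqrt_le_momentRate_right (hk : 0 ≤ k K) : Real.sqrt (m' K) ≤ momentRate m m' k K := by
  unfold momentRate
  have h1 : Real.sqrt (m' K) ≤ Real.sqrt (max (m K) (m' K)) := Real.sqrt_le_sqrt (le_max_right _ _)
  have h2 : 1 ≤ Real.exp (k K / 2) := Real.one_le_exp (by linarith)
  calc Real.sqrt (m' K) = Real.sqrt (m' K) * 1 := (mul_one _).symm
    _ ≤ Real.sqrt (max (m K) (m' K)) * Real.exp (k K / 2) := mul_le_mul h1 h2 zero_le_one (Real.sqrt_nonneg _)

/-- `k_K ≤ k₀` ⇒ `momentRate_K ≤ (√m_K + √m'_K)·e^{k₀/2}`. [folklore] -/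
theorem momentRate_le_of_le {k₀ : ℝ} (hk : k K ≤ k₀) :
    momentRate m m' k K ≤ (Real.sqrt (m K) + Real.sqrt (m' K)) * Real.exp (k₀ / 2) := by
  unfold momentRate
  have h1 : Real.sqrt (max (m K) (m' K)) ≤ Real.sqrt (m K) + Real.sqrt (m' K) := by
    rw [sqrt_max]
    exact max_le (le_add_of_nonneg_right (Real.sqrt_nonneg _)) (le_add_of_nonneg_left (Real.sqrt_nonneg _))
  have h2 : Real.exp (k K / 2) ≤ Real.exp (k₀ / 2) := Real.exp_le_exp.2 (by linarith)
  exact mul_le_mul h1 h2 (Real.exp_pos _).le (add_nonneg (Real.sqrt_nonneg _) (Real.sqrt_nonneg _))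

/-- **THE MOMENT HALF IS A SQUARE-ROOT CLAUSE.**  For a bounded entropy input `0 ≤ k_K ≤ k₀`:
`Summable (momentRate m m' k) ↔ Summable √m ∧ Summable √m'` (no sign hypothesis on `m`, `m'`). [folklore] -/
theorem summable_momentRate_iff {k₀ : ℝ} (hk : ∀ K, 0 ≤ k K ∧ k K ≤ k₀) :
    Summable (momentRate m m' k) ↔
      Summable (fun K => Real.sqrt (m K)) ∧ Summable (fun K => Real.sqrt (m' K)) := by
  refine ⟨fun h => ⟨?_, ?_⟩, fun h => ?_⟩
  · exact Summable.of_nonneg_of_le (fun K => Real.sqrt_nonneg _) (fun K => sqrt_le_momentRate_left (hk K).1) h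
  · exact Summable.of_nonneg_of_le (fun K => Real.sqrt_nonneg _) (fun K => sqrt_le_momentRate_right (hk K).1) h
  · exact Summable.of_nonneg_of_le (fun K => momentRate_nonneg _ _ _ K) (fun K => momentRate_le_of_le (hk K).2)
      ((h.1.add h.2).mul_right _)

/-- **THE PURE-MOMENT CLAUSE IS A SQUARE-ROOT CLAUSE, UNCONDITIONALLY**: `Summable (mRate M M') ↔ Summable √M ∧ Summable √M'`
— the clause of `T4PathVarianceRate.hasContinuumLimit_of_effTiltMoment` asks that the ROOTS of both endpoint second
moments be summable (the produced entropy payment `√M + √M'` is then bounded by itself). [folklore] -/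
theorem summable_mRate_iff :
    Summable (mRate M M') ↔ Summable (fun K => Real.sqrt (M K)) ∧ Summable (fun K => Real.sqrt (M' K)) := by
  rw [mRate_eq_momentRate]
  have hk0 : ∀ K, 0 ≤ Real.sqrt (M K) + Real.sqrt (M' K) := fun K =>
    add_nonneg (Real.sqrt_nonneg _) (Real.sqrt_nonneg _)
  refine ⟨fun h => ⟨?_, ?_⟩, fun h => ?_⟩
  · exact Summable.of_nonneg_of_le (fun K => Real.sqrt_nonneg _) (fun K => sqrt_le_momentRate_left (hk0 K)) h
  · exact Summable.of_nonneg_of_le (fun K => Real.sqrt_nonneg _) (fun K => sqrt_le_momentRate_right (hk0 K)) h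
  · obtain ⟨B, hB⟩ := (h.1.add h.2).tendsto_atTop_zero.bddAbove_range
    exact (summable_momentRate_iff (k₀ := B) fun K => ⟨hk0 K, hB ⟨K, rfl⟩⟩).2 h

/-- **`√` SPLITS SUMS**: for `a_K, b_K ≥ 0`, `max(√a, √b) ≤ √(a + b) ≤ √a + √b`, hence
`Summable √(a + b) ↔ Summable √a ∧ Summable √b`. [folklore] -/
theorem summable_sqrt_add_iff {a b : ℕ → ℝ} (ha : ∀ K, 0 ≤ a K) (hb : ∀ K, 0 ≤ b K) :
    Summable (fun K => Real.sqrt (a K + b K)) ↔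
      Summable (fun K => Real.sqrt (a K)) ∧ Summable (fun K => Real.sqrt (b K)) := by
  have sqrt_add_le : ∀ K, Real.sqrt (a K + b K) ≤ Real.sqrt (a K) + Real.sqrt (b K) := fun K => by
    rw [Real.sqrt_le_left (add_nonneg (Real.sqrt_nonneg _) (Real.sqrt_nonneg _))]
    nlinarith [Real.sq_sqrt (ha K), Real.sq_sqrt (hb K), mul_nonneg (Real.sqrt_nonneg (a K)) (Real.sqrt_nonneg (b K))]
  refine ⟨fun h => ⟨?_, ?_⟩, fun h => ?_⟩
  · exact Summable.of_nonneg_of_le (fun K => Real.sqrt_nonneg _)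
      (fun K => Real.sqrt_le_sqrt (le_add_of_nonneg_right (hb K))) h
  · exact Summable.of_nonneg_of_le (fun K => Real.sqrt_nonneg _)
      (fun K => Real.sqrt_le_sqrt (le_add_of_nonneg_left (ha K))) h
  · exact Summable.of_nonneg_of_le (fun K => Real.sqrt_nonneg _) sqrt_add_le (h.1.add h.2)

/-- `Summable √(r² + m) ↔ Summable r ∧ Summable √m` for `r_K, m_K ≥ 0`. [folklore] -/
theorem summable_sqrt_sq_add_iff (hr : ∀ K, 0 ≤ r K) (hm : ∀ K, 0 ≤ m K) :
    Summable (fun K => Real.sqrt (r K ^ 2 + m K)) ↔ Summable r ∧ Summable (fun K => Real.sqrt (m K)) := by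
  rw [summable_sqrt_add_iff (fun K => sq_nonneg (r K)) hm]
  have e : (fun K => Real.sqrt (r K ^ 2)) = r := funext fun K => Real.sqrt_sq (hr K)
  rw [e]

/-- **THE CLAUSE OF NE7-M REACHED FROM NE7-SGM.**  `T4PathVarianceRate.effTiltMoment_of_effTiltSandwichGM` produces NE7-M
with `M = r² + m`, `M' = r² + m'`; its clause holds IF AND ONLY IF `Summable r ∧ Summable √m ∧ Summable √m'`
(`r, m, m' ≥ 0`). [folklore] -/
theorem summable_mRate_sq_add_iff (hr : ∀ K, 0 ≤ r K) (hm : ∀ K, 0 ≤ m K) (hm' : ∀ K, 0 ≤ m' K) :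
    Summable (mRate (fun K => r K ^ 2 + m K) (fun K => r K ^ 2 + m' K)) ↔
      Summable r ∧ Summable (fun K => Real.sqrt (m K)) ∧ Summable (fun K => Real.sqrt (m' K)) := by
  rw [summable_mRate_iff]
  show Summable (fun K => Real.sqrt (r K ^ 2 + m K)) ∧ Summable (fun K => Real.sqrt (r K ^ 2 + m' K)) ↔ _
  rw [summable_sqrt_sq_add_iff hr hm, summable_sqrt_sq_add_iff hr hm']
  tauto

/-- The entropy input PRODUCED by NE7-SGM is nonnegative for `r_K, w'_K ≥ 0` (clauses of / immediate from the shape).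
[folklore] -/
theorem gmEntropy_nonneg (hr : 0 ≤ r K) (hw' : 0 ≤ w' K) : 0 ≤ gmEntropy r m w w' K := by
  unfold gmEntropy
  have := Real.sqrt_nonneg (w K * m K)
  positivity

/-- A bound for the produced entropy from bounds on its ingredients: `r_K ≤ r̄`, `w'_K ≤ W'`, `w_K·m_K ≤ P` ⇒
`gmEntropy_K ≤ 2r̄ + 2W' + √P`. [folklore] -/
theorem gmEntropy_le_of_bounds {rbar W' P : ℝ} (hr : r K ≤ rbar) (hw' : w' K ≤ W') (hP : w K * m K ≤ P) :
    gmEntropy r m w w' K ≤ 2 * rbar + 2 * W' + Real.sqrt P := by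
  unfold gmEntropy
  have := Real.sqrt_le_sqrt hP
  linarith

/-- Two-sided entropy bounds in producer form: `0 ≤ r_K ≤ r̄`, `0 ≤ w_K ≤ W`, `0 ≤ w'_K ≤ W'`, `0 ≤ m_K ≤ m̄` ⇒
`0 ≤ gmEntropy_K ≤ 2r̄ + 2W' + √(W·m̄)`. [folklore] -/
theorem gmEntropy_bounds {rbar W W' mbar : ℝ} (hr : 0 ≤ r K ∧ r K ≤ rbar) (hw : 0 ≤ w K ∧ w K ≤ W)
    (hw' : 0 ≤ w' K ∧ w' K ≤ W') (hmK : 0 ≤ m K ∧ m K ≤ mbar) :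
    0 ≤ gmEntropy r m w w' K ∧ gmEntropy r m w w' K ≤ 2 * rbar + 2 * W' + Real.sqrt (W * mbar) :=
  ⟨gmEntropy_nonneg hr.1 hw'.1,
    gmEntropy_le_of_bounds hr.2 hw'.2 (mul_le_mul hw.2 hmK.2 hmK.1 (hw.1.trans hw.2))⟩

/-- **THE MOMENT-SANDWICH CLAUSE, THREE CONJUNCTS**: for `r_K ≥ 0`, `max(m_K, m'_K) ≥ 0` and a bounded produced entropy
`0 ≤ gmEntropy_K ≤ k₀`, `Summable (gmRate r m m' w w') ↔ Summable r ∧ Summable √m ∧ Summable √m'`. [folklore] -/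
theorem summable_gmRate_iff_of_bounded (hr : ∀ K, 0 ≤ r K) (hm : ∀ K, 0 ≤ max (m K) (m' K)) {k₀ : ℝ}
    (hk : ∀ K, 0 ≤ gmEntropy r m w w' K ∧ gmEntropy r m w w' K ≤ k₀) :
    Summable (gmRate r m m' w w') ↔
      Summable r ∧ Summable (fun K => Real.sqrt (m K)) ∧ Summable (fun K => Real.sqrt (m' K)) := by
  rw [summable_gmRate_iff hr hm, summable_momentRate_iff hk]

/-- **THE LADDER STEP GM ⇒ M LOSES NOTHING AT CLAUSE LEVEL**: with a bounded produced entropy the clause of NE7-SGM and the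
clause of the NE7-M it produces (`effTiltMoment_of_effTiltSandwichGM`: `M = r² + m`, `M' = r² + m'`) are EQUIVALENT.
[folklore] -/
theorem summable_gmRate_iff_summable_mRate (hr : ∀ K, 0 ≤ r K) (hm : ∀ K, 0 ≤ m K) (hm' : ∀ K, 0 ≤ m' K) {k₀ : ℝ}
    (hk : ∀ K, 0 ≤ gmEntropy r m w w' K ∧ gmEntropy r m w w' K ≤ k₀) :
    Summable (gmRate r m m' w w') ↔ Summable (mRate (fun K => r K ^ 2 + m K) (fun K => r K ^ 2 + m' K)) := by
  rw [summable_gmRate_iff_of_bounded hr (fun K => le_max_of_le_left (hm K)) hk, summable_mRate_sq_add_iff hr hm hm']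

/-! ### §4.3 Necessity: the final-scale floor is an event floor and survives the change of currency -/

/-- A floor under the root: `M_K ≥ c > 0` eventually ⇒ `√M` is not summable. [folklore] -/
theorem not_summable_sqrt_of_floor {c : ℝ} (hc : 0 < c) (h : ∀ᶠ K in atTop, c ≤ M K) :
    ¬ Summable (fun K => Real.sqrt (M K)) :=
  not_summable_of_floor (sqrt_pos_of_pos hc) (h.mono fun _ hK => Real.sqrt_le_sqrt hK)

/-- **A FLOOR IN THE FIRST MOMENT SLOT KILLS THE PURE-MOMENT CLAUSE**, whatever `M'`. [folklore] -/
theorem not_summable_mRate_of_floor {c : ℝ} (hc : 0 < c) (h : ∀ᶠ K in atTop, c ≤ M K) :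
    ¬ Summable (mRate M M') :=
  fun hs => not_summable_sqrt_of_floor hc h (summable_mRate_iff.1 hs).1

/-- … and so does a floor in the second slot, whatever `M`. [folklore] -/
theorem not_summable_mRate_of_floor' {c : ℝ} (hc : 0 < c) (h : ∀ᶠ K in atTop, c ≤ M' K) :
    ¬ Summable (mRate M M') :=
  fun hs => not_summable_sqrt_of_floor hc h (summable_mRate_iff.1 hs).2

/-- **A FLOOR IN THE FIRST TAIL-MOMENT SLOT KILLS THE MOMENT-SANDWICH CLAUSE**, whatever `r, m', w, w'`
(`r_K, w'_K ≥ 0` eventually, clauses of the shape). [folklore] -/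
theorem not_summable_gmRate_of_tail_floor {c : ℝ} (hc : 0 < c) (h : ∀ᶠ K in atTop, c ≤ m K)
    (hr : ∀ᶠ K in atTop, 0 ≤ r K) (hw' : ∀ᶠ K in atTop, 0 ≤ w' K) : ¬ Summable (gmRate r m m' w w') :=
  not_summable_of_floor (sqrt_pos_of_pos hc)
    ((h.and (hr.and hw')).mono fun _ hK =>
      (Real.sqrt_le_sqrt hK.1).trans
        ((sqrt_le_momentRate_left (gmEntropy_nonneg hK.2.1 hK.2.2)).trans
          (momentRate_le_gmRate (le_max_of_le_left (hc.le.trans hK.1)))))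

/-- … and so does a floor in the second tail-moment slot. [folklore] -/
theorem not_summable_gmRate_of_tail_floor' {c : ℝ} (hc : 0 < c) (h : ∀ᶠ K in atTop, c ≤ m' K)
    (hr : ∀ᶠ K in atTop, 0 ≤ r K) (hw' : ∀ᶠ K in atTop, 0 ≤ w' K) : ¬ Summable (gmRate r m m' w w') :=
  not_summable_of_floor (sqrt_pos_of_pos hc)
    ((h.and (hr.and hw')).mono fun _ hK =>
      (Real.sqrt_le_sqrt hK.1).trans
        ((sqrt_le_momentRate_right (gmEntropy_nonneg hK.2.1 hK.2.2)).trans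
          (momentRate_le_gmRate (le_max_of_le_right (hc.le.trans hK.1)))))

/-- **CHEBYSHEV FROM BELOW.**  On a finite measure space, if the square `(f − κ)²` is integrable and `d ≤ |f − κ|` on a
measurable event `B ⊆ S` (`d ≥ 0`), then `μ(B)·d² ≤ ∫_S (f − κ)² dμ`. [folklore] -/
theorem measureReal_mul_sq_le_setIntegral {X : Type*} [MeasurableSpace X] {μ : Measure X} [IsFiniteMeasure μ]
    {f : X → ℝ} {κ d : ℝ} {B S : Set X} (hB : MeasurableSet B) (hBS : B ⊆ S) (hd : 0 ≤ d)
    (hdisc : ∀ u ∈ B, d ≤ |f u - κ|) (hi : Integrable (fun u => (f u - κ) ^ 2) μ) :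
    μ.real B * d ^ 2 ≤ ∫ u in S, (f u - κ) ^ 2 ∂μ := by
  calc μ.real B * d ^ 2 = ∫ _ in B, d ^ 2 ∂μ := by rw [setIntegral_const, smul_eq_mul]
    _ ≤ ∫ u in B, (f u - κ) ^ 2 ∂μ := by
        refine setIntegral_mono_on (integrable_const _).integrableOn hi.integrableOn hB fun u hu => ?_
        calc d ^ 2 ≤ |f u - κ| ^ 2 := pow_le_pow_left₀ hd (hdisc u hu) 2
          _ = (f u - κ) ^ 2 := sq_abs _
    _ ≤ ∫ u in S, (f u - κ) ^ 2 ∂μ :=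
        setIntegral_mono_set hi.integrableOn (Eventually.of_forall fun u => sq_nonneg (f u - κ)) hBS.eventuallyLE

/-- The same against the FULL second moment: `μ(B)·d² ≤ ∫ (f − κ)² dμ`. [folklore] -/
theorem measureReal_mul_sq_le_integral {X : Type*} [MeasurableSpace X] {μ : Measure X} [IsFiniteMeasure μ]
    {f : X → ℝ} {κ d : ℝ} {B : Set X} (hB : MeasurableSet B) (hd : 0 ≤ d) (hdisc : ∀ u ∈ B, d ≤ |f u - κ|)
    (hi : Integrable (fun u => (f u - κ) ^ 2) μ) : μ.real B * d ^ 2 ≤ ∫ u, (f u - κ) ^ 2 ∂μ := by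
  have h := measureReal_mul_sq_le_setIntegral hB (Set.subset_univ B) hd hdisc hi
  rwa [Measure.restrict_univ] at h

/-- A bounded measurable relative action has an integrable centred square on a finite measure space (the qualitative
clauses `Measurable f`, `∃ R, ∀ u, |f u| ≤ R` of the shapes NE7-M / NE7-SGM). [folklore] -/
theorem integrable_sq_sub_of_abs_le {X : Type*} [MeasurableSpace X] (μ : Measure X) [IsFiniteMeasure μ] {f : X → ℝ}
    (hf : Measurable f) {R : ℝ} (hR : ∀ u, |f u| ≤ R) (κ : ℝ) : Integrable (fun u => (f u - κ) ^ 2) μ := by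
  refine (integrable_const ((R + |κ|) ^ 2)).mono' ((hf.sub measurable_const).pow_const 2).aestronglyMeasurable
    (Eventually.of_forall fun u => ?_)
  rw [Real.norm_eq_abs, abs_of_nonneg (sq_nonneg _), ← sq_abs]
  exact pow_le_pow_left₀ (abs_nonneg _) ((abs_sub _ _).trans (add_le_add (hR u) le_rfl)) 2

/-- **AN EVENT FLOOR KILLS THE PURE-MOMENT CLAUSE.**  For a family of finite measures `μ_K`, relative actions `f_K` with
levels `κ_K`, and measurable events `B_K` with `μ_K(B_K) ≥ c > 0` on which `|f_K − κ_K| ≥ d > 0`: every moment majorant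
`M_K ≥ ∫(f_K − κ_K)² dμ_K` satisfies `M_K ≥ c·d²`, so `mRate M M'` is not summable, for every `M'`. [folklore] -/
theorem not_summable_mRate_of_event_floor {X : Type*} [MeasurableSpace X] (μ : ℕ → Measure X)
    [∀ K, IsFiniteMeasure (μ K)] (f : ℕ → X → ℝ) (κ : ℕ → ℝ) {B : ℕ → Set X} (hB : ∀ K, MeasurableSet (B K))
    {c d : ℝ} (hc : 0 < c) (hd : 0 < d) (hfloor : ∀ K, c ≤ (μ K).real (B K))
    (hdisc : ∀ K, ∀ u ∈ B K, d ≤ |f K u - κ K|) (hi : ∀ K, Integrable (fun u => (f K u - κ K) ^ 2) (μ K))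
    (hM : ∀ K, ∫ u, (f K u - κ K) ^ 2 ∂(μ K) ≤ M K) : ¬ Summable (mRate M M') := by
  refine not_summable_mRate_of_floor (mul_pos hc (pow_pos hd 2)) (Eventually.of_forall fun K => ?_)
  calc c * d ^ 2 ≤ (μ K).real (B K) * d ^ 2 := mul_le_mul_of_nonneg_right (hfloor K) (sq_nonneg _)
    _ ≤ ∫ u, (f K u - κ K) ^ 2 ∂(μ K) := measureReal_mul_sq_le_integral (hB K) hd.le (hdisc K) (hi K)
    _ ≤ M K := hM K

/-- **THE FINAL-SCALE FLOOR IN THE MOMENT CURRENCY** (§2's `not_summable_gbRate_of_finalScale_floor` transported to NE7-M;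
audit C-t4r3-1 (A1) in kernel form for the shape `EffTiltMoment`).  Along any family of endpoint-normalised runs
(`Step.Discrete031 b β′ K g (gs K)` for every cutoff `K`, so `p₀(gs K K) = p₀(g)` by `p0Profile_endpoint`): if for every `K`
an event `B_K` has one-run mass at least `c·exp(−p₀(gs K K))` under `μ_K` and the relative action of the two runs stays at
least `d > 0` away from its level `κ_K` on `B_K`, then EVERY moment majorant `M_K ≥ ∫(f_K − κ_K)² dμ_K` is bounded below by
`c·e^{−p₀(g)}·d²` and `mRate M M'` is NOT summable, for every `M'`.  Dictionary [analysis]: `B_K` = the unit-scale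
(LAST RG steps) large-field event of run `K`, whose one-run mass along endpoint-normalised runs is `K`-independent; the
moment currency of `T4PathVarianceRate` v1.3 §8 removes the sup-range as the SIZE assigned to the off-good-set
discrepancy, not the EVENT, so `Σ_K mRate_K < ∞` requires `d = d_K → 0` summably in root-mean-square ON that event — a
term-wise comparison of the two runs' young (recent-in-RG-time; audit (A1)'s «OLD») large-field action terms, in `L²`
instead of `sup`. [folklore] -/
theorem not_summable_mRate_of_finalScale_event_floor {X : Type*} [MeasurableSpace X] (μ : ℕ → Measure X)
    [∀ K, IsFiniteMeasure (μ K)] {b β' g : ℝ} (A₀ : ℝ) (p₀ : ℕ) {gs : ℕ → ℕ → ℝ}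
    (h031 : ∀ K, Step.Discrete031 b β' K g (gs K)) (f : ℕ → X → ℝ) (κ : ℕ → ℝ) {B : ℕ → Set X}
    (hB : ∀ K, MeasurableSet (B K)) {c d : ℝ} (hc : 0 < c) (hd : 0 < d)
    (hfloor : ∀ K, c * Real.exp (-(p0Profile A₀ p₀ (gs K K))) ≤ (μ K).real (B K))
    (hdisc : ∀ K, ∀ u ∈ B K, d ≤ |f K u - κ K|) (hi : ∀ K, Integrable (fun u => (f K u - κ K) ^ 2) (μ K))
    (hM : ∀ K, ∫ u, (f K u - κ K) ^ 2 ∂(μ K) ≤ M K) : ¬ Summable (mRate M M') :=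
  not_summable_mRate_of_event_floor μ f κ hB (mul_pos hc (Real.exp_pos (-(p0Profile A₀ p₀ g)))) hd
    (fun K => by
      have h := hfloor K
      rwa [p0Profile_endpoint A₀ p₀ (h031 K)] at h)
    hdisc hi hM

/-- **THE FINAL-SCALE FLOOR IN THE MOMENT-SANDWICH CURRENCY** (the same for the shape `EffTiltSandwichGM`): if the event
`B_K` lies in the BAD set `(Gd_K)ᶜ` for every `K`, every TAIL-moment majorant `m_K ≥ ∫_{Gd_Kᶜ}(f_K − κ_K)² dμ_K` is bounded
below by `c·e^{−p₀(g)}·d²` and `gmRate r m m' w w'` is NOT summable, for every `r ≥ 0`, `m'`, `w`, `w' ≥ 0`.  (If instead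
`B_K ⊆ Gd_K`, the shape asks the POINTWISE sandwich `|f_K − κ_K| ≤ r_K` on `B_K`: either way a term-wise comparison on the
final-scale large-field event.) [folklore] -/
theorem not_summable_gmRate_of_finalScale_event_floor {X : Type*} [MeasurableSpace X] (μ : ℕ → Measure X)
    [∀ K, IsFiniteMeasure (μ K)] {b β' g : ℝ} (A₀ : ℝ) (p₀ : ℕ) {gs : ℕ → ℕ → ℝ}
    (h031 : ∀ K, Step.Discrete031 b β' K g (gs K)) (f : ℕ → X → ℝ) (κ : ℕ → ℝ) {B Gd : ℕ → Set X}
    (hB : ∀ K, MeasurableSet (B K)) (hBG : ∀ K, B K ⊆ (Gd K)ᶜ) {c d : ℝ} (hc : 0 < c) (hd : 0 < d)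
    (hfloor : ∀ K, c * Real.exp (-(p0Profile A₀ p₀ (gs K K))) ≤ (μ K).real (B K))
    (hdisc : ∀ K, ∀ u ∈ B K, d ≤ |f K u - κ K|) (hi : ∀ K, Integrable (fun u => (f K u - κ K) ^ 2) (μ K))
    (hm : ∀ K, ∫ u in (Gd K)ᶜ, (f K u - κ K) ^ 2 ∂(μ K) ≤ m K) (hr : ∀ K, 0 ≤ r K) (hw' : ∀ K, 0 ≤ w' K) :
    ¬ Summable (gmRate r m m' w w') := by
  have hc' : 0 < c * Real.exp (-(p0Profile A₀ p₀ g)) * d ^ 2 :=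
    mul_pos (mul_pos hc (Real.exp_pos _)) (pow_pos hd 2)
  refine not_summable_gmRate_of_tail_floor hc' (Eventually.of_forall fun K => ?_) (Eventually.of_forall hr)
    (Eventually.of_forall hw')
  have h2 : c * Real.exp (-(p0Profile A₀ p₀ g)) ≤ (μ K).real (B K) := by
    have h := hfloor K
    rwa [p0Profile_endpoint A₀ p₀ (h031 K)] at h
  calc c * Real.exp (-(p0Profile A₀ p₀ g)) * d ^ 2 ≤ (μ K).real (B K) * d ^ 2 :=
        mul_le_mul_of_nonneg_right h2 (sq_nonneg _)
    _ ≤ ∫ u in (Gd K)ᶜ, (f K u - κ K) ^ 2 ∂(μ K) :=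
        measureReal_mul_sq_le_setIntegral (hB K) (hBG K) hd.le (hdisc K) (hi K)
    _ ≤ m K := hm K

/-! ### §4.4 The banked model in the moment currency: the doubled window persists; the conditional-RMS exponent -/

/-- THE BANKED MODEL, crude tail: `4·bankedRange² · bankedWeight` — the tail second moment granted by the sup-range alone
(`T4PathVarianceRate.effTiltSandwichGM_of_effTiltSandwichGB₀`: `m := 4R²w`) in the banked model of §3. [folklore] -/
def bankedTailMoment (R₀ Λ C V ρ C' : ℝ) : ℕ → ℝ := fun K => 4 * bankedRange R₀ Λ C K ^ 2 * bankedWeight V ρ C' K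

/-- [folklore] -/
theorem bankedTailMoment_nonneg {R₀ Λ C V ρ C' : ℝ} (hV : 0 ≤ V) (hρ : 0 ≤ ρ) (K : ℕ) :
    0 ≤ bankedTailMoment R₀ Λ C V ρ C' K := by
  unfold bankedTailMoment
  have := bankedWeight_nonneg (C' := C') hV hρ K
  positivity

/-- The root of the crude tail in closed form: `√(bankedTailMoment_K) = 2R₀·√V·(Λ^{ageCut C K}·(√ρ)^{ageCut C′ K})` — the
weight half of §3 at `k = 0` (`weightRate_banked_eq`). [folklore] -/
theorem sqrt_bankedTailMoment_eq {R₀ Λ C V ρ C' : ℝ} (hR₀ : 0 ≤ R₀) (hΛ : 0 ≤ Λ) (hV : 0 ≤ V) (hρ : 0 ≤ ρ) (K : ℕ) :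
    Real.sqrt (bankedTailMoment R₀ Λ C V ρ C' K) =
      2 * R₀ * Real.sqrt V * (Λ ^ ageCut C K * Real.sqrt ρ ^ ageCut C' K) := by
  show Real.sqrt (4 * (R₀ * Λ ^ ageCut C K) ^ 2 * (V * ρ ^ ageCut C' K)) = _
  rw [show 4 * (R₀ * Λ ^ ageCut C K) ^ 2 * (V * ρ ^ ageCut C' K) =
      (2 * R₀ * Λ ^ ageCut C K) ^ 2 * (V * ρ ^ ageCut C' K) by ring,
    Real.sqrt_mul' _ (by positivity), Real.sqrt_sq (by positivity), Real.sqrt_mul hV, sqrt_pow_eq hρ]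
  ring

/-- **THE CRUDE TAIL AT THE LOG WINDOW IS THE DOUBLED WINDOW AGAIN**: in the banked model (`R₀, V > 0`, `0 < ρ < 1`,
`Λ ≥ 1`, `C, C′ ≥ 0`) `Summable √(bankedTailMoment) ↔ 2 + 2C·log Λ < C′·(−log ρ)` — §3's `summable_weightRate_banked_iff`
in the moment currency. [folklore] -/
theorem summable_sqrt_bankedTailMoment_iff {R₀ Λ C V ρ C' : ℝ} (hR₀ : 0 < R₀) (hV : 0 < V) (h0 : 0 < ρ) (h1 : ρ < 1)
    (hΛ : 1 ≤ Λ) (hC : 0 ≤ C) (hC' : 0 ≤ C') :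
    Summable (fun K => Real.sqrt (bankedTailMoment R₀ Λ C V ρ C' K)) ↔
      2 + 2 * C * Real.log Λ < C' * (-Real.log ρ) := by
  have hA : 0 < 2 * R₀ * Real.sqrt V := by
    have := sqrt_pos_of_pos hV
    positivity
  simp_rw [sqrt_bankedTailMoment_eq hR₀.le (zero_le_one.trans hΛ) hV.le h0.le]
  rw [summable_mul_left_iff hA.ne', summable_pow_ageCut_mul_sqrt_iff h0 h1 hΛ hC hC']

/-- **STRICT SEPARATION, MOMENT FORM.**  If `1 < C′·(−log ρ) ≤ 2` the banked weights satisfy the LINEAR weight clause but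
the root of the crude tail is NOT summable even for bounded range (`Λ = 1`, `C = 0`). [folklore] -/
theorem linear_window_not_moment_window {R₀ V ρ C' : ℝ} (hR₀ : 0 < R₀) (hV : 0 < V) (h0 : 0 < ρ) (h1 : ρ < 1)
    (hC' : 0 ≤ C') (hlo : 1 < C' * (-Real.log ρ)) (hhi : C' * (-Real.log ρ) ≤ 2) :
    Summable (bankedWeight V ρ C') ∧ ¬ Summable (fun K => Real.sqrt (bankedTailMoment R₀ 1 0 V ρ C' K)) := by
  refine ⟨(summable_bankedWeight_iff hV h0 h1 hC').2 hlo, fun hs => ?_⟩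
  have h := (summable_sqrt_bankedTailMoment_iff hR₀ hV h0 h1 le_rfl le_rfl hC').1 hs
  rw [Real.log_one] at h
  linarith

/-- In the crude banked model the product `bankedWeight · bankedTailMoment` is BOUNDED as soon as the product threshold
`1 < C′·(−log ρ) − C·log Λ` holds (so the produced entropy `gmEntropy` is bounded). [folklore] -/
theorem bankedWeight_mul_bankedTailMoment_bounded {R₀ Λ C V ρ C' : ℝ} (h0 : 0 < ρ) (h1 : ρ < 1) (hΛ : 1 ≤ Λ)
    (hC : 0 ≤ C) (hC' : 0 ≤ C') (hq : 1 < C' * (-Real.log ρ) - C * Real.log Λ) :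
    ∃ P, ∀ K, bankedWeight V ρ C' K * bankedTailMoment R₀ Λ C V ρ C' K ≤ P := by
  have hΛ0 : 0 < Λ := one_pos.trans_le hΛ
  have hs : Summable (fun K : ℕ => Λ ^ ageCut C K * ρ ^ ageCut C' K) :=
    (summable_pow_ageCut_mul_iff hΛ hC h0 h1 hC').2 hq
  obtain ⟨B, hB⟩ := hs.tendsto_atTop_zero.bddAbove_range
  have hB' : ∀ K, Λ ^ ageCut C K * ρ ^ ageCut C' K ≤ B := fun K => hB ⟨K, rfl⟩
  refine ⟨4 * R₀ ^ 2 * V ^ 2 * B ^ 2, fun K => ?_⟩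
  show V * ρ ^ ageCut C' K * (4 * (R₀ * Λ ^ ageCut C K) ^ 2 * (V * ρ ^ ageCut C' K)) ≤ _
  have e : V * ρ ^ ageCut C' K * (4 * (R₀ * Λ ^ ageCut C K) ^ 2 * (V * ρ ^ ageCut C' K)) =
      4 * R₀ ^ 2 * V ^ 2 * (Λ ^ ageCut C K * ρ ^ ageCut C' K) ^ 2 := by ring
  rw [e]
  have hP0 : 0 ≤ Λ ^ ageCut C K * ρ ^ ageCut C' K := by positivity
  exact mul_le_mul_of_nonneg_left (pow_le_pow_left₀ hP0 (hB' K) 2) (by positivity)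

/-- **THE MOMENT-SANDWICH CLAUSE IN THE CRUDE BANKED MODEL** (tail moments `bankedTailMoment`, weights `bankedWeight`, a
bounded summable nonnegative two-run input `r`, entropy PRODUCED as `gmEntropy`): `Summable (gmRate …)` holds IF AND ONLY
IF `2 + 2C·log Λ < C′·(−log ρ)` — §3's `summable_gbRate_gbEntropy_banked_iff` verbatim in the moment currency. [folklore] -/
theorem summable_gmRate_banked_iff {R₀ Λ C V ρ C' rbar : ℝ} (hR₀ : 0 < R₀) (hV : 0 < V) (h0 : 0 < ρ) (h1 : ρ < 1)
    (hΛ : 1 ≤ Λ) (hC : 0 ≤ C) (hC' : 0 ≤ C') (hr : ∀ K, 0 ≤ r K ∧ r K ≤ rbar) (hrs : Summable r) :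
    Summable (gmRate r (bankedTailMoment R₀ Λ C V ρ C') (bankedTailMoment R₀ Λ C V ρ C') (bankedWeight V ρ C')
        (bankedWeight V ρ C')) ↔ 2 + 2 * C * Real.log Λ < C' * (-Real.log ρ) := by
  have hm0 : ∀ K, 0 ≤ bankedTailMoment R₀ Λ C V ρ C' K := fun K => bankedTailMoment_nonneg hV.le h0.le K
  have hmx : ∀ K, 0 ≤ max (bankedTailMoment R₀ Λ C V ρ C' K) (bankedTailMoment R₀ Λ C V ρ C' K) := fun K =>
    le_max_of_le_left (hm0 K)
  have hk0 : ∀ K, 0 ≤ gmEntropy r (bankedTailMoment R₀ Λ C V ρ C') (bankedWeight V ρ C') (bankedWeight V ρ C') K :=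
    fun K => gmEntropy_nonneg (hr K).1 (bankedWeight_nonneg hV.le h0.le K)
  refine ⟨fun hs => ?_, fun hwin => ?_⟩
  · have h2 := ((summable_gmRate_iff (fun K => (hr K).1) hmx).1 hs).2
    exact (summable_sqrt_bankedTailMoment_iff hR₀ hV h0 h1 hΛ hC hC').1
      (Summable.of_nonneg_of_le (fun K => Real.sqrt_nonneg _) (fun K => sqrt_le_momentRate_left (hk0 K)) h2)
  · have hsq := (summable_sqrt_bankedTailMoment_iff hR₀ hV h0 h1 hΛ hC hC').2 hwin
    obtain ⟨P, hP⟩ := bankedWeight_mul_bankedTailMoment_bounded (R₀ := R₀) (V := V) h0 h1 hΛ hC hC'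
      (productWindow_of_doubledWindow hΛ hC hwin)
    have hk : ∀ K, 0 ≤ gmEntropy r (bankedTailMoment R₀ Λ C V ρ C') (bankedWeight V ρ C') (bankedWeight V ρ C') K ∧
        gmEntropy r (bankedTailMoment R₀ Λ C V ρ C') (bankedWeight V ρ C') (bankedWeight V ρ C') K ≤
          2 * rbar + 2 * V + Real.sqrt P :=
      fun K => ⟨hk0 K, gmEntropy_le_of_bounds (hr K).2 (bankedWeight_le hV.le h0.le h1.le K) (hP K)⟩
    exact (summable_gmRate_iff_of_bounded (fun K => (hr K).1) hmx hk).2 ⟨hrs, hsq, hsq⟩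

/-- **THE PURE-MOMENT CLAUSE IN THE CRUDE BANKED MODEL** (NE7-M reached through GM ⇒ M: `M = M' = r² + bankedTailMoment`):
`Summable (mRate …) ↔ 2 + 2C·log Λ < C′·(−log ρ)` for a summable nonnegative two-run input `r`. [folklore] -/
theorem summable_mRate_banked_iff {R₀ Λ C V ρ C' : ℝ} (hR₀ : 0 < R₀) (hV : 0 < V) (h0 : 0 < ρ) (h1 : ρ < 1)
    (hΛ : 1 ≤ Λ) (hC : 0 ≤ C) (hC' : 0 ≤ C') (hr : ∀ K, 0 ≤ r K) (hrs : Summable r) :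
    Summable (mRate (fun K => r K ^ 2 + bankedTailMoment R₀ Λ C V ρ C' K)
        (fun K => r K ^ 2 + bankedTailMoment R₀ Λ C V ρ C' K)) ↔ 2 + 2 * C * Real.log Λ < C' * (-Real.log ρ) := by
  have hm0 : ∀ K, 0 ≤ bankedTailMoment R₀ Λ C V ρ C' K := fun K => bankedTailMoment_nonneg hV.le h0.le K
  rw [summable_mRate_sq_add_iff hr hm0 hm0, summable_sqrt_bankedTailMoment_iff hR₀ hV h0 h1 hΛ hC hC']
  exact ⟨fun h => h.2.1, fun h => ⟨hrs, h, h⟩⟩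

/-- **WHAT THE MOMENT FORM BUYS: A CONDITIONAL-RMS MAJORANT.**  If the discrepancy on the bad set is at most `s_K` in
root-mean-square CONDITIONALLY on the bad set — `m_K ≤ w_K·s_K²` — then `√m_K ≤ √w_K·s_K` (`s_K ≥ 0`): the tail moment
enters the clause as (root of the weight) × (conditional RMS), where §1's weight half had (root of the weight) × (range).
[folklore] -/
theorem sqrt_le_of_condRMS {mK wK sK : ℝ} (hs : 0 ≤ sK) (h : mK ≤ wK * sK ^ 2) :
    Real.sqrt mK ≤ Real.sqrt wK * sK := by
  calc Real.sqrt mK ≤ Real.sqrt (wK * sK ^ 2) := Real.sqrt_le_sqrt h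
    _ = Real.sqrt wK * sK := by rw [Real.sqrt_mul' _ (sq_nonneg _), Real.sqrt_sq hs]

/-- **PRODUCER FORM, CONDITIONAL-RMS SCALE AT THE LOG WINDOW.**  Tail moments majorised by banked weights times the square
of a conditional-RMS scale growing at most like a power of `K + 1`,
`m_K ≤ V·ρ^{ageCut C′ K}·(s₀·Λ_s^{ageCut C_s K})²` (`s₀, V ≥ 0`, `0 < ρ < 1`, `Λ_s ≥ 1`, `C_s, C′ ≥ 0`), and the window
`2 + 2C_s·log Λ_s < C′·(−log ρ)` ⇒ `Summable √m`.  Compared with §3 (`summable_weightRate_of_banked_le`) the RANGE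
exponent `C·log Λ` is replaced by the conditional-RMS exponent `C_s·log Λ_s`; the factor two stays. [folklore] -/
theorem summable_sqrt_of_condRMS_banked_le {s₀ Λs Cs V ρ C' : ℝ} (hs₀ : 0 ≤ s₀) (hV : 0 ≤ V) (h0 : 0 < ρ)
    (h1 : ρ < 1) (hΛ : 1 ≤ Λs) (hC : 0 ≤ Cs) (hC' : 0 ≤ C')
    (hb : ∀ K, m K ≤ V * ρ ^ ageCut C' K * (s₀ * Λs ^ ageCut Cs K) ^ 2)
    (hwin : 2 + 2 * Cs * Real.log Λs < C' * (-Real.log ρ)) : Summable (fun K => Real.sqrt (m K)) := by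
  have hΛ0 : 0 ≤ Λs := zero_le_one.trans hΛ
  have hle : ∀ K, Real.sqrt (m K) ≤ s₀ * Real.sqrt V * (Λs ^ ageCut Cs K * Real.sqrt ρ ^ ageCut C' K) := fun K => by
    calc Real.sqrt (m K) ≤ Real.sqrt (V * ρ ^ ageCut C' K) * (s₀ * Λs ^ ageCut Cs K) :=
          sqrt_le_of_condRMS (by positivity) (hb K)
      _ = s₀ * Real.sqrt V * (Λs ^ ageCut Cs K * Real.sqrt ρ ^ ageCut C' K) := by
          rw [Real.sqrt_mul hV, sqrt_pow_eq h0.le]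
          ring
  exact Summable.of_nonneg_of_le (fun K => Real.sqrt_nonneg _) hle
    (((summable_pow_ageCut_mul_sqrt_iff h0 h1 hΛ hC hC').2 hwin).mul_left _)

/-- **PRODUCER FORM FOR THE WHOLE MOMENT-SANDWICH CLAUSE**: a bounded summable nonnegative two-run input `r`, both tail
moments under the conditional-RMS banked majorant, weights `0 ≤ w_K ≤ W`, `0 ≤ w'_K ≤ W'`, and the window
`2 + 2C_s·log Λ_s < C′·(−log ρ)` ⇒ `Summable (gmRate r m m' w w')` — the clause of
`T4PathVarianceRate.hasContinuumLimit_of_effTiltSandwichGM`, which then applies by name.  No instance is asserted.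
[folklore] -/
theorem summable_gmRate_of_condRMS_banked_le {s₀ Λs Cs V ρ C' W W' rbar : ℝ} (hs₀ : 0 ≤ s₀) (hV : 0 ≤ V)
    (h0 : 0 < ρ) (h1 : ρ < 1) (hΛ : 1 ≤ Λs) (hC : 0 ≤ Cs) (hC' : 0 ≤ C') (hr : ∀ K, 0 ≤ r K ∧ r K ≤ rbar)
    (hrs : Summable r) (hm : ∀ K, 0 ≤ m K ∧ m K ≤ V * ρ ^ ageCut C' K * (s₀ * Λs ^ ageCut Cs K) ^ 2)
    (hm' : ∀ K, 0 ≤ m' K ∧ m' K ≤ V * ρ ^ ageCut C' K * (s₀ * Λs ^ ageCut Cs K) ^ 2)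
    (hw : ∀ K, 0 ≤ w K ∧ w K ≤ W) (hw' : ∀ K, 0 ≤ w' K ∧ w' K ≤ W')
    (hwin : 2 + 2 * Cs * Real.log Λs < C' * (-Real.log ρ)) : Summable (gmRate r m m' w w') := by
  have hsm : Summable (fun K => Real.sqrt (m K)) :=
    summable_sqrt_of_condRMS_banked_le hs₀ hV h0 h1 hΛ hC hC' (fun K => (hm K).2) hwin
  have hsm' : Summable (fun K => Real.sqrt (m' K)) :=
    summable_sqrt_of_condRMS_banked_le hs₀ hV h0 h1 hΛ hC hC' (fun K => (hm' K).2) hwin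
  obtain ⟨B, hB⟩ := hsm.tendsto_atTop_zero.bddAbove_range
  have hmB : ∀ K, m K ≤ B ^ 2 := fun K => by
    have h : Real.sqrt (m K) ≤ B := hB ⟨K, rfl⟩
    calc m K = Real.sqrt (m K) ^ 2 := (Real.sq_sqrt (hm K).1).symm
      _ ≤ B ^ 2 := pow_le_pow_left₀ (Real.sqrt_nonneg _) h 2
  exact (summable_gmRate_iff_of_bounded (fun K => (hr K).1) (fun K => le_max_of_le_left (hm K).1)
    fun K => gmEntropy_bounds (hr K) (hw K) (hw' K) ⟨(hm K).1, hmB K⟩).2 ⟨hrs, hsm, hsm'⟩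

/-! ### §4.5 (v1.3) The entropy hypothesis is self-funding: GM ⇔ M at clause level from weight bounds alone

§4.2's `summable_gmRate_iff_summable_mRate` asks a bound `0 ≤ gmEntropy_K ≤ k₀` on the PRODUCED entropy
`gmEntropy = 2r + 2w' + √(w·m)`.  That bound is produced by the M-clause itself once the bad-set weight MAJORANTS are
bounded (`0 ≤ w_K ≤ W`, `0 ≤ w'_K ≤ W'`; for NE7-SGM `w'_K ≤ ½` is a clause of the shape and `w_K ≤ 1` after the harmless
normalisation `w ↦ min(w, 1)`, effective laws being probability measures): `Summable r` and `Summable √m` make `r` and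
`√m` bounded (summable ⇒ null), whence `gmEntropy_K ≤ 2·sup r + 2W' + √(W·(sup √m)²)`.  So the GM-clause and the
M-clause of the NE7-M it produces are equivalent with NO entropy hypothesis; one direction needs signs only.  Reading
[analysis]: at clause level the GM currency carries exactly the summability content of the M currency — what NE7-SGM adds
over NE7-M is the SHAPE (the good/bad split exploited in §4.3–§4.4), not the clause. [folklore] real arithmetic. -/

/-- **THE PRODUCED ENTROPY IS BOUNDED BY THE CLAUSE ITSELF.**  If the two-run input `r ≥ 0` and the root `√m` of the first
tail moment (`m ≥ 0`) are summable and the bad-set weight majorants are bounded, `0 ≤ w_K ≤ W`, `0 ≤ w'_K ≤ W'`, then the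
entropy PRODUCED by NE7-SGM, `gmEntropy = 2r + 2w' + √(w·m)`, is bounded: `0 ≤ gmEntropy_K ≤ 2r̄ + 2W' + √(W·s̄²)` with
`r̄ ≥ sup r`, `s̄ ≥ sup √m` (both exist: summable sequences tend to zero, `Filter.Tendsto.bddAbove_range`). [folklore] -/
theorem gmEntropy_bounded_of_summable (hr : ∀ K, 0 ≤ r K) (hm : ∀ K, 0 ≤ m K) {W W' : ℝ}
    (hw : ∀ K, 0 ≤ w K ∧ w K ≤ W) (hw' : ∀ K, 0 ≤ w' K ∧ w' K ≤ W') (hsr : Summable r)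
    (hsm : Summable (fun K => Real.sqrt (m K))) :
    ∃ k₀, ∀ K, 0 ≤ gmEntropy r m w w' K ∧ gmEntropy r m w w' K ≤ k₀ := by
  obtain ⟨rbar, hrbar⟩ := hsr.tendsto_atTop_zero.bddAbove_range
  obtain ⟨sbar, hsbar⟩ := hsm.tendsto_atTop_zero.bddAbove_range
  refine ⟨2 * rbar + 2 * W' + Real.sqrt (W * sbar ^ 2), fun K =>
    gmEntropy_bounds ⟨hr K, hrbar ⟨K, rfl⟩⟩ (hw K) (hw' K) ⟨hm K, ?_⟩⟩
  calc m K = Real.sqrt (m K) ^ 2 := (Real.sq_sqrt (hm K)).symm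
    _ ≤ sbar ^ 2 := pow_le_pow_left₀ (Real.sqrt_nonneg _) (hsbar ⟨K, rfl⟩) 2

/-- **GM-CLAUSE ⇒ M-CLAUSE FROM SIGNS ONLY** (`r, m, m', w' ≥ 0` — clauses of, or immediate from, the shape NE7-SGM; no
weight bound, no entropy bound): `Summable (gmRate r m m' w w') → Summable (mRate (r²+m) (r²+m'))`. [folklore] -/
theorem summable_mRate_sq_add_of_summable_gmRate (hr : ∀ K, 0 ≤ r K) (hm : ∀ K, 0 ≤ m K) (hm' : ∀ K, 0 ≤ m' K)
    (hw' : ∀ K, 0 ≤ w' K) (h : Summable (gmRate r m m' w w')) :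
    Summable (mRate (fun K => r K ^ 2 + m K) (fun K => r K ^ 2 + m' K)) := by
  obtain ⟨hsr, hsmom⟩ := (summable_gmRate_iff hr (fun K => le_max_of_le_left (hm K))).1 h
  have hk0 : ∀ K, 0 ≤ gmEntropy r m w w' K := fun K => gmEntropy_nonneg (hr K) (hw' K)
  refine (summable_mRate_sq_add_iff hr hm hm').2 ⟨hsr, ?_, ?_⟩
  · exact Summable.of_nonneg_of_le (fun K => Real.sqrt_nonneg _) (fun K => sqrt_le_momentRate_left (hk0 K)) hsmom
  · exact Summable.of_nonneg_of_le (fun K => Real.sqrt_nonneg _) (fun K => sqrt_le_momentRate_right (hk0 K)) hsmom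

/-- **GM ⇔ M AT CLAUSE LEVEL FROM WEIGHT BOUNDS ALONE.**  For `r, m, m' ≥ 0` and BOUNDED bad-set weight majorants
`0 ≤ w_K ≤ W`, `0 ≤ w'_K ≤ W'`: `Summable (gmRate r m m' w w') ↔ Summable (mRate (r²+m) (r²+m'))` — the bounded-entropy
hypothesis of `summable_gmRate_iff_summable_mRate` (§4.2) is produced by the right-hand clause itself
(`gmEntropy_bounded_of_summable`).  The ladder step NE7-SGM ⇒ NE7-M (`effTiltMoment_of_effTiltSandwichGM`) loses nothing at
clause level, unconditionally in the entropy. [folklore] -/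
theorem summable_gmRate_iff_summable_mRate_of_weights_le (hr : ∀ K, 0 ≤ r K) (hm : ∀ K, 0 ≤ m K)
    (hm' : ∀ K, 0 ≤ m' K) {W W' : ℝ} (hw : ∀ K, 0 ≤ w K ∧ w K ≤ W) (hw' : ∀ K, 0 ≤ w' K ∧ w' K ≤ W') :
    Summable (gmRate r m m' w w') ↔ Summable (mRate (fun K => r K ^ 2 + m K) (fun K => r K ^ 2 + m' K)) := by
  refine ⟨summable_mRate_sq_add_of_summable_gmRate hr hm hm' (fun K => (hw' K).1), fun h => ?_⟩
  obtain ⟨hsr, hsm, -⟩ := (summable_mRate_sq_add_iff hr hm hm').1 h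
  obtain ⟨k₀, hk⟩ := gmEntropy_bounded_of_summable hr hm hw hw' hsr hsm
  exact (summable_gmRate_iff_summable_mRate hr hm hm' hk).2 h

/-- Normalising the first weight majorant can only LOWER the produced entropy: `m_K ≥ 0` ⇒
`gmEntropy r m (min w 1) w' K ≤ gmEntropy r m w w' K`. [folklore] -/
theorem gmEntropy_min_one_le (hm : 0 ≤ m K) :
    gmEntropy r m (fun K => min (w K) 1) w' K ≤ gmEntropy r m w w' K := by
  unfold gmEntropy
  have : Real.sqrt (min (w K) 1 * m K) ≤ Real.sqrt (w K * m K) :=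
    Real.sqrt_le_sqrt (mul_le_mul_of_nonneg_right (min_le_left _ _) hm)
  linarith

/-- … hence can only LOWER the produced rate: `gmRate r m m' (min w 1) w' K ≤ gmRate r m m' w w' K` (`m_K ≥ 0`).
[folklore] -/
theorem gmRate_min_one_le (hm : 0 ≤ m K) :
    gmRate r m m' (fun K => min (w K) 1) w' K ≤ gmRate r m m' w w' K := by
  unfold gmRate
  refine Real.sqrt_le_sqrt (add_le_add le_rfl ?_)
  exact mul_le_mul_of_nonneg_left (Real.exp_le_exp.2 (gmEntropy_min_one_le hm)) (le_max_of_le_left hm)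

/-! ### §4.5 at the level of the shape NE7-SGM: no hypothesis beyond the shape (`β_K ≥ 0` for the normalisation) -/

section SchemeSelfFunding

open T4VarianceMatching Missing T4Continuum T4LimitLaw
open T4PathVarianceRate (EffTiltSandwichGM)

variable {G : Type*} {O : Type*} {S : TorusScheme G O} [MeasurableSpace G] {X : Type*} [MeasurableSpace X]
  (F : UnitFactorisation S X) [GaugeGroup G] [HaarData G]

/-- The SIGNS AND THE ONE BOUND carried by an instance of NE7-SGM (bookkeeping, no estimate): `0 ≤ r_K` (a clause),
`0 ≤ m_K`, `0 ≤ m'_K` (tail second moments of squares are nonnegative), `0 ≤ w_K`, `0 ≤ w'_K` (measure masses are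
nonnegative) and `w'_K ≤ ½` (a clause).  (The consumer `T4ApexCanonical` v1.3 §9.1 reads off the signs alone, downstream, as
`T4ApexCanonical.effTiltSandwichGM_signs`; this upstream copy adds the bound and feeds §4.5 only.) [folklore] -/
theorem effTiltSandwichGM_signBounds (h : EffTiltSandwichGM F r m m' w w') (K : ℕ) :
    0 ≤ r K ∧ 0 ≤ m K ∧ 0 ≤ m' K ∧ 0 ≤ w K ∧ 0 ≤ w' K ∧ w' K ≤ 1 / 2 := by
  obtain ⟨f, κ, Gd, -, hGd, -, hr0, -, -, hm, hm', hw, hw', hw'h⟩ := h K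
  exact ⟨hr0, (setIntegral_nonneg hGd.compl fun u _ => sq_nonneg _).trans hm,
    (setIntegral_nonneg hGd.compl fun u _ => sq_nonneg _).trans hm', measureReal_nonneg.trans hw,
    measureReal_nonneg.trans hw', hw'h⟩

/-- **GM ⇔ M UNDER THE SHAPE, given any bound `w_K ≤ W` on the first weight majorant** (every other sign/bound is read off
NE7-SGM). [folklore] -/
theorem summable_gmRate_iff_summable_mRate_of_effTiltSandwichGM (h : EffTiltSandwichGM F r m m' w w') {W : ℝ}
    (hwW : ∀ K, w K ≤ W) :
    Summable (gmRate r m m' w w') ↔ Summable (mRate (fun K => r K ^ 2 + m K) (fun K => r K ^ 2 + m' K)) :=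
  summable_gmRate_iff_summable_mRate_of_weights_le (fun K => (effTiltSandwichGM_signBounds F h K).1)
    (fun K => (effTiltSandwichGM_signBounds F h K).2.1) (fun K => (effTiltSandwichGM_signBounds F h K).2.2.1)
    (fun K => ⟨(effTiltSandwichGM_signBounds F h K).2.2.2.1, hwW K⟩)
    (fun K => ⟨(effTiltSandwichGM_signBounds F h K).2.2.2.2.1, (effTiltSandwichGM_signBounds F h K).2.2.2.2.2⟩)

/-- **GM-CLAUSE ⇒ M-CLAUSE UNDER THE SHAPE, NO FURTHER HYPOTHESIS.** [folklore] -/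
theorem summable_mRate_sq_add_of_effTiltSandwichGM (h : EffTiltSandwichGM F r m m' w w')
    (hs : Summable (gmRate r m m' w w')) :
    Summable (mRate (fun K => r K ^ 2 + m K) (fun K => r K ^ 2 + m' K)) :=
  summable_mRate_sq_add_of_summable_gmRate (fun K => (effTiltSandwichGM_signBounds F h K).1)
    (fun K => (effTiltSandwichGM_signBounds F h K).2.1) (fun K => (effTiltSandwichGM_signBounds F h K).2.2.1)
    (fun K => (effTiltSandwichGM_signBounds F h K).2.2.2.2.1) hs

variable [RegularGaugeGroup G]

/-- **NORMALISING THE FIRST BAD-SET WEIGHT MAJORANT**: an instance of NE7-SGM stays an instance with `w ↦ min(w, 1)` — the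
effective laws are probability measures (`β_K ≥ 0`, instance `[RegularGaugeGroup G]`, through `F.isProbabilityMeasure_effLaw`), so
`effLaw_K(Gdᶜ) ≤ 1`. [folklore] -/
theorem effTiltSandwichGM_min_one (hβ : ∀ K, 0 ≤ S.β K) (h : EffTiltSandwichGM F r m m' w w') :
    EffTiltSandwichGM F r m m' (fun K => min (w K) 1) w' := by
  intro K
  obtain ⟨f, κ, Gd, hf, hGd, hR, hr0, hr, heq, hm, hm', hw, hw', hw'h⟩ := h K
  haveI := F.isProbabilityMeasure_effLaw hβ K
  exact ⟨f, κ, Gd, hf, hGd, hR, hr0, hr, heq, hm, hm', le_min hw measureReal_le_one, hw', hw'h⟩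

/-- **M-CLAUSE ⇔ GM-CLAUSE OF THE NORMALISED INSTANCE, NO FURTHER HYPOTHESIS** (`β_K ≥ 0`; instance `[RegularGaugeGroup G]`).
[folklore] -/
theorem summable_gmRate_min_one_iff_of_effTiltSandwichGM (hβ : ∀ K, 0 ≤ S.β K) (h : EffTiltSandwichGM F r m m' w w') :
    Summable (gmRate r m m' (fun K => min (w K) 1) w') ↔
      Summable (mRate (fun K => r K ^ 2 + m K) (fun K => r K ^ 2 + m' K)) :=
  summable_gmRate_iff_summable_mRate_of_effTiltSandwichGM F (effTiltSandwichGM_min_one F hβ h) fun _ => min_le_right _ _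

/-- **THE EXISTENTIAL FORM: NE7-SGM MAY CARRY THE CLAUSE OF THE NE7-M IT PRODUCES.**  Over a unit factorisation with
`β_K ≥ 0`: (∃ inputs, `Summable gmRate` ∧ NE7-SGM) ↔ (∃ inputs, `Summable (mRate (r²+m) (r²+m'))` ∧ NE7-SGM) — an honest
equivalence of hypothesis SHAPES (the witness changes only by `w ↦ min(w,1)`), no entropy or weight side condition.
(Instance `[RegularGaugeGroup G]`, through `F.isProbabilityMeasure_effLaw`.) [folklore] -/
theorem exists_effTiltSandwichGM_summable_iff (hβ : ∀ K, 0 ≤ S.β K) :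
    (∃ r m m' w w' : ℕ → ℝ, Summable (gmRate r m m' w w') ∧ EffTiltSandwichGM F r m m' w w') ↔
      (∃ r m m' w w' : ℕ → ℝ, Summable (mRate (fun K => r K ^ 2 + m K) (fun K => r K ^ 2 + m' K)) ∧
        EffTiltSandwichGM F r m m' w w') := by
  constructor
  · rintro ⟨r, m, m', w, w', hs, h⟩
    exact ⟨r, m, m', w, w', summable_mRate_sq_add_of_effTiltSandwichGM F h hs, h⟩
  · rintro ⟨r, m, m', w, w', hs, h⟩
    exact ⟨r, m, m', _, w', (summable_gmRate_min_one_iff_of_effTiltSandwichGM F hβ h).2 hs,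
      effTiltSandwichGM_min_one F hβ h⟩

end SchemeSelfFunding

/-! ### §4.6 (v1.5) The clause of NE7-M reached from NE7-V is the V-clause (t4-lean's upstream ask, gen 22)

HOSTED VERBATIM (one-writer rule: this leaf is the home of the `mRate` clause lemmas).  `T4PathVarianceRate` v1.4 §8.6
(`effTiltMoment_of_effPathVarianceRate`, `canonicalEffTiltMoment_of_canonicalEffPathVarianceRate`, t4-ne7-p3) turns NE7-V with
rate `v` into NE7-M with moments `(M, M') = (v², 2v²(1+v²))`; the clause `hasContinuumLimit_of_effTiltMoment` consumes is
`Summable (mRate M M')`, i.e. by §4.2's unconditional `summable_mRate_iff` the pair `Summable √(v²) ∧ Summable √(2v²(1+v²))` — and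
THIS HOLDS IFF `Summable v` (real sequences, no sign hypothesis: `√(v²) = |v|`, and a summable sequence is bounded, `|v| ≤ B`,
whence `√(2v²(1+v²)) ≤ √(2(1+B²))·|v|`).  So the M-clause PRODUCED from a V-instance is the V-clause (`summable_mRate_sq_iff`),
the sibling of §4.2's `summable_mRate_sq_add_iff` («the clause of NE7-M reached from NE7-SGM»).  The four declarations below —
`summable_sqrt_sq_iff`, `sqrt_two_mul_sq_le`, `summable_mRate_sq_iff`, `summable_mRate_sq_of_summable` — are the kernel-checked
text offered by t4-lean gen 22 (journal NOTE l.59216; file `HOME/b2b-balaban-t4-lean/gen22/clause/MRateSqClause.lean`, sha256[:16]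
548ba115ff23cbba, statements and proofs byte-identical), hosted here at its request; the consumer binds them BY NAME downstream
(`T4ApexCanonical2`, t4-lean: the census edge NE7-V ⇒ NE7-M becomes the kernel iff `CanonicalTiltMomentUnder ↔
CanonicalPathVarianceUnder` under the targets' prefix, clauses included — typed THERE, not here; nothing of `T4ApexCanonical` is
restated and no import changes).  Hypothesis-shape bookkeeping at rung (B)+1 on one finite torus: which NOT-PRINTED NE7 currencies
are interchangeable under the prefix; no currency is produced for Bałaban's scheme; NOT an estimate; NOT summit progress.
[folklore] real analysis. -/

section ClauseFromV

variable {v : ℕ → ℝ}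

/-- `√(v²) = |v|`, hence `Summable √(v_K²) ↔ Summable v` (real sequences). [folklore] -/
theorem summable_sqrt_sq_iff : Summable (fun K => Real.sqrt (v K ^ 2)) ↔ Summable v := by
  have e : (fun K => Real.sqrt (v K ^ 2)) = fun K => |v K| := funext fun K => Real.sqrt_sq_eq_abs (v K)
  rw [e]
  exact summable_abs_iff

/-- `√(2v²(1+v²)) ≤ √(2(1+B²))·|v|` whenever `|v| ≤ B`. [folklore] -/
theorem sqrt_two_mul_sq_le {x B : ℝ} (hB : |x| ≤ B) :
    Real.sqrt (2 * x ^ 2 * (1 + x ^ 2)) ≤ Real.sqrt (2 * (1 + B ^ 2)) * |x| := by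
  have hB0 : 0 ≤ B := (abs_nonneg x).trans hB
  have hxB : x ^ 2 ≤ B ^ 2 := by
    have := sq_abs x
    nlinarith [abs_nonneg x, hB]
  have hr : (0 : ℝ) ≤ Real.sqrt (2 * (1 + B ^ 2)) * |x| := mul_nonneg (Real.sqrt_nonneg _) (abs_nonneg _)
  rw [Real.sqrt_le_left hr]
  have hx2 : |x| ^ 2 = x ^ 2 := sq_abs x
  have hs : Real.sqrt (2 * (1 + B ^ 2)) ^ 2 = 2 * (1 + B ^ 2) := Real.sq_sqrt (by positivity)
  nlinarith [hs, hx2, hxB, sq_nonneg x]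

/-- **THE M-CLAUSE PRODUCED FROM A V-INSTANCE IS THE V-CLAUSE**: for every real sequence `v`,
`Summable (mRate (v²) (2v²(1+v²))) ↔ Summable v` — the clause of `T4PathVarianceRate.hasContinuumLimit_of_effTiltMoment` at the
moments `(v², 2v²(1+v²))` produced by `T4PathVarianceRate.effTiltMoment_of_effPathVarianceRate` (v1.4 §8.6) holds iff the V-clause
`Summable v` does.  No sign hypothesis. [folklore] -/
theorem summable_mRate_sq_iff :
    Summable (mRate (fun K => v K ^ 2) (fun K => 2 * v K ^ 2 * (1 + v K ^ 2))) ↔ Summable v := by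
  rw [summable_mRate_iff, summable_sqrt_sq_iff]
  refine ⟨fun h => h.1, fun hv => ⟨hv, ?_⟩⟩
  obtain ⟨B, hB⟩ := hv.abs.tendsto_atTop_zero.bddAbove_range
  have hB' : ∀ K, |v K| ≤ B := fun K => by
    have := hB ⟨K, rfl⟩
    simpa using this
  exact Summable.of_nonneg_of_le (fun K => Real.sqrt_nonneg _) (fun K => sqrt_two_mul_sq_le (hB' K))
    (hv.abs.mul_left _)

/-- One-way form with the name the consumer's docstring anticipated (`T4ApexCanonical` v1.4 l.1738–1740). [folklore] -/
theorem summable_mRate_sq_of_summable (hv : Summable v) :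
    Summable (mRate (fun K => v K ^ 2) (fun K => 2 * v K ^ 2 * (1 + v K ^ 2))) :=
  summable_mRate_sq_iff.2 hv

end ClauseFromV

end Moment

/-! ## §5 (v1.4) THE FIELD-LEVEL CURRENCY NE7-H: LINEAR IN THE WEIGHT, POINTWISE IN THE FIELD — what the weight slot
## `W_K` of `T4PathVarianceRate.EffTermHybrid` (v1.5 §9, t4-ne7-p3 gen 8, p191671) can and cannot carry (GEN 17,
## unit `b2b-balaban-t4-ne7-p2-g17`)

THE RIDER OF §1–§4 IN THE FOURTH CURRENCY.  The field-level hybrid NE7-H asks, at every number of steps `K` and AT EVERY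
unit-lattice field `u`, for a hybrid sandwich `T4HybridMatching.HybridSandwich T (Gd u) (a · u) (b · u) c (r K) (W K)` of the
two runs' term DENSITIES with ONE field-independent relative bad-class weight `0 ≤ W_K < 1`, and produces the rate
`fieldHybridRate r W K = r_K − log(1 − W_K)`.  Its CONSUMER NOTE (journal LANDED l.58106: «CONSUMER NOTE (t4-lean `T4ApexCanonical`;
t4-ne7-p2 `T4PathVarianceWeightSplit`): nothing to rebind») asks nothing of this leaf; this section types
what the weight route has to say about the slot `W_K` — three things, all [folklore] real / `Finset` arithmetic, no estimate.

(5.1) THE EXACT SPLIT IS LINEAR.  For `r_K ≥ 0`, `0 ≤ W_K < 1`: `Summable (fieldHybridRate r W) ↔ Summable r ∧ Summable W`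
(`summable_fieldHybridRate_iff`; `W_K ≤ −log(1 − W_K) ≤ 2W_K` eventually, `T4HybridMatching.le_neg_log_one_sub` /
`summable_neg_log_one_sub`).  So the weight clause of NE7-H is the LINEAR clause `Σ W_K < ∞` — for banked weights
`W_K = V·ρ^{ageCut C′ K}` exactly the window `1 < C′·(−log ρ)` of the endpoint / density currencies (`summable_bankedWeight_iff`),
HALF of the doubled window `2 < C′·(−log ρ)` that the secant (§3) and crude-moment (§4.4) currencies charge for the same
weights (`fieldHybrid_linear_window`: in the strip `1 < C′·(−log ρ) ≤ 2` NE7-H's rate IS summable while `weightRate` and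
`√(bankedTailMoment)` are NOT, by `linear_window_not_secant_window` / `linear_window_not_moment_window`).  In the weight
coordinate NE7-H is the cheapest law-level currency on the node.

(5.2) THE FLOORS TRANSPORT VERBATIM.  `W_K ≤ fieldHybridRate r W K` (`weight_le_fieldHybridRate`), so every floor theorem of
this lineage applies to the slot BY NAME: a positive eventual floor (`not_summable_fieldHybridRate_of_floor`), the FINAL-SCALE
floor along endpoint-normalised runs (`not_summable_fieldHybridRate_of_finalScale_floor`, from
`T4ShellSuppressionRoute.not_summable_of_finalScale_floor`), and the WINDOW-LEVEL floor — a bad slot minorised by the one-run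
size `e^{−p₀(g_{sel K})}` of ANY level `jlogOf C K ≤ sel K ≤ K` of the log window is not summable in `K`
(`not_summable_fieldHybridRate_of_windowLevel_floor`, from `T4BookingNecessity.not_summable_exp_neg_p0Profile_select`).
Suppression SIZE books no shell of the window into `W_K`, in this currency as in the three before it.

(5.3) POINTWISE IN THE FIELD, THE SLOT IS A FEASIBILITY CONDITION FIRST.  New in this currency: `W_K` bounds the bad fraction
AT EVERY FIELD, so before any summability the sandwich must EXIST fieldwise with `W_K < 1`.  Elementary consequences of
`HybridSandwich` (this namespace; the structure is `T4HybridMatching`'s and is not modified): the good class keeps the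
fraction `1 − W` of each run's pointwise mass (`hybrid_sum_good_ge_left/right`), hence is charged by BOTH runs at once — some
good term has both densities positive (`hybrid_exists_good_pos`); the slot dominates the pointwise bad fraction
(`hybrid_badFraction_le`) and `1 − η ≤ W` as soon as a class of bad terms carries the fraction `1 − η` of one run's mass at ONE
field (`hybrid_one_sub_le_weight`, `hybrid_one_le_weight_of_good_null`); and if at some field no term is charged by both runs
(«disjoint supports») there is NO hybrid sandwich with `W < 1` at that field, for any good class and any constants
(`not_hybridSandwich_of_disjoint_support`).  The toy `thresholdMismatch_disjoint` / `not_hybridSandwich_thresholdMismatch`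
shows the hypothesis is met VERBATIM by history-labelled terms cut with SHARP characteristic functions at two different
thresholds, at every field of the shell between them.  PRECISION (the owner of NE7-H, t4-ne7-p3 gen 9, journal l.58720 (2), concurred):
`EffTermHybrid` is EXISTENTIAL in the decomposition at every `K` and is witnessed by the ONE-TERM decomposition of NE7-S
(`T4PathVarianceRate.effTermHybrid_of_effTiltSandwich`), so per-`K` feasibility of the SHAPE is a property of the two effective LAWS;
the support-disjointness obstruction constrains the TERM-WISE, history-labelled instantiation with sharp final-level characteristic
functions (the carved reading, DICTIONARY (a) below), not the law-level shape NE7-H.  Its positive counterpart for SMOOTHED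
characteristic functions is §6 (v1.5).

(5.4) AT THE LEVEL OF THE SHAPE, no hypothesis beyond it: NE7-H's clause `Σ_K fieldHybridRate r W K < ∞` IS the split clause
`Summable r ∧ Summable W` (`summable_fieldHybridRate_iff_of_effTermHybrid`, `exists_effTermHybrid_summable_iff` — the clause the
consumer `T4ApexCanonical` v1.4 §10.2 types for `CanonicalTermHybridUnder`), and every instance exhibits, at every field, a good
term charged by both runs (`exists_common_good_support_of_effTermHybrid`).

DICTIONARY [analysis, NOT PRINTED — no two-run comparison of Bałaban's large-field expansions exists in print at any level,
[Balaban1989LargeFieldII] p. 356, referee file T4-REF-U5 F2; nothing below this paragraph's kernel content is asserted for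
Bałaban's data].  At field level the bad class of the carved reading is indexed by large-field HISTORIES, and its two
species separate.  (a) The FINAL-level indicator shell (NE7c at level `K`: the unit-lattice fields small for one run's last
characteristic function and large for the other's — a threshold mismatch `p₀(g_K^A) ≠ p₀(g_K^B)`, or any mismatch of the last
restrictions) is a SET OF FIELDS `u`; with the sharp characteristic functions of [Balaban1988Convergent] (1.1) p. 246 the two
runs' nonvanishing term densities at such `u` carry DIFFERENT final-level labels, the supports are disjoint label by label,
and (5.3) says no `W_K < 1` exists there: the final-level shell is NOT A WEIGHT at field level — not bookable in `W_K` at any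
price, summable or not — but a FEASIBILITY obstruction, removed only by DESIGN: (η) smoothed / averaged thresholds (node U5b's
(η)-design, record `t4/T4-EST-U5bE2.md`), under which both runs charge every field and the mismatch becomes a term-wise
ratio, i.e. part of `r_K`; or (ii′) identical final-level restrictions on matched histories (the final couplings of two
endpoint-normalised runs AGREE, `T4ShellSuppressionRoute.sq_endpoint` — a node-U5d alignment, not a printed fact).  (b) The
shells of the YOUNGER integrated levels `jlogOf C K ≤ j < K` are classes of TERMS at fixed `u`; their pointwise relative
weight is the CONDITIONAL shell mass given the unit-lattice field, which `W_K` must dominate UNIFORMLY in `u` (5.3,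
`hybrid_badFraction_le` at every field) — bookable only by a conditional level-rate (the (M1)-shape `κ K j ≤ D(K − j)·θ^j` of
`T4ShellSuppressionRoute` §4, conditioned on `u`; owner ne7c-p1; NOT PRINTED), never by suppression size (5.2).  So in the
H currency the weight route's standing finding splits cleanly: LINEAR price for whatever conditional level-rate the node
supplies (5.1), NO price at all for the final-level shell, which must be designed away before the currency is even defined
(5.3).  `BetaPertH`, (B), (B^μ) occur in no declaration; NOT an estimate; NOT summit progress. -/

section FieldHybrid

open T4PathVarianceRate (fieldHybridRate EffTermHybrid)
open T4HybridMatching (HybridSandwich le_neg_log_one_sub neg_log_one_sub_nonneg summable_neg_log_one_sub)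
open T4ShellSuppressionRoute (not_summable_of_finalScale_floor)
open T4BookingNecessity (not_summable_exp_neg_p0Profile_select)
open T4GoodClassBudget (jlogOf)

/-! ### §5.1 The exact split of the field-level rate: linear in the weight -/

/-- `−log(1 − W_K) ≤ fieldHybridRate r W K` for `r_K ≥ 0`. [folklore] -/
theorem neg_log_one_sub_le_fieldHybridRate {W : ℕ → ℝ} (hr : 0 ≤ r K) :
    -Real.log (1 - W K) ≤ fieldHybridRate r W K := by
  unfold fieldHybridRate
  linarith

/-- **The weight slot is BELOW the produced rate**: `W_K ≤ fieldHybridRate r W K` for `r_K ≥ 0`, `W_K < 1`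
(`x ≤ −log(1 − x)`, `T4HybridMatching.le_neg_log_one_sub`). [folklore] -/
theorem weight_le_fieldHybridRate {W : ℕ → ℝ} (hr : 0 ≤ r K) (h1 : W K < 1) : W K ≤ fieldHybridRate r W K :=
  (le_neg_log_one_sub h1).trans (neg_log_one_sub_le_fieldHybridRate hr)

/-- `Σ_K (−log(1 − W_K)) < ∞ ↔ Σ_K W_K < ∞` for `0 ≤ W_K < 1` (the converse of `T4HybridMatching.summable_neg_log_one_sub`
is the comparison `W_K ≤ −log(1 − W_K)`). [folklore] -/
theorem summable_neg_log_one_sub_iff {W : ℕ → ℝ} (h0 : ∀ K, 0 ≤ W K) (h1 : ∀ K, W K < 1) :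
    Summable (fun K => -Real.log (1 - W K)) ↔ Summable W :=
  ⟨fun hs => Summable.of_nonneg_of_le h0 (fun K => le_neg_log_one_sub (h1 K)) hs, summable_neg_log_one_sub h0 h1⟩

/-- **THE EXACT SPLIT OF NE7-H's RATE: LINEAR IN THE WEIGHT.**  For `r_K ≥ 0` and `0 ≤ W_K < 1`:
`Σ_K fieldHybridRate r W K < ∞ ↔ Σ r_K < ∞ ∧ Σ W_K < ∞`.  (P3's `summable_fieldHybridRate` is the direction `⇐`.) [folklore] -/
theorem summable_fieldHybridRate_iff (hr : ∀ K, 0 ≤ r K) {W : ℕ → ℝ} (h0 : ∀ K, 0 ≤ W K) (h1 : ∀ K, W K < 1) :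
    Summable (fieldHybridRate r W) ↔ Summable r ∧ Summable W := by
  have hf : fieldHybridRate r W = fun K => r K + -Real.log (1 - W K) := by
    funext K
    simp only [fieldHybridRate]
    ring
  refine ⟨fun hs => ⟨?_, ?_⟩, fun h => ?_⟩
  · rw [hf] at hs
    exact Summable.of_nonneg_of_le hr
      (fun K => le_add_of_nonneg_right (neg_log_one_sub_nonneg (h0 K) (h1 K))) hs
  · rw [hf] at hs
    exact (summable_neg_log_one_sub_iff h0 h1).1
      (Summable.of_nonneg_of_le (fun K => neg_log_one_sub_nonneg (h0 K) (h1 K))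
        (fun K => le_add_of_nonneg_left (hr K)) hs)
  · rw [hf]
    exact h.1.add (summable_neg_log_one_sub h0 h1 h.2)

/-- **BANKED WEIGHTS IN THE H CURRENCY: THE LINEAR WINDOW.**  For a summable nonnegative term-wise input `r` and banked
weights `W_K = V·ρ^{ageCut C′ K}` (`0 < V < 1`, `0 < ρ < 1`, `C′ ≥ 0`): `Σ_K fieldHybridRate r W K < ∞ ↔ 1 < C′·(−log ρ)` —
the window of `summable_bankedWeight_iff`, i.e. of the endpoint / density currencies. [folklore] -/
theorem summable_fieldHybridRate_banked_iff (hr : ∀ K, 0 ≤ r K) (hrs : Summable r) {V ρ C' : ℝ} (hV : 0 < V)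
    (hV1 : V < 1) (h0 : 0 < ρ) (h1 : ρ < 1) (hC' : 0 ≤ C') :
    Summable (fieldHybridRate r (bankedWeight V ρ C')) ↔ 1 < C' * (-Real.log ρ) := by
  have hw0 : ∀ K, 0 ≤ bankedWeight V ρ C' K := bankedWeight_nonneg hV.le h0.le
  have hw1 : ∀ K, bankedWeight V ρ C' K < 1 := fun K => (bankedWeight_le hV.le h0.le h1.le K).trans_lt hV1
  rw [summable_fieldHybridRate_iff hr hw0 hw1, summable_bankedWeight_iff hV h0 h1 hC']
  exact ⟨fun h => h.2, fun h => ⟨hrs, h⟩⟩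

/-- **STRICT SEPARATION, FIELD FORM: NE7-H CHARGES HALF THE WINDOW OF §3 / §4.4.**  In the strip `1 < C′·(−log ρ) ≤ 2` the
banked weights fund NE7-H's rate (any summable `r ≥ 0`) while the secant weight half `weightRate` (bounded range `Λ = 1`,
`C = 0`, any entropy input `k ≥ 0`) and the root of the crude tail `√(bankedTailMoment)` are NOT summable
(`linear_window_not_secant_window`, `linear_window_not_moment_window`). [folklore] -/
theorem fieldHybrid_linear_window (hr : ∀ K, 0 ≤ r K) (hrs : Summable r) {R₀ V ρ C' : ℝ} (hR₀ : 0 < R₀) (hV : 0 < V)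
    (hV1 : V < 1) (h0 : 0 < ρ) (h1 : ρ < 1) (hC' : 0 ≤ C') (hlo : 1 < C' * (-Real.log ρ))
    (hhi : C' * (-Real.log ρ) ≤ 2) (hk : ∀ K, 0 ≤ k K) :
    Summable (fieldHybridRate r (bankedWeight V ρ C')) ∧
      ¬ Summable (weightRate (bankedRange R₀ 1 0) (bankedWeight V ρ C') (bankedWeight V ρ C') k) ∧
      ¬ Summable (fun K => Real.sqrt (bankedTailMoment R₀ 1 0 V ρ C' K)) :=
  ⟨(summable_fieldHybridRate_banked_iff hr hrs hV hV1 h0 h1 hC').2 hlo,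
    (linear_window_not_secant_window hR₀ hV h0 h1 hC' hlo hhi hk).2,
    (linear_window_not_moment_window hR₀ hV h0 h1 hC' hlo hhi).2⟩

/-! ### §5.2 The lineage's floors, transported to the slot `W_K` by name -/

/-- A non-summable admissible weight kills NE7-H's clause, for every `r ≥ 0`. [folklore] -/
theorem not_summable_fieldHybridRate_of_not_summable (hr : ∀ K, 0 ≤ r K) {W : ℕ → ℝ} (h0 : ∀ K, 0 ≤ W K)
    (h1 : ∀ K, W K < 1) (hW : ¬ Summable W) : ¬ Summable (fieldHybridRate r W) :=
  fun hs => hW ((summable_fieldHybridRate_iff hr h0 h1).1 hs).2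

/-- **A POSITIVE EVENTUAL FLOOR ON THE SLOT KILLS THE CLAUSE** (`T4ShellSuppressionRoute.not_summable_of_floor`): if
`W_K ≥ c > 0` eventually then `fieldHybridRate r W` is not summable, for every `r ≥ 0`. [folklore] -/
theorem not_summable_fieldHybridRate_of_floor {c : ℝ} (hc : 0 < c) (hr : ∀ K, 0 ≤ r K) {W : ℕ → ℝ}
    (h1 : ∀ K, W K < 1) (h : ∀ᶠ K in atTop, c ≤ W K) : ¬ Summable (fieldHybridRate r W) :=
  not_summable_of_floor hc (h.mono fun K hK => hK.trans (weight_le_fieldHybridRate (hr K) (h1 K)))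

/-- **THE FINAL-SCALE FLOOR IN THE H CURRENCY** (`T4ShellSuppressionRoute.not_summable_of_finalScale_floor` by name).  Along
endpoint-normalised runs (`Step.Discrete031 b β′ K g (gs K)` for every cutoff `K`), a slot minorised by a positive multiple of
the final-level one-run size `exp(−p₀(gs K K)) = exp(−p₀(g))` is not summable: NE7-H's clause is unfundable by a producer whose
bad class books the unit-scale large-field event by its size. [folklore] -/
theorem not_summable_fieldHybridRate_of_finalScale_floor {b β' g : ℝ} (A₀ : ℝ) (p₀ : ℕ) {gs : ℕ → ℕ → ℝ}
    (h031 : ∀ K, Step.Discrete031 b β' K g (gs K)) {c : ℝ} (hc : 0 < c) (hr : ∀ K, 0 ≤ r K) {W : ℕ → ℝ}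
    (h1 : ∀ K, W K < 1) (hfloor : ∀ K, c * Real.exp (-(p0Profile A₀ p₀ (gs K K))) ≤ W K) :
    ¬ Summable (fieldHybridRate r W) :=
  not_summable_of_finalScale_floor A₀ p₀ h031 hc fun K =>
    (hfloor K).trans (weight_le_fieldHybridRate (hr K) (h1 K))

/-- **THE WINDOW-LEVEL FLOOR IN THE H CURRENCY** (`T4BookingNecessity.not_summable_exp_neg_p0Profile_select` by name).
Along endpoint-normalised runs with `0 < g ≤ 1`, `b, β′, A₀, C ≥ 0`: if for every `K` the slot is minorised by `c·exp(−p₀(gs K (sel K)))`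
for SOME level `sel K` of the log window `jlogOf C K ≤ sel K ≤ K` (the one-run size of that level's indicator shell), then
`fieldHybridRate r W` is not summable, for every `r ≥ 0` — size-only booking of ANY shell of the window is excluded. [folklore] -/
theorem not_summable_fieldHybridRate_of_windowLevel_floor {b β' g C A₀ : ℝ} (hA : 0 ≤ A₀) (p₀ : ℕ) (hb : 0 ≤ b)
    (hβ : 0 ≤ β') (hg : 0 < g) (hg1 : g ≤ 1) (hC : 0 ≤ C) {gs : ℕ → ℕ → ℝ}
    (h031 : ∀ K, Step.Discrete031 b β' K g (gs K)) {sel : ℕ → ℕ} (hsel : ∀ K, jlogOf C K ≤ sel K ∧ sel K ≤ K)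
    {c : ℝ} (hc : 0 < c) (hr : ∀ K, 0 ≤ r K) {W : ℕ → ℝ} (h1 : ∀ K, W K < 1)
    (hfloor : ∀ K, c * Real.exp (-(p0Profile A₀ p₀ (gs K (sel K)))) ≤ W K) :
    ¬ Summable (fieldHybridRate r W) := by
  intro hs
  refine not_summable_exp_neg_p0Profile_select hA p₀ hb hβ hg hg1 hC h031 hsel (m := fun _ => 1)
    (fun _ => le_rfl) ?_
  refine Summable.of_nonneg_of_le (fun K => by positivity) (fun K => ?_) (hs.div_const c)
  rw [one_mul, le_div_iff₀ hc, mul_comm]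
  exact (hfloor K).trans (weight_le_fieldHybridRate (hr K) (h1 K))

/-! ### §5.3 Pointwise in the field: the slot is a feasibility condition (`HybridSandwich` arithmetic) -/

section Pointwise

variable {ι : Type*} [DecidableEq ι] {T Gd : Finset ι} {a b : ι → ℝ} {c s W : ℝ}

/-- The good class keeps the fraction `1 − W` of run A's mass: `(1 − W)·Σ_T a ≤ Σ_Gd a`. [folklore] -/
theorem hybrid_sum_good_ge_left (h : HybridSandwich T Gd a b c s W) :
    (1 - W) * ∑ τ ∈ T, a τ ≤ ∑ τ ∈ Gd, a τ := by
  have hA := Finset.sum_sdiff (f := a) h.subset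
  linarith [h.bad_left]

/-- … and of run B's: `(1 − W)·Σ_T b ≤ Σ_Gd b`. [folklore] -/
theorem hybrid_sum_good_ge_right (h : HybridSandwich T Gd a b c s W) :
    (1 - W) * ∑ τ ∈ T, b τ ≤ ∑ τ ∈ Gd, b τ := by
  have hB := Finset.sum_sdiff (f := b) h.subset
  linarith [h.bad_right]

/-- With `W < 1` and `Σ_T a > 0` the good class has positive run-A mass. [folklore] -/
theorem hybrid_sum_good_pos_left (h : HybridSandwich T Gd a b c s W) (hW : W < 1) (hpos : 0 < ∑ τ ∈ T, a τ) :
    0 < ∑ τ ∈ Gd, a τ :=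
  lt_of_lt_of_le (mul_pos (by linarith) hpos) (hybrid_sum_good_ge_left h)

/-- … and positive run-B mass (`HybridSandwich.sum_pos`). [folklore] -/
theorem hybrid_sum_good_pos_right (h : HybridSandwich T Gd a b c s W) (hW : W < 1) (hpos : 0 < ∑ τ ∈ T, a τ) :
    0 < ∑ τ ∈ Gd, b τ :=
  lt_of_lt_of_le (mul_pos (by linarith) (h.sum_pos hW hpos)) (hybrid_sum_good_ge_right h)

/-- **THE GOOD CLASS IS CHARGED BY BOTH RUNS AT ONCE**: under a hybrid sandwich with `W < 1` and `Σ_T a > 0` some good term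
has BOTH densities positive (a good term with `a_τ > 0` exists, and `b_τ ≥ e^{c−s}·a_τ > 0` there). [folklore] -/
theorem hybrid_exists_good_pos (h : HybridSandwich T Gd a b c s W) (hW : W < 1) (hpos : 0 < ∑ τ ∈ T, a τ) :
    ∃ τ ∈ Gd, 0 < a τ ∧ 0 < b τ := by
  have hex : ∃ τ ∈ Gd, 0 < a τ := by
    by_contra hne
    exact absurd (Finset.sum_nonpos fun τ hτ => not_lt.1 fun hlt => hne ⟨τ, hτ, hlt⟩)
      (not_le.2 (hybrid_sum_good_pos_left h hW hpos))
  obtain ⟨τ, hτ, ha⟩ := hex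
  exact ⟨τ, hτ, ha, lt_of_lt_of_le (mul_pos (Real.exp_pos _) ha) (h.lower τ hτ)⟩

/-- The slot dominates the bad FRACTION of run A's mass: `(Σ_{T∖Gd} a) / (Σ_T a) ≤ W`. [folklore] -/
theorem hybrid_badFraction_le (h : HybridSandwich T Gd a b c s W) (hpos : 0 < ∑ τ ∈ T, a τ) :
    (∑ τ ∈ T \ Gd, a τ) / ∑ τ ∈ T, a τ ≤ W :=
  (div_le_iff₀ hpos).2 h.bad_left

/-- **A BAD CLASS CARRYING THE FRACTION `1 − η` OF ONE RUN'S MASS FORCES `1 − η ≤ W`.**  If `I ⊆ T ∖ Gd` and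
`(1 − η)·Σ_T a ≤ Σ_I a` with `Σ_T a > 0`, then `1 − η ≤ W`. [folklore] -/
theorem hybrid_one_sub_le_weight (h : HybridSandwich T Gd a b c s W) {I : Finset ι} (hI : I ⊆ T \ Gd) {η : ℝ}
    (hfrac : (1 - η) * ∑ τ ∈ T, a τ ≤ ∑ τ ∈ I, a τ) (hpos : 0 < ∑ τ ∈ T, a τ) : 1 - η ≤ W := by
  have h1 : ∑ τ ∈ I, a τ ≤ ∑ τ ∈ T \ Gd, a τ :=
    Finset.sum_le_sum_of_subset_of_nonneg hI fun τ hτ _ => h.nonneg_left τ (Finset.mem_sdiff.1 hτ).1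
  exact le_of_mul_le_mul_right (hfrac.trans (h1.trans h.bad_left)) hpos

/-- If the good class carries NONE of run A's (positive) mass then `1 ≤ W`: no admissible slot. [folklore] -/
theorem hybrid_one_le_weight_of_good_null (h : HybridSandwich T Gd a b c s W) (hnull : ∑ τ ∈ Gd, a τ = 0)
    (hpos : 0 < ∑ τ ∈ T, a τ) : 1 ≤ W := by
  have hA := Finset.sum_sdiff (f := a) h.subset
  have := hybrid_one_sub_le_weight h (Finset.Subset.refl (T \ Gd)) (η := 0) (by linarith) hpos
  linarith

/-- **DISJOINT SUPPORTS ADMIT NO HYBRID SANDWICH WITH `W < 1`.**  If no good term is charged by both runs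
(`a_τ > 0 ⇒ b_τ ≤ 0` on `Gd`) and `Σ_T a > 0`, then `HybridSandwich T Gd a b c s W` fails for EVERY `c`, `s` and every
`W < 1`. [folklore] -/
theorem not_hybridSandwich_of_disjoint_support (hdis : ∀ τ ∈ Gd, 0 < a τ → b τ ≤ 0) (hW : W < 1)
    (hpos : 0 < ∑ τ ∈ T, a τ) : ¬ HybridSandwich T Gd a b c s W := fun h => by
  obtain ⟨τ, hτ, ha, hb⟩ := hybrid_exists_good_pos h hW hpos
  exact absurd (hdis τ hτ ha) (not_le.2 hb)

end Pointwise

/-! ### §5.3′ Toy: sharp characteristic functions at two thresholds are support-disjoint on the shell -/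

section ThresholdToy

variable {Y : Type*} (PA PB : Y → Prop) [DecidablePred PA] [DecidablePred PB] (φA ψA φB ψB : Y → ℝ)

/-- TOY DENSITIES (bookkeeping, nothing printed): two history labels (`true` = «large at the final level», `false` = «small»);
run A declares a field `u` large iff `PA u`, run B iff `PB u`, each with a SHARP characteristic function, carrying densities
`φ` on its large history and `ψ` on its small history. [folklore] -/
def thresholdDensity (P : Y → Prop) [DecidablePred P] (φ ψ : Y → ℝ) : Bool → Y → ℝ :=
  fun τ u => if τ then (if P u then φ u else 0) else (if P u then 0 else ψ u)

/-- On the SHELL `PA u ∧ ¬PB u` (large for run A's threshold, small for run B's) the two runs' densities are support-disjoint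
LABEL BY LABEL: whichever label run A charges at `u`, run B does not. [folklore] -/
theorem thresholdMismatch_disjoint {u : Y} (hu : PA u ∧ ¬ PB u) (τ : Bool) :
    0 < thresholdDensity PA φA ψA τ u → thresholdDensity PB φB ψB τ u ≤ 0 := by
  cases τ <;> simp [thresholdDensity, hu.1, hu.2]

/-- Hence at every field of the shell where run A's large-history density is positive there is NO hybrid sandwich of the
two label families with `W < 1` — for any good class `Gd`, any constant `c` and any term-wise remainder `s`: the final-level
indicator shell is a feasibility obstruction for NE7-H, not a weight. [folklore] -/
theorem not_hybridSandwich_thresholdMismatch {u : Y} (hu : PA u ∧ ¬ PB u) (hφ : 0 < φA u) (Gd : Finset Bool)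
    {c s W : ℝ} (hW : W < 1) :
    ¬ HybridSandwich Finset.univ Gd (fun τ => thresholdDensity PA φA ψA τ u)
      (fun τ => thresholdDensity PB φB ψB τ u) c s W :=
  not_hybridSandwich_of_disjoint_support (fun τ _ => thresholdMismatch_disjoint PA PB φA ψA φB ψB hu τ) hW
    (by simp [thresholdDensity, hu.1, hφ])

end ThresholdToy

/-! ### §5.4 At the level of the shape NE7-H: the clause is the split clause; feasibility at every field -/

section SchemeLevel

open T4VarianceMatching Missing T4Continuum T4LimitLaw

variable {G : Type*} {O : Type*} {S : TorusScheme G O} [MeasurableSpace G] {X : Type*} [MeasurableSpace X]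
  {F : UnitFactorisation S X} [GaugeGroup G] [HaarData G]

/-- The SIGNS carried by an instance of NE7-H (bookkeeping): `0 ≤ r_K`, `0 ≤ W_K < 1` are clauses of the shape. [folklore] -/
theorem effTermHybrid_signBounds {W : ℕ → ℝ} (h : EffTermHybrid F r W) (K : ℕ) : 0 ≤ r K ∧ 0 ≤ W K ∧ W K < 1 := by
  obtain ⟨_, _, _, _, _, _, _, hr, hW0, hW1, _⟩ := h K
  exact ⟨hr, hW0, hW1⟩

/-- **UNDER THE SHAPE, NE7-H's CLAUSE IS THE SPLIT CLAUSE**: `Summable (fieldHybridRate r W) ↔ Summable r ∧ Summable W` for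
every instance of `EffTermHybrid F r W`, no hypothesis beyond the shape (`summable_fieldHybridRate_iff` at the shape's signs).  So
the consumer's prefixed form (`T4ApexCanonical` v1.4 §10.2 `CanonicalTermHybridUnder`: clause `Summable r ∧ Summable W`, the
hypotheses of `T4PathVarianceRate.hasContinuumLimit_of_canonicalEffTermHybrid`) and the rate form `Σ_K fieldHybridRate r W K < ∞`
carry the same content. [folklore] -/
theorem summable_fieldHybridRate_iff_of_effTermHybrid {W : ℕ → ℝ} (h : EffTermHybrid F r W) :
    Summable (fieldHybridRate r W) ↔ Summable r ∧ Summable W :=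
  summable_fieldHybridRate_iff (fun K => (effTermHybrid_signBounds h K).1) (fun K => (effTermHybrid_signBounds h K).2.1)
    fun K => (effTermHybrid_signBounds h K).2.2

variable (F) in
/-- Existence form: (∃ inputs, `Summable (fieldHybridRate r W)` ∧ NE7-H) ↔ (∃ inputs, (`Summable r ∧ Summable W`) ∧ NE7-H).
[folklore] -/
theorem exists_effTermHybrid_summable_iff :
    (∃ r W : ℕ → ℝ, Summable (fieldHybridRate r W) ∧ EffTermHybrid F r W) ↔
      ∃ r W : ℕ → ℝ, (Summable r ∧ Summable W) ∧ EffTermHybrid F r W := by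
  constructor
  · rintro ⟨r, W, hs, h⟩
    exact ⟨r, W, (summable_fieldHybridRate_iff_of_effTermHybrid h).1 hs, h⟩
  · rintro ⟨r, W, hs, h⟩
    exact ⟨r, W, (summable_fieldHybridRate_iff_of_effTermHybrid h).2 hs, h⟩

/-- **EVERY INSTANCE OF NE7-H EXHIBITS, AT EVERY FIELD, A GOOD TERM CHARGED BY BOTH RUNS** (unpacking + `hybrid_exists_good_pos`):
the two runs' term densities of an `EffTermHybrid` presentation are never support-disjoint on the good class at any
unit-lattice field — the feasibility content of the slot `W_K < 1`, prior to and independent of `Σ W_K < ∞`. [folklore] -/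
theorem exists_common_good_support_of_effTermHybrid {W : ℕ → ℝ} (h : EffTermHybrid F r W) (K : ℕ) :
    ∃ (T : Finset ℕ) (Gd : X → Finset ℕ) (a b : ℕ → X → ℝ) (c : ℝ),
      (∀ u, HybridSandwich T (Gd u) (fun τ => a τ u) (fun τ => b τ u) c (r K) (W K)) ∧
      F.effLaw (K + 1) = (F.effLaw K).tilted (fun u => Real.log (∑ τ ∈ T, b τ u) - Real.log (∑ τ ∈ T, a τ u)) ∧
      ∀ u, ∃ τ ∈ Gd u, 0 < a τ u ∧ 0 < b τ u := by
  obtain ⟨T, Gd, a, b, c, -, -, -, -, hW1, hpos, hhyb, heq⟩ := h K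
  exact ⟨T, Gd, a, b, c, hhyb, heq, fun u => hybrid_exists_good_pos (hhyb u) hW1 (hpos u)⟩

end SchemeLevel

end FieldHybrid

/-! ## §6 (v1.5) COLLAR DISCARD: THE POSITIVE COUNTERPART OF (5.3) — with SMOOTHED final-level thresholds the pattern-labelled
## hybrid sandwich IS feasible at every field, with a field-dependent good class, at a price linear in the discarded collar
## mass (GEN 18, unit `b2b-balaban-t4-ne7-p2-g18`)

THE DESIGN CONDITION (5.3) ASKS FOR, MADE QUANTITATIVE.  (5.3) showed: history-labelled term densities cut with SHARP characteristic
functions at two different final-level thresholds are support-disjoint on the shell, so NO hybrid sandwich with `W < 1` exists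
there — the final-level shell must be designed away ((η): smoothed thresholds, record `t4/T4-EST-U5bE2.md`; the (η) member's
Lipschitz-smoothed pattern layers are on the tree since `T4AgeZeroLayer` / `T4PatternLayer`, pv07).  This section types what the
smoothing BUYS at field level, in `T4HybridMatching.HybridSandwich`'s own terms, by [folklore] `Finset` algebra — no estimate, no
floor, no anti-concentration, no suppression input:

(6.1) PATTERNS ARE A PARTITION OF UNITY.  A finite SLOT set `S` (the final-level blocks), one run's smoothed small-field factors
`φ : S → [0,1]`, and for a pattern `P ⊆ S` (the slots declared LARGE) the weight
`patWeight S φ P = (∏_{□ ∈ P} (1 − φ □)) · ∏_{□ ∈ S ∖ P} φ □`; then `Σ_{P ⊆ S} patWeight S φ P = ∏_{□ ∈ S} ((1 − φ □) + φ □) = 1`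
(`sum_powerset_patWeight`, `Finset.prod_add`; NO hypothesis).

(6.2) COLLAR DISCARD.  Run A decides, slot by slot, to DISCARD one polarity: `Dt ⊆ S` (the large polarity is discarded: its factor
`1 − φ_A □` is below a cut `t₀`), `Df ⊆ S` (the small polarity is discarded), `Dt ∩ Df = ∅`; the GOOD patterns are those avoiding
every discarded polarity, `collarGood S Dt Df = {P ⊆ S : P ∩ Dt = ∅, Df ⊆ P}` — a FIELD-DEPENDENT good class (the discard is read
off run A's field; `T4PathVarianceRate.EffTermHybrid`'s good class `Gd u` is allowed to depend on the field).  The good patterns'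
total weight is the product of the kept factors (`sum_collarGood_patWeight`, a masked `Finset.prod_add`), so the BAD weight is
`1 − ∏(1 − x_□) ≤ Σ x_□` (`one_sub_prod_le_sum`), `x_□` = the discarded factor: `Σ_{bad P} patWeight ≤ Σ_{□ ∈ Dt} (1 − φ □) + Σ_{□ ∈ Df} φ □`
(`sum_bad_patWeight_le`) — linear in the discarded COLLAR MASS, slot by slot.

(6.3) THE SANDWICH.  If off the discard the two runs' polarity factors are matched modulo `e^{± s_□}` (`e^{−s□} φ_A ≤ φ_B ≤ e^{s□} φ_A`
on `S ∖ Df`, the same for `1 − φ` on `S ∖ Dt`), the discarded factors of BOTH runs are `≤ δ_□`, and the pattern-independent old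
factors satisfy `e^{c−r₀} ψ_A ≤ ψ_B ≤ e^{c+r₀} ψ_A`, `ψ_A ≥ 0`, then
`HybridSandwich S.powerset (collarGood S Dt Df) (patWeight S φ_A · ψ_A) (patWeight S φ_B · ψ_B) c (r₀ + Σ_{□∈S} s_□) (Σ_{□∈Dt} δ_□ + Σ_{□∈Df} δ_□)`
(`hybridSandwich_of_collarDiscard`): term-wise remainder = the sum of the slot tolerances, weight slot = the discarded collar mass.
With SHARP factors (`φ ∈ {0,1}`) at two different thresholds no `s_□ < ∞` exists on the shell and (5.3) is recovered; with no
discard (`Dt = Df = ∅`) the statement is U5b's term-wise matching (`T4HybridMatching.prod_sandwich`) with `W = 0`.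

(6.4) THE RAMP DICTIONARY.  If the two runs' factors at a slot differ by at most `η` (`|φ_B − φ_A| ≤ η`: thresholds `λ` apart read
through a ramp of width `w` give `η = λ/w`) and run A discards the polarity whose factor is `< t₀`, `η < t₀`, then off the discard
the ratio is matched with `s = η/(t₀ − η)` and the discarded factors are `≤ t₀ + η` in both runs (`collar_dictionary`,
from `1 + x ≤ eˣ`); the choice `t₀ = √η` (`η ≤ 1/4`) makes BOTH prices `≤ 2√η` (`collar_sqrt_budget`), so along the ladder
`Σ_K √η_K < ∞` funds `Σ_K s_K < ∞` and `Σ_K δ_K < ∞` at once (`summable_collar_budget`).  At the FINAL level the slot count `N` does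
not depend on `K` (one fixed torus), so the increments `N·s_K` of `vol·δ_K` and `N·(t₀+η_K)` of `W_K` are summable and `W_K < 1`
eventually from the ramp data ALONE: in the H currency the final-level shell, once smoothed, costs `Σ_K √(λ_K/w_K) < ∞` — a condition
on the DESIGN (threshold mismatch over ramp width), which is what (η) has to meet; the suppression of the collar event (a (B)-type
weight, [Balaban1988LargeFieldI] in kind) would only improve the constant after integration and is not needed for feasibility or
summability here.  The YOUNGER levels are untouched by this section: their slot counts grow like `L^{4(K−j)}` and their shells stay
the conditional mass of (5.3)(b), bookable only by a conditional level-rate ((M1) given `u`, ne7c-p1; NOT PRINTED).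
[analysis of hypothesis shapes; nothing is asserted for Bałaban's expansions — no two-run comparison of the large-field expansions
exists in print, [Balaban1989LargeFieldII] p. 356, T4-REF-U5 F2; `BetaPertH`, (B), (B^μ) occur in no declaration; NOT an estimate;
NOT summit progress.] -/

section CollarDiscard

open T4HybridMatching (HybridSandwich prod_sandwich)

variable {σ : Type*} [DecidableEq σ]

/-! ### §6.1 Pattern weights: a partition of unity over the powerset -/

/-- The PATTERN WEIGHT of `P ⊆ S` (the slots declared large) for smoothed small-field factors `φ`:
`(∏_{□ ∈ P} (1 − φ □)) · ∏_{□ ∈ S ∖ P} φ □`. [folklore] -/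
def patWeight (S : Finset σ) (φ : σ → ℝ) (P : Finset σ) : ℝ :=
  (∏ i ∈ P, (1 - φ i)) * ∏ i ∈ S \ P, φ i

/-- **PARTITION OF UNITY**: `Σ_{P ⊆ S} patWeight S φ P = 1`, for ANY real `φ` (`Finset.prod_add` with `(1 − φ) + φ = 1`).
[folklore] -/
theorem sum_powerset_patWeight (S : Finset σ) (φ : σ → ℝ) : ∑ P ∈ S.powerset, patWeight S φ P = 1 := by
  unfold patWeight
  rw [← Finset.prod_add]
  simp

/-- Pattern weights are nonnegative for factors in `[0,1]`. [folklore] -/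
theorem patWeight_nonneg {S P : Finset σ} {φ : σ → ℝ} (h0 : ∀ i ∈ S, 0 ≤ φ i) (h1 : ∀ i ∈ S, φ i ≤ 1) (hP : P ⊆ S) :
    0 ≤ patWeight S φ P :=
  mul_nonneg (Finset.prod_nonneg fun i hi => sub_nonneg.mpr (h1 i (hP hi)))
    (Finset.prod_nonneg fun i hi => h0 i (Finset.mem_sdiff.mp hi).1)

/-- `1 − ∏_{□∈S} k □ ≤ Σ_{□∈S} (1 − k □)` for `k □ ∈ [0,1]` (the union bound behind the collar price). [folklore] -/
theorem one_sub_prod_le_sum (S : Finset σ) {k : σ → ℝ} (h0 : ∀ i ∈ S, 0 ≤ k i) (h1 : ∀ i ∈ S, k i ≤ 1) :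
    1 - ∏ i ∈ S, k i ≤ ∑ i ∈ S, (1 - k i) := by
  induction S using Finset.induction_on with
  | empty => simp
  | insert a s ha ih =>
    rw [Finset.prod_insert ha, Finset.sum_insert ha]
    have h0' : ∀ i ∈ s, 0 ≤ k i := fun i hi => h0 i (Finset.mem_insert_of_mem hi)
    have h1' : ∀ i ∈ s, k i ≤ 1 := fun i hi => h1 i (Finset.mem_insert_of_mem hi)
    have hP0 : 0 ≤ ∏ i ∈ s, k i := Finset.prod_nonneg h0'
    have hP1 : ∏ i ∈ s, k i ≤ 1 := Finset.prod_le_one h0' h1'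
    have ha0 : 0 ≤ k a := h0 a (Finset.mem_insert_self a s)
    have ha1 : k a ≤ 1 := h1 a (Finset.mem_insert_self a s)
    nlinarith [ih h0' h1', mul_nonneg (sub_nonneg.mpr ha1) (sub_nonneg.mpr hP1)]

/-! ### §6.2 The collar discard: a field-dependent good class and the linear price of the bad patterns -/

/-- The GOOD PATTERNS of the collar discard `(Dt, Df)`: `P ⊆ S` using no discarded polarity — `P ∩ Dt = ∅` (the large
polarity of the slots in `Dt` is discarded) and `Df ⊆ P` (the small polarity of the slots in `Df` is discarded). [folklore] -/
def collarGood (S Dt Df : Finset σ) : Finset (Finset σ) :=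
  S.powerset.filter fun P => Disjoint P Dt ∧ Df ⊆ P

/-- The KEPT FACTOR of a slot under the discard: `φ □` on `Dt`, `1 − φ □` on `Df`, `1` elsewhere. [folklore] -/
def keptFac (Dt Df : Finset σ) (φ : σ → ℝ) (i : σ) : ℝ :=
  if i ∈ Dt then φ i else if i ∈ Df then 1 - φ i else 1

/-- The good patterns are patterns (`collarGood S Dt Df ⊆ S.powerset`). [folklore] -/
theorem collarGood_subset (S Dt Df : Finset σ) : collarGood S Dt Df ⊆ S.powerset := Finset.filter_subset _ _

/-- Membership in the good class: `P ⊆ S`, `P ∩ Dt = ∅`, `Df ⊆ P`. [folklore] -/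
theorem mem_collarGood {S Dt Df P : Finset σ} : P ∈ collarGood S Dt Df ↔ P ⊆ S ∧ Disjoint P Dt ∧ Df ⊆ P := by
  simp [collarGood, Finset.mem_filter, Finset.mem_powerset]

/-- **THE GOOD WEIGHT IS THE PRODUCT OF THE KEPT FACTORS** (a masked `Finset.prod_add`): for disjoint `Dt, Df` with `Df ⊆ S`,
`Σ_{P ∈ collarGood S Dt Df} patWeight S φ P = ∏_{□ ∈ S} keptFac Dt Df φ □`. [folklore] -/
theorem sum_collarGood_patWeight {S Dt Df : Finset σ} (φ : σ → ℝ) (hDf : Df ⊆ S) (hdisj : Disjoint Dt Df) :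
    ∑ P ∈ collarGood S Dt Df, patWeight S φ P = ∏ i ∈ S, keptFac Dt Df φ i := by
  have key : ∏ i ∈ S, keptFac Dt Df φ i =
      ∏ i ∈ S, ((if i ∈ Dt then 0 else 1 - φ i) + (if i ∈ Df then 0 else φ i)) := by
    refine Finset.prod_congr rfl fun i _ => ?_
    unfold keptFac
    by_cases ht : i ∈ Dt
    · have hf : i ∉ Df := Finset.disjoint_left.mp hdisj ht
      simp [ht, hf]
    · by_cases hf : i ∈ Df
      · simp [ht, hf]
      · simp [ht, hf]
  rw [key, Finset.prod_add]
  unfold collarGood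
  rw [Finset.sum_filter]
  refine Finset.sum_congr rfl fun P hP => ?_
  split_ifs with hgood
  · unfold patWeight
    congr 1
    · exact Finset.prod_congr rfl fun i hi => by
        have : i ∉ Dt := Finset.disjoint_left.mp hgood.1 hi
        simp [this]
    · exact Finset.prod_congr rfl fun i hi => by
        have : i ∉ Df := fun h => (Finset.mem_sdiff.mp hi).2 (hgood.2 h)
        simp [this]
  · rw [not_and_or] at hgood
    rcases hgood with h | h
    · obtain ⟨i, hiP, hiD⟩ := Finset.not_disjoint_iff.mp h
      rw [Finset.prod_eq_zero hiP (by simp [hiD]), zero_mul]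
    · obtain ⟨i, hiD, hiP⟩ := Finset.not_subset.mp h
      rw [Finset.prod_eq_zero (Finset.mem_sdiff.mpr ⟨hDf hiD, hiP⟩) (by simp [hiD]), mul_zero]

/-- The kept factors lie in `[0,1]` and `1 − keptFac` is the discarded factor: `1 − φ □` on `Dt`, `φ □` on `Df`, `0` elsewhere.
[folklore] -/
theorem one_sub_keptFac_eq {Dt Df : Finset σ} (φ : σ → ℝ) (hdisj : Disjoint Dt Df) (i : σ) :
    1 - keptFac Dt Df φ i = (if i ∈ Dt then 1 - φ i else 0) + (if i ∈ Df then φ i else 0) := by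
  unfold keptFac
  by_cases ht : i ∈ Dt
  · have hf : i ∉ Df := Finset.disjoint_left.mp hdisj ht
    simp [ht, hf]
  · by_cases hf : i ∈ Df
    · simp [ht, hf]
    · simp [ht, hf]

/-- **THE LINEAR PRICE OF THE BAD PATTERNS**: for factors in `[0,1]` and a discard `Dt, Df ⊆ S`, `Dt ∩ Df = ∅`,
`Σ_{P ⊆ S, P ∉ collarGood} patWeight S φ P ≤ Σ_{□ ∈ Dt} (1 − φ □) + Σ_{□ ∈ Df} φ □` — the discarded collar mass, slot by slot
(`1 − ∏ kept ≤ Σ (1 − kept)`). [folklore] -/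
theorem sum_bad_patWeight_le {S Dt Df : Finset σ} {φ : σ → ℝ} (h0 : ∀ i ∈ S, 0 ≤ φ i) (h1 : ∀ i ∈ S, φ i ≤ 1)
    (hDt : Dt ⊆ S) (hDf : Df ⊆ S) (hdisj : Disjoint Dt Df) :
    ∑ P ∈ S.powerset \ collarGood S Dt Df, patWeight S φ P ≤ ∑ i ∈ Dt, (1 - φ i) + ∑ i ∈ Df, φ i := by
  rw [Finset.sum_sdiff_eq_sub (collarGood_subset S Dt Df), sum_powerset_patWeight, sum_collarGood_patWeight φ hDf hdisj]
  have hk0 : ∀ i ∈ S, 0 ≤ keptFac Dt Df φ i := fun i hi => by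
    unfold keptFac; split_ifs
    · exact h0 i hi
    · exact sub_nonneg.mpr (h1 i hi)
    · exact zero_le_one
  have hk1 : ∀ i ∈ S, keptFac Dt Df φ i ≤ 1 := fun i hi => by
    unfold keptFac; split_ifs
    · exact h1 i hi
    · exact sub_le_self _ (h0 i hi)
    · exact le_rfl
  refine (one_sub_prod_le_sum S hk0 hk1).trans (le_of_eq ?_)
  rw [Finset.sum_congr rfl fun i _ => one_sub_keptFac_eq φ hdisj i, Finset.sum_add_distrib, Finset.sum_ite_mem,
    Finset.sum_ite_mem, Finset.inter_eq_right.mpr hDt, Finset.inter_eq_right.mpr hDf]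

/-! ### §6.3 The hybrid sandwich of the collar discard -/

omit [DecidableEq σ] in
/-- Ratio matching multiplies (U5b's `prod_sandwich` with `c = 0`): `e^{−s□} φ □ ≤ ψ □ ≤ e^{s□} φ □`, `φ ≥ 0` on `t` give
`e^{−Σ s} ∏ φ ≤ ∏ ψ ≤ e^{Σ s} ∏ φ`. [folklore] -/
theorem prod_ratio_sandwich (t : Finset σ) {φ ψ s : σ → ℝ} (hφ : ∀ i ∈ t, 0 ≤ φ i)
    (hl : ∀ i ∈ t, Real.exp (-s i) * φ i ≤ ψ i) (hu : ∀ i ∈ t, ψ i ≤ Real.exp (s i) * φ i) :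
    Real.exp (-∑ i ∈ t, s i) * ∏ i ∈ t, φ i ≤ ∏ i ∈ t, ψ i ∧
      ∏ i ∈ t, ψ i ≤ Real.exp (∑ i ∈ t, s i) * ∏ i ∈ t, φ i := by
  have h := prod_sandwich t (c := fun _ => (0 : ℝ)) (r := s) hφ (fun i hi => by simpa using hl i hi)
    (fun i hi => by simpa using hu i hi)
  simpa using h

/-- **THE HYBRID SANDWICH OF THE COLLAR DISCARD** (the positive counterpart of (5.3)'s `not_hybridSandwich_thresholdMismatch`).
Slots `S`, a discard `Dt, Df ⊆ S`, `Dt ∩ Df = ∅`; the two runs' smoothed small-field factors `φA, φB : S → [0,1]`; off the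
discard the polarity factors are matched modulo `e^{± s□}` (`φ` on `S ∖ Df`, `1 − φ` on `S ∖ Dt`); the discarded factors of BOTH
runs are `≤ δ□`; the pattern-independent old factors satisfy `e^{c−r₀} ψA ≤ ψB ≤ e^{c+r₀} ψA` with `ψA ≥ 0`.  Then the pattern
families `P ↦ patWeight S φA P · ψA`, `P ↦ patWeight S φB P · ψB` on `S.powerset` satisfy `HybridSandwich` with the
FIELD-DEPENDENT good class `collarGood S Dt Df`, term-wise remainder `r₀ + Σ_{□∈S} s□` and weight `Σ_{□∈Dt} δ□ + Σ_{□∈Df} δ□`.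
No floor, no anti-concentration, no suppression enters. [folklore] -/
theorem hybridSandwich_of_collarDiscard {S Dt Df : Finset σ} {φA φB s δ : σ → ℝ} {ψA ψB c r₀ : ℝ}
    (hDt : Dt ⊆ S) (hDf : Df ⊆ S) (hdisj : Disjoint Dt Df)
    (hA0 : ∀ i ∈ S, 0 ≤ φA i) (hA1 : ∀ i ∈ S, φA i ≤ 1) (hB0 : ∀ i ∈ S, 0 ≤ φB i) (hB1 : ∀ i ∈ S, φB i ≤ 1)
    (hψA : 0 ≤ ψA) (hψl : Real.exp (c - r₀) * ψA ≤ ψB) (hψu : ψB ≤ Real.exp (c + r₀) * ψA)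
    (hsm : ∀ i ∈ S \ Df, Real.exp (-s i) * φA i ≤ φB i ∧ φB i ≤ Real.exp (s i) * φA i)
    (hlg : ∀ i ∈ S \ Dt, Real.exp (-s i) * (1 - φA i) ≤ 1 - φB i ∧ 1 - φB i ≤ Real.exp (s i) * (1 - φA i))
    (hdt : ∀ i ∈ Dt, 1 - φA i ≤ δ i ∧ 1 - φB i ≤ δ i) (hdf : ∀ i ∈ Df, φA i ≤ δ i ∧ φB i ≤ δ i) :
    HybridSandwich S.powerset (collarGood S Dt Df) (fun P => patWeight S φA P * ψA) (fun P => patWeight S φB P * ψB)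
      c (r₀ + ∑ i ∈ S, s i) (∑ i ∈ Dt, δ i + ∑ i ∈ Df, δ i) := by
  have hψB : 0 ≤ ψB := (mul_nonneg (Real.exp_pos _).le hψA).trans hψl
  -- `0 ≤ xᵢ ≤ yᵢ ⇒ x₁x₂x₃ ≤ y₁y₂y₃`
  have mml : ∀ {x₁ x₂ x₃ y₁ y₂ y₃ : ℝ}, 0 ≤ x₁ → 0 ≤ x₂ → 0 ≤ x₃ → x₁ ≤ y₁ → x₂ ≤ y₂ → x₃ ≤ y₃ →
      x₁ * x₂ * x₃ ≤ y₁ * y₂ * y₃ := fun h₁ h₂ h₃ e₁ e₂ e₃ =>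
    mul_le_mul (mul_le_mul e₁ e₂ h₂ (h₁.trans e₁)) e₃ h₃ (mul_nonneg (h₁.trans e₁) (h₂.trans e₂))
  -- the good patterns, factor-wise
  have good : ∀ P ∈ collarGood S Dt Df,
      Real.exp (c - (r₀ + ∑ i ∈ S, s i)) * (patWeight S φA P * ψA) ≤ patWeight S φB P * ψB ∧
        patWeight S φB P * ψB ≤ Real.exp (c + (r₀ + ∑ i ∈ S, s i)) * (patWeight S φA P * ψA) := by
    intro P hP
    obtain ⟨hPS, hPt, hfP⟩ := mem_collarGood.mp hP
    -- large polarity on P (P misses Dt), small polarity on S \ P (which misses Df)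
    have hLG := prod_ratio_sandwich P (φ := fun i => 1 - φA i) (ψ := fun i => 1 - φB i) (s := s)
      (fun i hi => sub_nonneg.mpr (hA1 i (hPS hi)))
      (fun i hi => (hlg i (Finset.mem_sdiff.mpr ⟨hPS hi, Finset.disjoint_left.mp hPt hi⟩)).1)
      (fun i hi => (hlg i (Finset.mem_sdiff.mpr ⟨hPS hi, Finset.disjoint_left.mp hPt hi⟩)).2)
    have hSM := prod_ratio_sandwich (S \ P) (φ := φA) (ψ := φB) (s := s)
      (fun i hi => hA0 i (Finset.mem_sdiff.mp hi).1)
      (fun i hi => (hsm i (Finset.mem_sdiff.mpr ⟨(Finset.mem_sdiff.mp hi).1,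
        fun h => (Finset.mem_sdiff.mp hi).2 (hfP h)⟩)).1)
      (fun i hi => (hsm i (Finset.mem_sdiff.mpr ⟨(Finset.mem_sdiff.mp hi).1,
        fun h => (Finset.mem_sdiff.mp hi).2 (hfP h)⟩)).2)
    have hsum : ∑ i ∈ P, s i + ∑ i ∈ S \ P, s i = ∑ i ∈ S, s i := by
      rw [add_comm]; exact Finset.sum_sdiff hPS
    have hπ1 : 0 ≤ ∏ i ∈ P, (1 - φA i) := Finset.prod_nonneg fun i hi => sub_nonneg.mpr (hA1 i (hPS hi))
    have hπ2 : 0 ≤ ∏ i ∈ S \ P, φA i := Finset.prod_nonneg fun i hi => hA0 i (Finset.mem_sdiff.mp hi).1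
    constructor
    · have e : Real.exp (c - (r₀ + ∑ i ∈ S, s i)) * (patWeight S φA P * ψA) =
          (Real.exp (-∑ i ∈ P, s i) * ∏ i ∈ P, (1 - φA i)) * (Real.exp (-∑ i ∈ S \ P, s i) * ∏ i ∈ S \ P, φA i) *
            (Real.exp (c - r₀) * ψA) := by
        have : Real.exp (c - (r₀ + ∑ i ∈ S, s i)) =
            Real.exp (-∑ i ∈ P, s i) * Real.exp (-∑ i ∈ S \ P, s i) * Real.exp (c - r₀) := by
          rw [← Real.exp_add, ← Real.exp_add]; congr 1; linarith
        rw [this]; unfold patWeight; ring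
      rw [e]
      calc _ ≤ (∏ i ∈ P, (1 - φB i)) * (∏ i ∈ S \ P, φB i) * ψB :=
            mml (mul_nonneg (Real.exp_pos _).le hπ1) (mul_nonneg (Real.exp_pos _).le hπ2)
              (mul_nonneg (Real.exp_pos _).le hψA) hLG.1 hSM.1 hψl
        _ = patWeight S φB P * ψB := by unfold patWeight; ring
    · have e : Real.exp (c + (r₀ + ∑ i ∈ S, s i)) * (patWeight S φA P * ψA) =
          (Real.exp (∑ i ∈ P, s i) * ∏ i ∈ P, (1 - φA i)) * (Real.exp (∑ i ∈ S \ P, s i) * ∏ i ∈ S \ P, φA i) *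
            (Real.exp (c + r₀) * ψA) := by
        have : Real.exp (c + (r₀ + ∑ i ∈ S, s i)) =
            Real.exp (∑ i ∈ P, s i) * Real.exp (∑ i ∈ S \ P, s i) * Real.exp (c + r₀) := by
          rw [← Real.exp_add, ← Real.exp_add]; congr 1; linarith
        rw [this]; unfold patWeight; ring
      rw [e]
      have hρ1 : 0 ≤ ∏ i ∈ P, (1 - φB i) := Finset.prod_nonneg fun i hi => sub_nonneg.mpr (hB1 i (hPS hi))
      have hρ2 : 0 ≤ ∏ i ∈ S \ P, φB i := Finset.prod_nonneg fun i hi => hB0 i (Finset.mem_sdiff.mp hi).1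
      calc patWeight S φB P * ψB = (∏ i ∈ P, (1 - φB i)) * (∏ i ∈ S \ P, φB i) * ψB := by unfold patWeight; ring
        _ ≤ _ := mml hρ1 hρ2 hψB hLG.2 hSM.2 hψu
  -- the bad patterns, by the linear price
  have badA := sum_bad_patWeight_le hA0 hA1 hDt hDf hdisj
  have badB := sum_bad_patWeight_le hB0 hB1 hDt hDf hdisj
  have hWA : ∑ i ∈ Dt, (1 - φA i) + ∑ i ∈ Df, φA i ≤ ∑ i ∈ Dt, δ i + ∑ i ∈ Df, δ i :=
    add_le_add (Finset.sum_le_sum fun i hi => (hdt i hi).1) (Finset.sum_le_sum fun i hi => (hdf i hi).1)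
  have hWB : ∑ i ∈ Dt, (1 - φB i) + ∑ i ∈ Df, φB i ≤ ∑ i ∈ Dt, δ i + ∑ i ∈ Df, δ i :=
    add_le_add (Finset.sum_le_sum fun i hi => (hdt i hi).2) (Finset.sum_le_sum fun i hi => (hdf i hi).2)
  exact
  { subset := collarGood_subset S Dt Df
    nonneg_left := fun P hP => mul_nonneg (patWeight_nonneg hA0 hA1 (Finset.mem_powerset.mp hP)) hψA
    nonneg_right := fun P hP => mul_nonneg (patWeight_nonneg hB0 hB1 (Finset.mem_powerset.mp hP)) hψB
    lower := fun P hP => (good P hP).1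
    upper := fun P hP => (good P hP).2
    bad_left := by
      rw [← Finset.sum_mul, ← Finset.sum_mul, sum_powerset_patWeight, one_mul]
      exact mul_le_mul_of_nonneg_right (badA.trans hWA) hψA
    bad_right := by
      rw [← Finset.sum_mul, ← Finset.sum_mul, sum_powerset_patWeight, one_mul]
      exact mul_le_mul_of_nonneg_right (badB.trans hWB) hψB }

/-- With NO discard every pattern is good (U5b's term-wise matching, weight slot `0`). [folklore] -/
theorem collarGood_empty (S : Finset σ) : collarGood S ∅ ∅ = S.powerset := by
  unfold collarGood
  simp

/-- The weight slot of the discard is at most the slot count times the largest discarded factor (the final level of one fixed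
torus has a `K`-independent slot count). [folklore] -/
theorem collar_weight_le_card_mul {S Dt Df : Finset σ} {δ : σ → ℝ} {d : ℝ} (hDt : Dt ⊆ S) (hDf : Df ⊆ S)
    (hdisj : Disjoint Dt Df) (hd : 0 ≤ d) (hδ : ∀ i ∈ S, δ i ≤ d) :
    ∑ i ∈ Dt, δ i + ∑ i ∈ Df, δ i ≤ (S.card : ℝ) * d := by
  rw [← Finset.sum_union hdisj]
  calc ∑ i ∈ Dt ∪ Df, δ i ≤ ∑ i ∈ Dt ∪ Df, d :=
        Finset.sum_le_sum fun i hi => hδ i (Finset.union_subset hDt hDf hi)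
    _ = ((Dt ∪ Df).card : ℝ) * d := by rw [Finset.sum_const, nsmul_eq_mul]
    _ ≤ (S.card : ℝ) * d :=
        mul_le_mul_of_nonneg_right (by exact_mod_cast Finset.card_le_card (Finset.union_subset hDt hDf)) hd

/-! ### §6.3′ Labelling by the discard datum: the good class becomes field-independent -/

/-- **LABELLING BY THE DISCARD DATUM MAKES THE GOOD CLASS FIELD-INDEPENDENT.**  A hybrid sandwich on `T` with good class
`G = Gd d₀` read off a datum `d₀ ∈ D` (at field level: run A's collar discard at the field `u`) is a hybrid sandwich on the
LABELLED index set `T ×ˢ D` whose densities carry the indicator of the datum (`(τ, d) ↦ [d = d₀]·a τ`) and whose good class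
`{(τ, d) : τ ∈ Gd d}` no longer depends on `d₀` — the form a field-uniform socket (one bad class for all fields) accepts; same
constants. [folklore] -/
theorem hybridSandwich_label {ι κ : Type*} [DecidableEq ι] [DecidableEq κ] {T G : Finset ι} {a b : ι → ℝ} {c r W : ℝ}
    {D : Finset κ} {d₀ : κ} (hd₀ : d₀ ∈ D) (Gd : κ → Finset ι) (hG : Gd d₀ = G) (h : HybridSandwich T G a b c r W) :
    HybridSandwich (T ×ˢ D) ((T ×ˢ D).filter fun p => p.1 ∈ Gd p.2)
      (fun p => if p.2 = d₀ then a p.1 else 0) (fun p => if p.2 = d₀ then b p.1 else 0) c r W := by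
  have tot : ∀ f : ι → ℝ, ∑ p ∈ T ×ˢ D, (if p.2 = d₀ then f p.1 else 0) = ∑ τ ∈ T, f τ := by
    intro f
    rw [Finset.sum_product]
    refine Finset.sum_congr rfl fun τ _ => ?_
    rw [Finset.sum_eq_single d₀ (fun d _ hd => by simp [hd]) (fun hd => absurd hd₀ hd)]
    simp
  have bad : ∀ f : ι → ℝ, ∑ p ∈ (T ×ˢ D) \ (T ×ˢ D).filter (fun p => p.1 ∈ Gd p.2),
      (if p.2 = d₀ then f p.1 else 0) = ∑ τ ∈ T \ G, f τ := by
    intro f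
    rw [← Finset.filter_not, Finset.sum_filter, Finset.sum_product, Finset.sdiff_eq_filter, Finset.sum_filter]
    refine Finset.sum_congr rfl fun τ _ => ?_
    rw [Finset.sum_eq_single d₀ (fun d _ hd => by simp [hd]) (fun hd => absurd hd₀ hd)]
    simp [hG]
  exact
  { subset := Finset.filter_subset _ _
    nonneg_left := fun p hp => by
      split_ifs
      · exact h.nonneg_left p.1 (Finset.mem_product.mp hp).1
      · exact le_rfl
    nonneg_right := fun p hp => by
      split_ifs
      · exact h.nonneg_right p.1 (Finset.mem_product.mp hp).1
      · exact le_rfl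
    lower := fun p hp => by
      obtain ⟨_, hpG⟩ := Finset.mem_filter.mp hp
      by_cases hp2 : p.2 = d₀
      · have hG' : p.1 ∈ G := by rw [← hG, ← hp2]; exact hpG
        simp only [if_pos hp2]
        exact h.lower p.1 hG'
      · simp only [if_neg hp2, mul_zero, le_refl]
    upper := fun p hp => by
      obtain ⟨_, hpG⟩ := Finset.mem_filter.mp hp
      by_cases hp2 : p.2 = d₀
      · have hG' : p.1 ∈ G := by rw [← hG, ← hp2]; exact hpG
        simp only [if_pos hp2]
        exact h.upper p.1 hG'
      · simp only [if_neg hp2, mul_zero, le_refl]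
    bad_left := by rw [bad, tot]; exact h.bad_left
    bad_right := by rw [bad, tot]; exact h.bad_right }

/-! ### §6.4 The ramp dictionary: mismatch `η`, cut `t₀`, prices `(η/(t₀ − η), t₀ + η)`; the choice `t₀ = √η` -/

/-- **THE RAMP DICTIONARY.**  Two runs' factors at a slot with `|y − x| ≤ η`, `0 ≤ η < t₀`: if run A KEEPS the polarity
(`t₀ ≤ x`) the ratio is matched, `e^{−η/(t₀−η)} x ≤ y ≤ e^{η/(t₀−η)} x`; if run A DISCARDS it (`x < t₀`) both factors are
`≤ t₀ + η`. [folklore] -/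
theorem collar_dictionary {x y η t₀ : ℝ} (hη0 : 0 ≤ η) (hη : η < t₀) (hxy : |y - x| ≤ η) :
    (t₀ ≤ x → Real.exp (-(η / (t₀ - η))) * x ≤ y ∧ y ≤ Real.exp (η / (t₀ - η)) * x) ∧
      (x < t₀ → x ≤ t₀ + η ∧ y ≤ t₀ + η) := by
  have h1 := (abs_le.mp hxy).1
  have h2 := (abs_le.mp hxy).2
  refine ⟨fun hx => ⟨?_, ?_⟩, fun hx => ⟨by linarith, by linarith⟩⟩
  · -- lower: e^{-s}·x ≤ (1 − η/t₀)·x ≤ x − η ≤ y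
    have ht0 : 0 < t₀ := lt_of_le_of_lt hη0 hη
    have hx0 : 0 ≤ x := ht0.le.trans hx
    -- `e^{−a}(1 + a) ≤ 1` from `1 + a ≤ eᵃ`
    have key : Real.exp (-(η / (t₀ - η))) * (1 + η / (t₀ - η)) ≤ 1 := by
      have h := Real.add_one_le_exp (η / (t₀ - η))
      have hpos := Real.exp_pos (-(η / (t₀ - η)))
      calc Real.exp (-(η / (t₀ - η))) * (1 + η / (t₀ - η))
          ≤ Real.exp (-(η / (t₀ - η))) * Real.exp (η / (t₀ - η)) := mul_le_mul_of_nonneg_left (by linarith) hpos.le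
        _ = 1 := by rw [← Real.exp_add, neg_add_cancel, Real.exp_zero]
    have hd : 0 < t₀ - η := by linarith
    have hne : t₀ - η ≠ 0 := hd.ne'
    have e1 : (1 + η / (t₀ - η)) = t₀ / (t₀ - η) := by
      rw [← div_self hne, ← add_div]
      congr 1; ring
    -- so exp(-s) ≤ (t₀ - η)/t₀
    have hexp : Real.exp (-(η / (t₀ - η))) ≤ (t₀ - η) / t₀ := by
      rw [e1] at key
      rw [le_div_iff₀ ht0]
      have h3 := mul_le_mul_of_nonneg_right key hd.le
      have e2 : Real.exp (-(η / (t₀ - η))) * (t₀ / (t₀ - η)) * (t₀ - η) = Real.exp (-(η / (t₀ - η))) * t₀ := by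
        rw [mul_assoc, div_mul_cancel₀ _ hne]
      linarith
    calc Real.exp (-(η / (t₀ - η))) * x ≤ (t₀ - η) / t₀ * x := mul_le_mul_of_nonneg_right hexp hx0
      _ ≤ x - η := by
          rw [div_mul_eq_mul_div, div_le_iff₀ ht0]
          nlinarith
      _ ≤ y := by linarith
  · -- upper: y ≤ x + η ≤ x(1 + η/t₀) ≤ x·e^{η/t₀} ≤ x·e^{η/(t₀-η)}
    have ht0 : 0 < t₀ := lt_of_le_of_lt hη0 hη
    have hx0 : 0 ≤ x := ht0.le.trans hx
    have hst : η / t₀ ≤ η / (t₀ - η) := div_le_div_of_nonneg_left hη0 (by linarith) (by linarith)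
    calc y ≤ x + η := by linarith
      _ ≤ x * (1 + η / t₀) := by
          rw [mul_add, mul_one, add_le_add_iff_left, mul_div_assoc']
          rw [le_div_iff₀ ht0]
          nlinarith
      _ ≤ x * Real.exp (η / t₀) := mul_le_mul_of_nonneg_left (by linarith [Real.add_one_le_exp (η / t₀)]) hx0
      _ ≤ x * Real.exp (η / (t₀ - η)) := mul_le_mul_of_nonneg_left (Real.exp_le_exp.mpr hst) hx0
      _ = Real.exp (η / (t₀ - η)) * x := mul_comm _ _

/-- **THE SQUARE-ROOT CUT**: with `t₀ = √η`, `0 ≤ η ≤ 1/4`, both prices are `≤ 2√η`: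
`η/(√η − η) ≤ 2√η` and `√η + η ≤ 2√η`. [folklore] -/
theorem collar_sqrt_budget {η : ℝ} (h0 : 0 ≤ η) (h4 : η ≤ 1 / 4) :
    η / (Real.sqrt η - η) ≤ 2 * Real.sqrt η ∧ Real.sqrt η + η ≤ 2 * Real.sqrt η := by
  have hs0 : 0 ≤ Real.sqrt η := Real.sqrt_nonneg η
  have hs2 : Real.sqrt η ≤ 1 / 2 := by
    rw [show (1:ℝ)/2 = Real.sqrt (1/4) by
      rw [show (1:ℝ)/4 = (1/2)^2 by norm_num, Real.sqrt_sq (by norm_num)]]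
    exact Real.sqrt_le_sqrt h4
  have hsq : Real.sqrt η * Real.sqrt η = η := Real.mul_self_sqrt h0
  have hηle : η ≤ Real.sqrt η / 2 := by nlinarith
  refine ⟨?_, by linarith⟩
  rcases eq_or_lt_of_le h0 with h | h
  · subst h; simp
  · have hsp : 0 < Real.sqrt η := Real.sqrt_pos.mpr h
    have hden : 0 < Real.sqrt η - η := by linarith
    rw [div_le_iff₀ hden]
    nlinarith

/-- **ALONG THE LADDER**: if `0 ≤ η_K ≤ 1/4` and `Σ_K √η_K < ∞` then both price sequences of the square-root cut are summable:
`Σ_K η_K/(√η_K − η_K) < ∞` (term-wise tolerances) and `Σ_K (√η_K + η_K) < ∞` (discarded factors). [folklore] -/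
theorem summable_collar_budget {η : ℕ → ℝ} (h0 : ∀ K, 0 ≤ η K) (h4 : ∀ K, η K ≤ 1 / 4)
    (hs : Summable fun K => Real.sqrt (η K)) :
    Summable (fun K => η K / (Real.sqrt (η K) - η K)) ∧ Summable (fun K => Real.sqrt (η K) + η K) := by
  have h2 : Summable fun K => 2 * Real.sqrt (η K) := hs.mul_left 2
  refine ⟨Summable.of_nonneg_of_le (fun K => ?_) (fun K => (collar_sqrt_budget (h0 K) (h4 K)).1) h2,
    Summable.of_nonneg_of_le (fun K => add_nonneg (Real.sqrt_nonneg _) (h0 K))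
      (fun K => (collar_sqrt_budget (h0 K) (h4 K)).2) h2⟩
  rcases eq_or_lt_of_le (h0 K) with h | h
  · rw [← h]; simp
  · have hs2 : Real.sqrt (η K) ≤ 1 / 2 := by
      rw [show (1:ℝ)/2 = Real.sqrt (1/4) by
        rw [show (1:ℝ)/4 = (1/2)^2 by norm_num, Real.sqrt_sq (by norm_num)]]
      exact Real.sqrt_le_sqrt (h4 K)
    have hsq : Real.sqrt (η K) * Real.sqrt (η K) = η K := Real.mul_self_sqrt (h0 K)
    have hsp : 0 < Real.sqrt (η K) := Real.sqrt_pos.mpr h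
    exact div_nonneg (h0 K) (by nlinarith)

/-- **THE FINAL-LEVEL SHELL, ONCE SMOOTHED, IS BOOKED BY THE RAMP DATA ALONE.**  `N` slots (the final level of ONE fixed torus:
`N` does not depend on `K`), mismatch-over-width `0 ≤ η_K ≤ 1/4` with `Σ_K √η_K < ∞`, square-root cut: the per-level term-wise
price `N·η_K/(√η_K − η_K)` and weight price `N·(√η_K + η_K)` are BOTH summable, and the weight price is eventually `< 1`
(feasibility of the slot, cf. (5.3)).  No suppression input. [folklore] -/
theorem collar_finalLevel_clause (N : ℕ) {η : ℕ → ℝ} (h0 : ∀ K, 0 ≤ η K) (h4 : ∀ K, η K ≤ 1 / 4)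
    (hs : Summable fun K => Real.sqrt (η K)) :
    Summable (fun K => (N : ℝ) * (η K / (Real.sqrt (η K) - η K))) ∧
      Summable (fun K => (N : ℝ) * (Real.sqrt (η K) + η K)) ∧
      ∀ᶠ K in atTop, (N : ℝ) * (Real.sqrt (η K) + η K) < 1 := by
  obtain ⟨h1, h2⟩ := summable_collar_budget h0 h4 hs
  exact ⟨h1.mul_left _, h2.mul_left _, (h2.mul_left (N : ℝ)).tendsto_atTop_zero.eventually (gt_mem_nhds zero_lt_one)⟩

end CollarDiscard

end Literature.MathematicalPhysics.QuantumFieldTheory.Balaban1983to89.T4PathVarianceWeightSplit
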